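import Mathlib.NumberTheory.LSeries.SumCoeff
import Mathlib.NumberTheory.LSeries.Dirichlet
import Mathlib.MeasureTheory.Integral.Prod
import Mathlib.Analysis.Complex.ReImTopology
import Literature.NumberTheory.LFunctions.BaezDuarteMoebiusConvolutionProofs
import Literature.NumberTheory.LFunctions.MoebiusHarmonicSumBound
import Literature.NumberTheory.LFunctions.GeneralizedRH
import Literature.NumberTheory.LFunctions.BaezDuarteSimpleZerosProofs
import Literature.Analysis.Complex.SchwarzReflection
import Literature.Analysis.Complex.UpperHalfPlaneSegmentUniqueness
import Literature.Analysis.Complex.HolomorphicParametricIntegral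
import Literature.NumberTheory.LFunctions.ZetaFirstZeroCertificate
import HarnessLib

/-!
# RH-EQUIVALENT · Báez-Duarte's Möbius-convolution criterion for ONE Mellin-proper test function — the named facts `BaezDuarte2005Moebius_thm_3_1` and (§7, appended) `BaezDuarte2005Moebius_thm_3_2` DISCHARGED; nothing here bears on the truth of RH

L. Báez-Duarte, *Möbius-convolutions and the Riemann hypothesis*, IJMMS 2005:22 (2005) 3599–3608 =
arXiv:math/0504402, **Thm. 3.1** (arXiv numbering; IJMMS Thm. 3.5), (3.14): with
`g(x) = Σ_{n ≤ x} μ(n)/n` (`moebiusDivSum`) and `Gφ(x) = ∫₀^∞ g(xt) φ(1/t) dt/t` (`moebiusConv`),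
"if `φ` is mellin-proper then RH ⟺ `Gφ(x) ≪ x^{−1/2+ε}`". This file proves
`theorem BaezDuarte2005Moebius_thm_3_1_holds : BaezDuarte2005Moebius_thm_3_1` for the statement AS
TYPED in `RieszTypeSeriesCriteria.lean` (seat `rh-lit-broughan-2`), where *proper* asks
`N_σ(φ) = ∫₀^∞ x^{−σ−1}|φ(x)| dx < ∞` only for `σ ∈ (−1/2, 0]` (the arXiv text has `(−1/2, 1]`).

## The printed argument and what the typed range forces

"⟹" is (3.12): Littlewood's `g(x) ≪ x^{−1/2+ε}` under RH and the majorant `|Gφ(x)| ≤ C N(φ) x^{−1/2+ε}`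
— already a theorem of the tree (`moebiusConv_isBigO_of_riemannHypothesis`,
`BaezDuarteMoebiusConvolutionProofs.lean`), valid for every proper `φ`.

"⟸" (§3.2 of the paper, Lemma 3.3: `(Gφ)^∧(s) = g^∧(s) φ^∧(s)` with `g^∧(s) = 1/(s ζ(s+1))`, (2.7)):
the bound `Gφ ≪ x^{−1/2+ε}` makes `(Gφ)^∧` holomorphic in the strip `−1/2 < Re s < 0`, and the
factorisation exhibits `φ^∧(s)/(Gφ)^∧(s)`-type continuation of `s ζ(s+1)`'s reciprocal; since
`φ^∧ ≠ 0` in the strip, `ζ(s+1) ≠ 0` there, i.e. `ζ ≠ 0` on `1/2 < Re < 1`, which is RH. With the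
printed properness range the factorisation holds on the OPEN strip `0 < Re s < 1` and one continues
by the identity theorem. With the TYPED range `(−1/2, 0]` the two Mellin transforms `g^∧`
(absolutely convergent for `Re s ≥ 0` only) and `φ^∧` (for `−1/2 < Re s ≤ 0` only) coexist on the
single LINE `Re s = 0`, so the proof below runs through the boundary:

1. (§1) `g` is bounded, measurable, and `∫₁^∞ |g(x)| dx/x < ∞` — the latter from the prime number
   theorem in the form `g(x) ≪ exp(−c√log x)` (tree: `abs_sum_moebius_div_le_exp_neg_sqrt_log`,
   de la Vallée-Poussin–Landau), which is Báez-Duarte's (2.5)–(2.6) `g ∈ L¹(ℝ×)`.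
2. (§2) Generalities on left-Mellin transforms `h^∧(s) = ∫₀^∞ x^{−s−1} h(x) dx` of measurable `h`
   with finite weighted norms: holomorphy in the open strip of finiteness (dominated holomorphic
   parameter integrals, tree `Literature.Analysis.Complex.differentiableOn_integral_of_dominated`)
   and continuity up to a closed edge (dominated convergence) = the paper's Lemma 2.1; the two
   multiplicative substitutions `x ↦ xt`, `t ↦ 1/t`.
3. (§3) Fubini: whenever `N_σ(g), N_σ(φ) < ∞` (here: `σ = 0`), `N_σ(Gφ) < ∞` and
   `(Gφ)^∧(s) = g^∧(s) φ^∧(s)` on `Re s = σ` (Lemma 3.1, (3.8)–(3.9): Young's inequality on `ℝ×`).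
4. (§4) (2.7): `ζ(s+1) · s g^∧(s) = 1` for `Re s > 0` (Abel summation, Mathlib
   `LSeries_eq_mul_integral` + `LSeries_one_mul_Lseries_moebius`), extended to `Re s = 0`, `s ≠ 0`
   by continuity (`ζ(1+iτ) ≠ 0`).
5. (§5) Boundary uniqueness on a strip: a function holomorphic on `{−1/2 < Re s < 0}`, continuous
   from the left at the points `iτ`, `1 < τ < 2`, and zero there, vanishes identically (Schwarz
   reflection, tree `Complex.differentiableOn_schwarzReflection`, + identity theorem; the segment
   avoids `s = 0`, where `s ζ(s+1)` has Mathlib's junk value).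
6. (§6) Assembly: `D(s) = (Gφ)^∧(s) · s ζ(s+1) − φ^∧(s)` is holomorphic in the strip (the bound at
   `∞` from the hypothesis, the bound at `0` from step 3 at `σ = 0`), continuous to the edge, and
   `D(iτ) = φ^∧(iτ)(g^∧(iτ) iτ ζ(1+iτ) − 1) = 0`; hence `D ≡ 0` — this is Lemma 3.3's (3.11)
   `(Gφ)^∧(s) = φ^∧(s)/(s ζ(s+1))` on `(−1/2, 0]`, whose printed proof is exactly "on account of
   (3.9) and Lemma 2.1 … then invoke analytic continuation" from the line `σ = 0` — so (3.13)
   `ζ(s+1) = 0 ⇒ φ^∧(s) = 0` (`BaezDuarteMellin.leftMellin_eq_zero_of_riemannZeta_eq_zero`, §8),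
   `ζ(s+1) ≠ 0` in the strip when `φ^∧ ≠ 0` there, and RH via
   `quasiRiemannHypothesis_one_half_iff_holds`.

7. (§7, appended) **Proposition 3.1** (`φ⋆(x) = Gφ(x)` for `x > 0` when `φ(z) = Σ_{n≥1} a_n z^n` is
   entire: termwise integration, `∫₀^∞ g(xt) t^{−n−1} dt = x^n/(n ζ(n+1))` by (2.7) at `s = n`,
   interchange justified by `∫|g(xt)| t^{−n−1} dt ≤ 2B x^n` and `Σ |a_n| x^n < ∞`), whence the
   **entire-function criterion Thm. 3.2 = Broughan Vol. 2 Thm 2.7**: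
   `theorem BaezDuarte2005Moebius_thm_3_2_holds : BaezDuarte2005Moebius_thm_3_2`.

8. (§8, appended) (3.13) for merely proper `φ`; `β^∧(s) = −Γ(1 − s/2)`, so the Hardy–Littlewood
   test function `β` is Mellin-proper (the hypothesis class of Thms 3.1/3.2 is inhabited).
9. (§9, appended) the published remark (IJMMS p. 3604): an entire `φ` vanishing at `0` with
   `φ(x) ≪ x^{−a}` for some `a ≥ 1/2` is proper.
10. (§10, appended) **Theorem 4.1** ("RHS": `Gφ(x) ≪ x^{−1/2}` without `ε`, for Mellin-proper
   `φ` with `φ^∧` continuous and non-vanishing on `Re s = −1/2`, implies RH AND the simplicity of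
   every zero of `ζ`): `theorem BaezDuarte2005Moebius_thm_4_1`, via (3.11)
   (`leftMellin_moebiusConv_mul_eq`), the uniform bound `|(Gφ)^∧(s)| ≤ A + C/(Re s + 1/2)`, and the
   tree's `deriv_ne_zero_of_mul_le_norm` / `deriv_riemannZeta_trivialZero_ne_zero`.
11. (§11, appended) **Theorem 2.2 (arXiv) = IJMMS Theorem 2.3**, the `L^p` form of Littlewood's
   criterion: `theorem BaezDuarte2005Moebius_thm_2_3 : RH ↔ ∀ p ∈ [1,2), ∫₀^∞ |x⁻¹ g(x⁻¹)|^p dx < ∞`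
   (equivalence part; the unconditional `‖g₁‖₂ = ∞` is not formalised). "⟸" as printed (Hölder,
   here Young's inequality, gives `N_σ(g) < ∞` for `σ > 1/p − 1`; Lemma 2.1; identity theorem on
   the upper half-strip and then on `−1/2 < Re s < 0`, avoiding the pole of `ζ(s+1)` at `s = 0`).
12. (§12, appended) **IJMMS Theorem 4.2** (published version only; (4.4)–(4.5)), the `L^p`
   convolution criterion: `theorem BaezDuarte2005Moebius_thm_4_2 (hφ : IsMellinProper φ) :
   RH ↔ ∀ p ∈ [1,2), ∫₀^∞ |x⁻¹ Gφ(x⁻¹)|^p dx < ∞` (equivalence part; the unconditional (4.6)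
   `‖ψ‖₂ = ∞` is not formalised), through the norm form of the continuation step
   `riemannHypothesis_of_isMellinProper_of_hasFiniteMellinNorm` (§6).
13. (§13, appended) (2.13) `g^∧(0) = ∫₀^∞ g(x) dx/x = 1` (`leftMellin_moebiusDivSum_zero`, from
   (2.12) as `σ ↓ 0` and the residue of `ζ`), (3.11) `∫₀^∞ Gφ dx/x = ∫₀^∞ φ dx/x`
   (`leftMellin_moebiusConv_zero`, `integral_moebiusConv_div_eq`), and the qualitative part of
   Lemma 3.2 (IJMMS; arXiv Lemma 3.1) for proper `φ`: `Gφ` is continuous on `(0,∞)`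
   (`continuousOn_moebiusConv`) and tends to `0` at `0⁺` and at `∞` (`tendsto_moebiusConv_nhdsGT_zero`,
   `tendsto_moebiusConv_atTop` = (4.10)), by dominated convergence.
14. (§14, appended) **IJMMS Proposition 4.3** ((4.12), published version only; `Gφ ≠ o(x^{−1/2})`),
   proved under the hypotheses of Thm. 4.1 (`theorem BaezDuarte2005Moebius_prop_4_3`) with the
   tree's certified first zero of `ζ` (`exists_zero_Icc_first_bracket`) in place of "there are
   poles for `f(s)`"; the key estimate of §10 is refined to keep the constant
   (`norm_leftMellin_moebiusConv_le_of_isBigOWith`).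
15. (§15, appended) around Prop. 4.3: the unconditional `p = 1` cases of Thms 2.3/4.2
   (`‖g₁‖₁ < ∞`, `‖ψ‖₁ = N_0(Gφ) < ∞`), "`α ≥ −1/2`" of (4.13)
   (`not_hasFiniteMellinNorm_moebiusConv_of_lt`, via the norm form
   `leftMellin_moebiusConv_mul_eq_of_hasFiniteMellinNorm` of (3.11)), **(4.11)**
   (`BaezDuarte2005Moebius_eq_4_11`), and a proved remark on the range `ϑ ∈ [0,1/2)` printed in
   Thm. 4.4: under RH, `x^{ϑ+ε}Gφ(x) → 0` for some `ε > 0` whenever `ϑ < 1/2`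
   (`BaezDuarte2005Moebius_thm_4_4_range_of_riemannHypothesis`), i.e. the printed proof's
   "`α ∈ (−1/2, 0]`" tacitly assumes `α > −1/2`.

LOCATORS follow the arXiv text (math/0504402v1); in the published version (IJMMS 2005:22) the
numbering is shifted: arXiv Lemma 2.1 = IJMMS Lemma 2.1, (2.7) = (2.12), Prop. 3.1 = Prop. 3.1,
Lemma 3.1 ((3.8),(3.9)) = Lemma 3.2 ((3.9),(3.10)), Lemma 3.2 = Lemma 3.3, Lemma 3.3 = Lemma 3.4,
Thm. 2.1 = Thm. 2.2, Thm. 2.2 ((2.9)) = Thm. 2.3 ((2.14)),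
Thm. 3.1 ((3.12)–(3.15)) = Thm. 3.5, and the arXiv Thm. 3.2 (entire-function criterion) is in IJMMS
the closing remark of §3 ("the above criterion immediately proves the Riesz and the Hardy–Littlewood
criteria"). The properness range `σ ∈ (−1/2, 0]` typed in `RieszTypeSeriesCriteria.lean` is the
PUBLISHED one (IJMMS p. 3601: "proper when `N_σ(φ) < ∞` at least for `σ ∈ (−1/2,0]`"); arXiv v1
prints `(−1/2, 1]`. With the published range Báez-Duarte's own proof of Lemma 3.4 (= arXiv 3.3)
runs through the line `σ = 0` ("on account of (3.10) and Lemma 2.1 … then invoke analytic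
continuation"); the boundary-uniqueness step §5 is that continuation made explicit.

Everything is PROVED; no definitions, no named facts. Labels: RH-EQUIVALENT literature (proved
`↔`s; neither side is asserted). Nothing here bears on the truth of RH.

## References

* L. Báez-Duarte, *Möbius-convolutions and the Riemann hypothesis*, Int. J. Math. Math. Sci.
  2005:22 (2005) 3599–3608; arXiv:math/0504402 — §2 (2.5)–(2.7), Lemma 2.1, §3 (3.1)–(3.3),
  Prop. 3.1, (3.12), Lemma 3.3, Thm. 3.1, Thm. 3.2, Thm. 4.1; arXiv Thm. 2.2 = IJMMS Thm. 2.3 (p. 3602,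
  (2.14)); IJMMS Thm. 4.2 (pp. 3605–3606, (4.4)–(4.6)), Prop. 4.3 (p. 3607, (4.12)–(4.13)),
  (4.11), Thm. 4.4 (4.14). [BaezDuarte2005Moebius]
* K. Broughan, *Equivalents of the Riemann Hypothesis*, Vol. 2, CUP (2017), Thm 2.7 (§2.5).
  [Broughan2017]
* E. C. Titchmarsh, *The Theory of the Riemann Zeta-Function*, 2nd ed. (1986), §14.25 (Littlewood).
  [Titchmarsh1986]
* H. L. Montgomery, R. C. Vaughan, *Multiplicative Number Theory I* (2007), §6.2, §8.1 (`g ≪ exp(−c√log x)`).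
  [MontgomeryVaughan2007]
-/

noncomputable section

open Filter Asymptotics Topology MeasureTheory Set
open Complex (I)
open scoped ComplexConjugate

namespace Literature.NumberTheory.LFunctions

namespace BaezDuarteMellin

/-! ## §1 Littlewood's function `g`: measurable, bounded, `∫ |g| dx/x < ∞` -/

/-- `g(x) = Σ_{n ≤ x} μ(n)/n` is (Borel) measurable: it factors through `⌊x⌋` (a step function,
Báez-Duarte §2). [cite: BaezDuarte2005Moebius, §2 (definition of g)] -/
theorem measurable_moebiusDivSum : Measurable moebiusDivSum :=
  (measurable_from_nat (f := fun n : ℕ =>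
    ∑ k ∈ Finset.Icc 1 n, (ArithmeticFunction.moebius k : ℝ) / k)).comp Nat.measurable_floor

/-- `g` is bounded on `ℝ`: `|g(x)| ≤ B` for an absolute `B > 0` (trivially `|g(x)| ≤ x` on `[0, 2]`,
and `|g(x)| ≤ C exp(−c√log x) ≤ C` for `x ≥ 2`). [cite: BaezDuarte2005Moebius, §2 eq. (2.5)–(2.6)] -/
theorem exists_abs_moebiusDivSum_le : ∃ B : ℝ, 0 < B ∧ ∀ x : ℝ, |moebiusDivSum x| ≤ B := by
  obtain ⟨c, hc, C, hC⟩ := abs_sum_moebius_div_le_exp_neg_sqrt_log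
  refine ⟨max C 0 + 2, by positivity, fun x => ?_⟩
  rcases lt_or_ge x 2 with hx | hx
  · rcases lt_or_ge x 0 with hx0 | hx0
    · rw [moebiusDivSum_of_lt_one (by linarith), abs_zero]; positivity
    · exact (abs_moebiusDivSum_le_self hx0).trans (by linarith [le_max_right C 0])
  · have h := hC x hx
    have hexp : Real.exp (-c * Real.sqrt (Real.log x)) ≤ 1 :=
      Real.exp_le_one_iff.2 (by nlinarith [Real.sqrt_nonneg (Real.log x)])
    have h' : |moebiusDivSum x| ≤ max C 0 * Real.exp (-c * Real.sqrt (Real.log x)) :=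
      h.trans (mul_le_mul_of_nonneg_right (le_max_left _ _) (Real.exp_pos _).le)
    calc |moebiusDivSum x| ≤ max C 0 * Real.exp (-c * Real.sqrt (Real.log x)) := h'
      _ ≤ max C 0 * 1 := mul_le_mul_of_nonneg_left hexp (le_max_right _ _)
      _ ≤ max C 0 + 2 := by linarith

/-- **`g ∈ L¹(ℝ×)`** (Báez-Duarte (2.6) for `p = 1`): `∫₀^∞ |g(x)| dx/x < ∞`. On `(0, 2]` the
integrand is bounded (`g = 0` on `(0,1)`); on `(2, ∞)` it is `≤ C exp(−c√log x)/x`, integrable — the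
prime number theorem with de la Vallée-Poussin's remainder (tree:
`abs_sum_moebius_div_le_exp_neg_sqrt_log`). [cite: BaezDuarte2005Moebius, §2 eq. (2.6)] -/
theorem integrableOn_abs_moebiusDivSum_div :
    IntegrableOn (fun x : ℝ => |moebiusDivSum x| / x) (Ioi 0) := by
  obtain ⟨c, hc, C, hC⟩ := abs_sum_moebius_div_le_exp_neg_sqrt_log
  obtain ⟨B, hB, hgB⟩ := exists_abs_moebiusDivSum_le
  have hmeas : Measurable fun x : ℝ => |moebiusDivSum x| / x :=
    (continuous_abs.measurable.comp measurable_moebiusDivSum).div measurable_id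
  have hsplit : Ioi (0 : ℝ) = Ioc 0 2 ∪ Ioi 2 :=
    (Ioc_union_Ioi_eq_Ioi (by norm_num : (0 : ℝ) ≤ 2)).symm
  rw [hsplit]
  refine IntegrableOn.union ?_ ?_
  · refine Integrable.mono' (integrableOn_const (C := B) (hs := measure_Ioc_lt_top.ne))
      hmeas.aestronglyMeasurable ?_
    refine ae_restrict_of_forall_mem measurableSet_Ioc fun x hx => ?_
    rw [Real.norm_eq_abs, abs_div, abs_abs, abs_of_pos hx.1]
    rcases lt_or_ge x 1 with h1 | h1
    · rw [moebiusDivSum_of_lt_one h1, abs_zero, zero_div]; exact hB.le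
    · exact (div_le_self (abs_nonneg _) h1).trans (hgB x)
  · have hint : IntegrableOn
        (fun t : ℝ => max C 0 * (Real.exp (-(c * Real.sqrt (Real.log t))) / t)) (Ioi 2) :=
      ((MoebiusSum.integrableOn_exp_neg_mul_sqrt_log_div hc).mono_set
        (Ioi_subset_Ioi (by norm_num : (1 : ℝ) ≤ 2))).const_mul (max C 0)
    refine Integrable.mono' hint hmeas.aestronglyMeasurable ?_
    refine ae_restrict_of_forall_mem measurableSet_Ioi fun x hx => ?_
    have hx2 : (2 : ℝ) < x := hx
    have hx0 : 0 < x := by linarith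
    rw [Real.norm_eq_abs, abs_div, abs_abs, abs_of_pos hx0]
    have h := hC x hx2.le
    have h' : |moebiusDivSum x| ≤ max C 0 * Real.exp (-(c * Real.sqrt (Real.log x))) := by
      rw [neg_mul] at h
      exact h.trans (mul_le_mul_of_nonneg_right (le_max_left _ _) (Real.exp_pos _).le)
    rw [← mul_div_assoc]
    exact div_le_div_of_nonneg_right h' hx0.le

/-- The weighted norms of `g` (as a complex-valued function): `N_σ(g) = ∫₀^∞ x^{−σ−1}|g(x)| dx < ∞`
for every `σ ≥ 0` (for `σ = 0` this is `g ∈ L¹(ℝ×)`; for `σ > 0`, `x^{−σ−1} ≤ x^{−1}` on `[1,∞)` and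
`g = 0` on `(0,1)`). [cite: BaezDuarte2005Moebius, §2 eq. (2.6)–(2.7)] -/
theorem hasFiniteMellinNorm_moebiusDivSum {σ : ℝ} (hσ : 0 ≤ σ) :
    HasFiniteMellinNorm (fun x : ℝ => (moebiusDivSum x : ℂ)) σ := by
  unfold HasFiniteMellinNorm
  have hmeas : Measurable fun x : ℝ => x ^ (-σ - 1) * ‖(moebiusDivSum x : ℂ)‖ :=
    (measurable_id.pow_const _).mul (Complex.measurable_ofReal.comp measurable_moebiusDivSum).norm
  refine Integrable.mono' integrableOn_abs_moebiusDivSum_div hmeas.aestronglyMeasurable ?_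
  refine ae_restrict_of_forall_mem measurableSet_Ioi fun x hx => ?_
  have hx0 : (0 : ℝ) < x := hx
  rw [Real.norm_eq_abs, abs_mul, abs_of_nonneg (Real.rpow_nonneg hx0.le _), abs_norm,
    Complex.norm_real, Real.norm_eq_abs]
  rcases lt_or_ge x 1 with h1 | h1
  · rw [moebiusDivSum_of_lt_one h1, abs_zero, mul_zero, zero_div]
  · have hle : x ^ (-σ - 1) ≤ x ^ (-1 : ℝ) := Real.rpow_le_rpow_of_exponent_le h1 (by linarith)
    rw [Real.rpow_neg_one] at hle
    calc x ^ (-σ - 1) * |moebiusDivSum x| ≤ x⁻¹ * |moebiusDivSum x| :=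
          mul_le_mul_of_nonneg_right hle (abs_nonneg _)
      _ = |moebiusDivSum x| / x := by rw [div_eq_inv_mul]

/-! ## §2 Left-Mellin transforms of measurable functions with finite weighted norms -/

/-- `‖x^{−s−1} h(x)‖ = x^{−Re s−1} ‖h(x)‖` for `x > 0`. [folklore] -/
private theorem norm_cpow_mul {h : ℝ → ℂ} {x : ℝ} (hx : 0 < x) (s : ℂ) :
    ‖(x : ℂ) ^ (-s - 1) * h x‖ = x ^ (-s.re - 1) * ‖h x‖ := by
  rw [norm_mul, Complex.norm_cpow_eq_rpow_re_of_pos hx]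
  simp

/-- Two-sided domination of the Mellin weight: for `σ₁ ≤ σ ≤ σ₂` and `x > 0`,
`x^{−σ−1} ≤ x^{−σ₁−1} + x^{−σ₂−1}` (the first term dominates on `[1,∞)`, the second on `(0,1)`).
[folklore] -/
private theorem rpow_le_rpow_add_rpow {x σ σ₁ σ₂ : ℝ} (hx : 0 < x) (h1 : σ₁ ≤ σ) (h2 : σ ≤ σ₂) :
    x ^ (-σ - 1) ≤ x ^ (-σ₁ - 1) + x ^ (-σ₂ - 1) := by
  rcases le_or_gt 1 x with hx1 | hx1
  · have : x ^ (-σ - 1) ≤ x ^ (-σ₁ - 1) := Real.rpow_le_rpow_of_exponent_le hx1 (by linarith)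
    linarith [Real.rpow_nonneg hx.le (-σ₂ - 1)]
  · have : x ^ (-σ - 1) ≤ x ^ (-σ₂ - 1) :=
      Real.rpow_le_rpow_of_exponent_ge hx hx1.le (by linarith)
    linarith [Real.rpow_nonneg hx.le (-σ₁ - 1)]

/-- The Mellin integrand `x ↦ x^{−s−1} h(x)` of a measurable `h` is measurable. [folklore] -/
private theorem measurable_cpow_mul {h : ℝ → ℂ} (hm : Measurable h) (s : ℂ) :
    Measurable fun x : ℝ => (x : ℂ) ^ (-s - 1) * h x :=
  (Complex.measurable_ofReal.pow_const _).mul hm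

/-- If `N_{Re s}(h) < ∞` then the Mellin integrand at `s` is integrable on `(0, ∞)`.
[cite: BaezDuarte2005Moebius, §2 eq. (2.1) (absolute convergence)] -/
theorem integrableOn_cpow_mul {h : ℝ → ℂ} (hm : Measurable h) {s : ℂ}
    (hN : HasFiniteMellinNorm h s.re) :
    IntegrableOn (fun x : ℝ => (x : ℂ) ^ (-s - 1) * h x) (Ioi 0) := by
  refine Integrable.mono' hN (measurable_cpow_mul hm s).aestronglyMeasurable ?_
  refine ae_restrict_of_forall_mem measurableSet_Ioi fun x hx => ?_
  rw [norm_cpow_mul hx]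

/-- **Lemma 2.1 of the paper (holomorphy): the left-Mellin transform of a measurable `h` with
`N_σ(h) < ∞` for all `σ ∈ (a, b)` is holomorphic on the open strip `a < Re s < b`** (dominated
holomorphic parameter integral; local majorant `(x^{−σ₁−1} + x^{−σ₂−1})‖h(x)‖`).
[cite: BaezDuarte2005Moebius, §2 Lemma 2.1] -/
theorem differentiableOn_leftMellin {h : ℝ → ℂ} (hm : Measurable h) {a b : ℝ}
    (hN : ∀ σ : ℝ, a < σ → σ < b → HasFiniteMellinNorm h σ) :
    DifferentiableOn ℂ (leftMellin h) {s : ℂ | a < s.re ∧ s.re < b} := by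
  have hU : IsOpen {s : ℂ | a < s.re ∧ s.re < b} :=
    (isOpen_lt continuous_const Complex.continuous_re).inter
      (isOpen_lt Complex.continuous_re continuous_const)
  show DifferentiableOn ℂ (fun s : ℂ => ∫ x in Ioi (0 : ℝ), (x : ℂ) ^ (-s - 1) * h x)
    {s : ℂ | a < s.re ∧ s.re < b}
  refine Literature.Analysis.Complex.differentiableOn_integral_of_dominated
    (μ := volume.restrict (Ioi (0 : ℝ))) (F := fun (s : ℂ) (x : ℝ) => (x : ℂ) ^ (-s - 1) * h x)
    (fun s _ => (measurable_cpow_mul hm s).aestronglyMeasurable) ?_ ?_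
  · refine ae_restrict_of_forall_mem measurableSet_Ioi fun x hx => ?_
    have hx0 : (0 : ℝ) < x := hx
    have hx' : (x : ℂ) ≠ 0 := Complex.ofReal_ne_zero.2 hx0.ne'
    intro s _
    exact (((differentiableAt_id.neg.sub_const 1).const_cpow (Or.inl hx')).mul_const
      (h x)).differentiableWithinAt
  · rintro s₀ ⟨ha, hb⟩
    set R : ℝ := min (s₀.re - a) (b - s₀.re) / 2 with hR
    have hR0 : 0 < R := by
      rw [hR]; exact half_pos (lt_min (by linarith) (by linarith))
    have hRa : a < s₀.re - R := by
      have : R ≤ (s₀.re - a) / 2 := by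
        rw [hR]; exact div_le_div_of_nonneg_right (min_le_left _ _) zero_le_two
      linarith
    have hRb : s₀.re + R < b := by
      have : R ≤ (b - s₀.re) / 2 := by
        rw [hR]; exact div_le_div_of_nonneg_right (min_le_right _ _) zero_le_two
      linarith
    have hre : ∀ s ∈ Metric.ball s₀ R, s₀.re - R < s.re ∧ s.re < s₀.re + R := by
      intro s hs
      rw [Metric.mem_ball, dist_eq_norm] at hs
      have h1 : |(s - s₀).re| ≤ ‖s - s₀‖ := Complex.abs_re_le_norm _
      rw [Complex.sub_re] at h1
      constructor <;> linarith [(abs_lt.1 (h1.trans_lt hs)).1, (abs_lt.1 (h1.trans_lt hs)).2]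
    refine ⟨R, hR0, fun s hs => ⟨by linarith [(hre s hs).1], by linarith [(hre s hs).2]⟩,
      fun x => (x ^ (-(s₀.re - R) - 1) + x ^ (-(s₀.re + R) - 1)) * ‖h x‖, ?_, ?_⟩
    · have h1 := hN _ hRa (by linarith)
      have h2 := hN _ (by linarith) hRb
      unfold HasFiniteMellinNorm at h1 h2
      have := h1.add h2
      refine this.congr (ae_of_all _ fun x => ?_)
      simp only [Pi.add_apply]
      ring
    · refine ae_restrict_of_forall_mem measurableSet_Ioi fun x hx => ?_
      intro s hs
      rw [norm_cpow_mul hx]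
      exact mul_le_mul_of_nonneg_right
        (rpow_le_rpow_add_rpow hx (hre s hs).1.le (hre s hs).2.le) (norm_nonneg _)

/-- **Lemma 2.1 of the paper (continuity up to the edges): if `N_{σ₁}(h), N_{σ₂}(h) < ∞` then
`h^∧` is continuous on the closed strip `σ₁ ≤ Re s ≤ σ₂`** (dominated convergence with the
majorant `(x^{−σ₁−1} + x^{−σ₂−1})‖h(x)‖`). [cite: BaezDuarte2005Moebius, §2 Lemma 2.1] -/
theorem continuousWithinAt_leftMellin {h : ℝ → ℂ} (hm : Measurable h) {σ₁ σ₂ : ℝ}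
    (h1 : HasFiniteMellinNorm h σ₁) (h2 : HasFiniteMellinNorm h σ₂) (s₀ : ℂ) :
    ContinuousWithinAt (leftMellin h) {s : ℂ | σ₁ ≤ s.re ∧ s.re ≤ σ₂} s₀ := by
  show Tendsto (fun s : ℂ => ∫ x in Ioi (0 : ℝ), (x : ℂ) ^ (-s - 1) * h x)
    (𝓝[{s : ℂ | σ₁ ≤ s.re ∧ s.re ≤ σ₂}] s₀) (𝓝 (∫ x in Ioi (0 : ℝ), (x : ℂ) ^ (-s₀ - 1) * h x))
  refine tendsto_integral_filter_of_dominated_convergence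
    (fun x => (x ^ (-σ₁ - 1) + x ^ (-σ₂ - 1)) * ‖h x‖) ?_ ?_ ?_ ?_
  · exact Eventually.of_forall fun s => (measurable_cpow_mul hm s).aestronglyMeasurable
  · filter_upwards [self_mem_nhdsWithin] with s hs
    refine ae_restrict_of_forall_mem measurableSet_Ioi fun x hx => ?_
    rw [norm_cpow_mul hx]
    exact mul_le_mul_of_nonneg_right (rpow_le_rpow_add_rpow hx hs.1 hs.2) (norm_nonneg _)
  · unfold HasFiniteMellinNorm at h1 h2
    refine (h1.add h2).congr (ae_of_all _ fun x => ?_)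
    simp only [Pi.add_apply]
    ring
  · refine ae_restrict_of_forall_mem measurableSet_Ioi fun x hx => ?_
    have hx0 : (0 : ℝ) < x := hx
    have hx' : (x : ℂ) ≠ 0 := Complex.ofReal_ne_zero.2 hx0.ne'
    have hc : Continuous fun s : ℂ => (x : ℂ) ^ (-s - 1) * h x :=
      ((continuous_id.neg.sub continuous_const).const_cpow (Or.inl hx')).mul continuous_const
    exact (hc.tendsto s₀).mono_left nhdsWithin_le_nhds

/-- The substitution `x ↦ xt` in a Mellin integral (real form): for `t > 0`,
`∫₀^∞ x^{−σ−1} q(xt) dx = t^σ ∫₀^∞ w^{−σ−1} q(w) dw` (no integrability needed: both sides are the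
junk value together). [folklore] -/
private theorem integral_rpow_mul_comp_mul_right (q : ℝ → ℝ) {t : ℝ} (ht : 0 < t) (σ : ℝ) :
    ∫ x in Ioi (0 : ℝ), x ^ (-σ - 1) * q (x * t) =
      t ^ σ * ∫ w in Ioi (0 : ℝ), w ^ (-σ - 1) * q w := by
  have hkey : ∀ x : ℝ, x ^ (-σ - 1) * q (x * t) =
      (fun w : ℝ => (w / t) ^ (-σ - 1) * q w) (x * t) := by
    intro x
    simp only [mul_div_cancel_right₀ _ ht.ne']
  simp_rw [hkey]
  rw [integral_comp_mul_right_Ioi (fun w : ℝ => (w / t) ^ (-σ - 1) * q w) 0 ht, zero_mul]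
  have hcongr : ∫ w in Ioi (0 : ℝ), (w / t) ^ (-σ - 1) * q w =
      ∫ w in Ioi (0 : ℝ), t ^ (σ + 1) * (w ^ (-σ - 1) * q w) := by
    refine setIntegral_congr_fun measurableSet_Ioi fun w hw => ?_
    have hw0 : (0 : ℝ) < w := hw
    rw [Real.div_rpow hw0.le ht.le, div_eq_mul_inv, ← Real.rpow_neg ht.le]
    ring_nf
  rw [hcongr, integral_const_mul, smul_eq_mul, ← mul_assoc]
  congr 1
  rw [Real.rpow_add ht, Real.rpow_one]
  field_simp

/-- The substitution `x ↦ xt` in a Mellin integral (complex form): for `t > 0`,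
`∫₀^∞ x^{−s−1} q(xt) dx = t^s ∫₀^∞ w^{−s−1} q(w) dw`. [folklore] -/
private theorem integral_cpow_mul_comp_mul_right (q : ℝ → ℂ) {t : ℝ} (ht : 0 < t) (s : ℂ) :
    ∫ x in Ioi (0 : ℝ), (x : ℂ) ^ (-s - 1) * q (x * t) =
      (t : ℂ) ^ s * ∫ w in Ioi (0 : ℝ), (w : ℂ) ^ (-s - 1) * q w := by
  have ht' : (t : ℂ) ≠ 0 := Complex.ofReal_ne_zero.2 ht.ne'
  have hkey : ∀ x : ℝ, (x : ℂ) ^ (-s - 1) * q (x * t) =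
      (fun w : ℝ => ((w / t : ℝ) : ℂ) ^ (-s - 1) * q w) (x * t) := by
    intro x
    simp only [mul_div_cancel_right₀ _ ht.ne']
  simp_rw [hkey]
  rw [integral_comp_mul_right_Ioi (fun w : ℝ => ((w / t : ℝ) : ℂ) ^ (-s - 1) * q w) 0 ht,
    zero_mul]
  have hcongr : ∫ w in Ioi (0 : ℝ), ((w / t : ℝ) : ℂ) ^ (-s - 1) * q w =
      ∫ w in Ioi (0 : ℝ), (t : ℂ) ^ (s + 1) * ((w : ℂ) ^ (-s - 1) * q w) := by
    refine setIntegral_congr_fun measurableSet_Ioi fun w hw => ?_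
    have hw0 : (0 : ℝ) < w := hw
    have harg : (t : ℂ).arg ≠ Real.pi := by
      rw [Complex.arg_ofReal_of_nonneg ht.le]; exact Real.pi_ne_zero.symm
    have h1 : ((w / t : ℝ) : ℂ) ^ (-s - 1) = (w : ℂ) ^ (-s - 1) * (t : ℂ) ^ (s + 1) := by
      rw [div_eq_mul_inv, Complex.ofReal_mul, Complex.mul_cpow_ofReal_nonneg hw0.le
        (inv_nonneg.2 ht.le), Complex.ofReal_inv, Complex.inv_cpow _ _ harg, ← Complex.cpow_neg]
      congr 2
      ring
    rw [h1]
    ring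
  rw [hcongr, integral_const_mul, Complex.real_smul, ← mul_assoc]
  congr 1
  rw [Complex.cpow_add _ _ ht', Complex.cpow_one, Complex.ofReal_inv]
  field_simp

/-- The substitution `t ↦ 1/t` (real form, integrability): `N_σ(r) < ∞` iff
`t ↦ t^{σ−1} r(1/t)` is integrable on `(0, ∞)`. [folklore] -/
private theorem integrableOn_rpow_mul_comp_inv_iff (r : ℝ → ℝ) (σ : ℝ) :
    IntegrableOn (fun t : ℝ => t ^ (σ - 1) * r (1 / t)) (Ioi 0) ↔
      IntegrableOn (fun u : ℝ => u ^ (-σ - 1) * r u) (Ioi 0) := by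
  rw [← integrableOn_Ioi_comp_rpow_iff (fun u : ℝ => u ^ (-σ - 1) * r u)
    (by norm_num : (-1 : ℝ) ≠ 0)]
  refine integrableOn_congr_fun (fun t ht => ?_) measurableSet_Ioi
  have ht0 : (0 : ℝ) < t := ht
  simp only [smul_eq_mul, abs_neg, abs_one, one_mul]
  rw [Real.rpow_neg_one, Real.inv_rpow ht0.le, ← Real.rpow_neg ht0.le, ← one_div, ← mul_assoc,
    ← Real.rpow_add ht0]
  ring_nf

/-- The substitution `t ↦ 1/t` (complex form): `∫₀^∞ t^{s−1} r(1/t) dt = ∫₀^∞ u^{−s−1} r(u) du`.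
[folklore] -/
private theorem integral_cpow_mul_comp_inv (r : ℝ → ℂ) (s : ℂ) :
    ∫ t in Ioi (0 : ℝ), (t : ℂ) ^ (s - 1) * r (1 / t) =
      ∫ u in Ioi (0 : ℝ), (u : ℂ) ^ (-s - 1) * r u := by
  rw [← integral_comp_rpow_Ioi (fun u : ℝ => (u : ℂ) ^ (-s - 1) * r u)
    (by norm_num : (-1 : ℝ) ≠ 0)]
  refine setIntegral_congr_fun measurableSet_Ioi fun t ht => ?_
  have ht0 : (0 : ℝ) < t := ht
  have ht' : (t : ℂ) ≠ 0 := Complex.ofReal_ne_zero.2 ht0.ne'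
  have harg : (t : ℂ).arg ≠ Real.pi := by
    rw [Complex.arg_ofReal_of_nonneg ht0.le]; exact Real.pi_ne_zero.symm
  simp only [abs_neg, abs_one, one_mul, Complex.real_smul]
  rw [Real.rpow_neg_one, ← one_div, Complex.ofReal_cpow ht0.le, one_div, Complex.ofReal_inv,
    Complex.inv_cpow _ _ harg, ← Complex.cpow_neg, ← mul_assoc, ← Complex.cpow_add _ _ ht']
  congr 2
  push_cast
  ring


/-! ## §3 `Gφ` as a multiplicative convolution: measurability, `N_σ(Gφ) ≤ N_σ(g)·N_σ(φ)`, and Lemma 3.3 -/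

/-- The integrand `(x,t) ↦ g(xt) φ(1/t)/t` of `Gφ` is jointly measurable. [folklore] -/
private theorem measurable_convKernel {φ : ℝ → ℂ} (hφm : Measurable φ) :
    Measurable (Function.uncurry fun x t : ℝ => (moebiusDivSum (x * t) : ℂ) * φ (1 / t) / t) := by
  have h1 : Measurable fun p : ℝ × ℝ => (moebiusDivSum (p.1 * p.2) : ℂ) :=
    Complex.measurable_ofReal.comp (measurable_moebiusDivSum.comp (measurable_fst.mul measurable_snd))
  have h2 : Measurable fun p : ℝ × ℝ => φ (1 / p.2) := hφm.comp (measurable_snd.const_div 1)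
  have h3 : Measurable fun p : ℝ × ℝ => ((p.2 : ℝ) : ℂ) := Complex.measurable_ofReal.comp measurable_snd
  exact (h1.mul h2).div h3

/-- `Gφ` is measurable for measurable `φ` (measurability of a parametric Bochner integral).
[cite: BaezDuarte2005Moebius, §3.1 eq. (3.1)] -/
theorem measurable_moebiusConv {φ : ℝ → ℂ} (hφm : Measurable φ) : Measurable (moebiusConv φ) := by
  have h := (measurable_convKernel hφm).stronglyMeasurable.integral_prod_right
    (ν := volume.restrict (Ioi (0 : ℝ)))
  exact h.measurable

/-- The Mellin kernel `K_s(x,t) = x^{−s−1} g(xt) φ(1/t)/t` of `(Gφ)^∧(s)` is integrable on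
`(0,∞)²` as soon as `N_σ(g), N_σ(φ) < ∞`, `σ = Re s` (Tonelli: the `x`-integral of `|K_s|` is
`t^σ N_σ(g) · |φ(1/t)|/t`, whose `t`-integral is `N_σ(g) N_σ(φ)`). This is the proof of Báez-Duarte's
Lemma 3.1 (`g ∗ φ ∈ L¹(ℝ×)`, "the Banach algebra property") at a general abscissa.
[cite: BaezDuarte2005Moebius, §3.1 Lemma 3.1 (proof; eq. (3.8))] -/
theorem integrable_convKernel {φ : ℝ → ℂ} (hφm : Measurable φ) {s : ℂ}
    (hφ : HasFiniteMellinNorm φ s.re)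
    (hg : HasFiniteMellinNorm (fun x : ℝ => (moebiusDivSum x : ℂ)) s.re) :
    Integrable (Function.uncurry fun x t : ℝ =>
        (x : ℂ) ^ (-s - 1) * ((moebiusDivSum (x * t) : ℂ) * φ (1 / t) / t))
      ((volume.restrict (Ioi (0 : ℝ))).prod (volume.restrict (Ioi (0 : ℝ)))) := by
  set σ : ℝ := s.re with hσ
  have hmeas : Measurable (Function.uncurry fun x t : ℝ =>
      (x : ℂ) ^ (-s - 1) * ((moebiusDivSum (x * t) : ℂ) * φ (1 / t) / t)) :=
    ((Complex.measurable_ofReal.comp measurable_fst).pow_const _).mul (measurable_convKernel hφm)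
  refine (integrable_prod_iff' hmeas.aestronglyMeasurable).2 ⟨?_, ?_⟩
  · -- every `t`-section is integrable in `x`
    refine ae_restrict_of_forall_mem measurableSet_Ioi fun t ht => ?_
    have ht0 : (0 : ℝ) < t := ht
    have hsc : IntegrableOn (fun x : ℝ => (x : ℂ) ^ (-s - 1) * (moebiusDivSum (x * t) : ℂ))
        (Ioi 0) := by
      have hG : IntegrableOn (fun w : ℝ => (w / t) ^ (-σ - 1) * ‖(moebiusDivSum w : ℂ)‖)
          (Ioi (0 * t)) := by
        rw [zero_mul]
        refine IntegrableOn.congr_fun (hg.const_mul (t ^ (σ + 1))) (fun w hw => ?_)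
          measurableSet_Ioi
        have hw0 : (0 : ℝ) < w := hw
        simp only
        rw [Real.div_rpow hw0.le ht0.le, div_eq_mul_inv, ← Real.rpow_neg ht0.le]
        ring_nf
      have hG' := (integrableOn_Ioi_comp_mul_right_iff
        (fun w : ℝ => (w / t) ^ (-σ - 1) * ‖(moebiusDivSum w : ℂ)‖) 0 ht0).2 hG
      refine Integrable.mono' hG' (measurable_cpow_mul (Complex.measurable_ofReal.comp
        (measurable_moebiusDivSum.comp (measurable_id.mul_const t))) s).aestronglyMeasurable ?_
      refine ae_restrict_of_forall_mem measurableSet_Ioi fun x hx => ?_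
      have hx0 : (0 : ℝ) < x := hx
      rw [norm_cpow_mul (h := fun x : ℝ => (moebiusDivSum (x * t) : ℂ)) hx0,
        mul_div_cancel_right₀ _ ht0.ne']
    have := hsc.mul_const (φ (1 / t) / t)
    refine this.congr (ae_of_all _ fun x => ?_)
    simp only [Function.uncurry_apply_pair]
    ring
  · -- `t ↦ ∫ |K_s(x,t)| dx = N_σ(g) t^{σ−1} |φ(1/t)|` is integrable
    set N : ℝ := ∫ w in Ioi (0 : ℝ), w ^ (-σ - 1) * ‖(moebiusDivSum w : ℂ)‖ with hN
    have hval : ∀ t ∈ Ioi (0 : ℝ),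
        ∫ x in Ioi (0 : ℝ), ‖(Function.uncurry fun x t : ℝ =>
          (x : ℂ) ^ (-s - 1) * ((moebiusDivSum (x * t) : ℂ) * φ (1 / t) / t)) (x, t)‖ =
        N * (t ^ (σ - 1) * ‖φ (1 / t)‖) := by
      intro t ht
      have ht0 : (0 : ℝ) < t := ht
      have h1 : ∀ x ∈ Ioi (0 : ℝ), ‖(Function.uncurry fun x t : ℝ =>
          (x : ℂ) ^ (-s - 1) * ((moebiusDivSum (x * t) : ℂ) * φ (1 / t) / t)) (x, t)‖ =
          x ^ (-σ - 1) * ‖(moebiusDivSum (x * t) : ℂ)‖ * (‖φ (1 / t)‖ / t) := by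
        intro x hx
        have hx0 : (0 : ℝ) < x := hx
        simp only [Function.uncurry_apply_pair]
        rw [norm_mul, norm_div, norm_mul, Complex.norm_cpow_eq_rpow_re_of_pos hx0,
          Complex.norm_real t, Real.norm_of_nonneg ht0.le]
        simp only [Complex.sub_re, Complex.neg_re, Complex.one_re, hσ]
        ring
      rw [setIntegral_congr_fun measurableSet_Ioi h1, integral_mul_const,
        integral_rpow_mul_comp_mul_right (fun w : ℝ => ‖(moebiusDivSum w : ℂ)‖) ht0 σ, ← hN,
        Real.rpow_sub ht0, Real.rpow_one]
      field_simp
    have hI : Integrable (fun t : ℝ => N * (t ^ (σ - 1) * ‖φ (1 / t)‖))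
        (volume.restrict (Ioi (0 : ℝ))) :=
      (((integrableOn_rpow_mul_comp_inv_iff (fun u : ℝ => ‖φ u‖) σ).2 hφ).const_mul N)
    exact hI.congr (ae_restrict_of_forall_mem measurableSet_Ioi fun t ht => (hval t ht).symm)

/-- **Báez-Duarte's (3.8), `N_σ(Gφ) ≤ N_σ(g) N_σ(φ) < ∞`** whenever both norms are finite (printed
at `σ = 0`, Lemma 3.1; used there: the behaviour of `Gφ` at `0⁺` costs exactly `g ∈ L¹(ℝ×)`, i.e.
the prime number theorem). [cite: BaezDuarte2005Moebius, §3.1 Lemma 3.1 eq. (3.8)] -/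
theorem hasFiniteMellinNorm_moebiusConv {φ : ℝ → ℂ} (hφm : Measurable φ) {s : ℂ}
    (hφ : HasFiniteMellinNorm φ s.re)
    (hg : HasFiniteMellinNorm (fun x : ℝ => (moebiusDivSum x : ℂ)) s.re) :
    HasFiniteMellinNorm (moebiusConv φ) s.re := by
  have hI := integrable_convKernel hφm hφ hg
  have h1 := hI.integral_norm_prod_left
  unfold HasFiniteMellinNorm
  refine h1.mono' ((measurable_id.pow_const _).mul
    (measurable_moebiusConv hφm).norm).aestronglyMeasurable ?_
  refine ae_restrict_of_forall_mem measurableSet_Ioi fun x hx => ?_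
  have hx0 : (0 : ℝ) < x := hx
  have heq : (x : ℂ) ^ (-s - 1) * moebiusConv φ x = ∫ t in Ioi (0 : ℝ),
      (Function.uncurry fun x t : ℝ =>
        (x : ℂ) ^ (-s - 1) * ((moebiusDivSum (x * t) : ℂ) * φ (1 / t) / t)) (x, t) := by
    simp only [Function.uncurry_apply_pair]
    unfold moebiusConv
    exact (integral_const_mul _ _).symm
  rw [Real.norm_eq_abs, abs_of_nonneg (mul_nonneg (Real.rpow_nonneg hx0.le _) (norm_nonneg _))]
  calc x ^ (-s.re - 1) * ‖moebiusConv φ x‖ = ‖(x : ℂ) ^ (-s - 1) * moebiusConv φ x‖ :=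
        (norm_cpow_mul hx0 s).symm
    _ = ‖∫ t in Ioi (0 : ℝ), (Function.uncurry fun x t : ℝ =>
          (x : ℂ) ^ (-s - 1) * ((moebiusDivSum (x * t) : ℂ) * φ (1 / t) / t)) (x, t)‖ := by
        rw [heq]
    _ ≤ ∫ t in Ioi (0 : ℝ), ‖(Function.uncurry fun x t : ℝ =>
          (x : ℂ) ^ (-s - 1) * ((moebiusDivSum (x * t) : ℂ) * φ (1 / t) / t)) (x, t)‖ :=
        norm_integral_le_integral_norm _

/-- **Báez-Duarte's (3.9) (Lemma 3.1; Mellin factorisation of the convolution):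
`(Gφ)^∧(s) = g^∧(s) φ^∧(s)` whenever `N_σ(g), N_σ(φ) < ∞`, `σ = Re s`** — printed on the line
`σ = 0` as `F(Gφ) = F(g ∗ φ) = F(g)F(φ)` (Fubini, then `x ↦ xt` in the inner integral and `t ↦ 1/t`
in the outer one). [cite: BaezDuarte2005Moebius, §3.1 Lemma 3.1 eq. (3.9)] -/
theorem leftMellin_moebiusConv_eq {φ : ℝ → ℂ} (hφm : Measurable φ) {s : ℂ}
    (hφ : HasFiniteMellinNorm φ s.re)
    (hg : HasFiniteMellinNorm (fun x : ℝ => (moebiusDivSum x : ℂ)) s.re) :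
    leftMellin (moebiusConv φ) s =
      leftMellin (fun x : ℝ => (moebiusDivSum x : ℂ)) s * leftMellin φ s := by
  have hI := integrable_convKernel hφm hφ hg
  have h1 : ∀ x : ℝ, (x : ℂ) ^ (-s - 1) * moebiusConv φ x = ∫ t in Ioi (0 : ℝ),
      (fun x t : ℝ => (x : ℂ) ^ (-s - 1) * ((moebiusDivSum (x * t) : ℂ) * φ (1 / t) / t)) x t := by
    intro x
    unfold moebiusConv
    exact (integral_const_mul _ _).symm
  have h3 : ∀ t ∈ Ioi (0 : ℝ), ∫ x in Ioi (0 : ℝ),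
      (fun x t : ℝ => (x : ℂ) ^ (-s - 1) * ((moebiusDivSum (x * t) : ℂ) * φ (1 / t) / t)) x t =
      leftMellin (fun x : ℝ => (moebiusDivSum x : ℂ)) s * ((t : ℂ) ^ (s - 1) * φ (1 / t)) := by
    intro t ht
    have ht0 : (0 : ℝ) < t := ht
    have ht' : (t : ℂ) ≠ 0 := Complex.ofReal_ne_zero.2 ht0.ne'
    have h2 : ∀ x : ℝ, (fun x t : ℝ => (x : ℂ) ^ (-s - 1) *
        ((moebiusDivSum (x * t) : ℂ) * φ (1 / t) / t)) x t =
        (x : ℂ) ^ (-s - 1) * (moebiusDivSum (x * t) : ℂ) * (φ (1 / t) / t) := by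
      intro x
      simp only
      ring
    simp_rw [h2]
    rw [integral_mul_const, integral_cpow_mul_comp_mul_right
      (fun w : ℝ => (moebiusDivSum w : ℂ)) ht0 s]
    unfold leftMellin
    rw [Complex.cpow_sub _ _ ht', Complex.cpow_one, div_eq_mul_inv, div_eq_mul_inv]
    ring
  unfold leftMellin
  simp_rw [h1]
  rw [integral_integral_swap hI, setIntegral_congr_fun measurableSet_Ioi h3, integral_const_mul,
    integral_cpow_mul_comp_inv φ s]
  rfl


/-! ## §4 (2.7): `ζ(s+1) · s g^∧(s) = 1` for `Re s > 0`, and on `Re s = 0`, `s ≠ 0` -/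

/-- **Báez-Duarte's (2.7)**: `ζ(s+1) · s ∫₀^∞ x^{−s−1} g(x) dx = 1` for `Re s > 0` ("summing by parts
the Dirichlet series of `1/ζ(s+1)`": Mathlib's `LSeries_eq_mul_integral` for the coefficients
`μ(k)/k`, whose partial sums `g(n)` are bounded, and `ζ(w) · Σ μ(n) n^{−w} = 1` for `Re w > 1`).
[cite: BaezDuarte2005Moebius, §2 eq. (2.7)] -/
theorem riemannZeta_mul_leftMellin_moebiusDivSum {s : ℂ} (hs : 0 < s.re) :
    riemannZeta (s + 1) * (s * leftMellin (fun x : ℝ => (moebiusDivSum x : ℂ)) s) = 1 := by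
  obtain ⟨B, hB, hgB⟩ := exists_abs_moebiusDivSum_le
  set f : ℕ → ℂ := fun k => (ArithmeticFunction.moebius k : ℂ) / k with hf
  have hpart' : ∀ t : ℝ, ∑ k ∈ Finset.Icc 1 ⌊t⌋₊, f k = (moebiusDivSum t : ℂ) := by
    intro t
    simp only [hf]
    unfold moebiusDivSum
    push_cast
    rfl
  have hpart : ∀ n : ℕ, ∑ k ∈ Finset.Icc 1 n, f k = (moebiusDivSum n : ℂ) := by
    intro n
    rw [← hpart' n, Nat.floor_natCast]
  have hO : (fun n : ℕ => ∑ k ∈ Finset.Icc 1 n, f k) =O[atTop] fun n : ℕ => (n : ℝ) ^ (0 : ℝ) := by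
    refine IsBigO.of_bound B (Eventually.of_forall fun n => ?_)
    rw [hpart, Complex.norm_real, Real.norm_eq_abs, Real.rpow_zero, norm_one, mul_one]
    exact hgB n
  have hS : LSeriesSummable f s := by
    refine Summable.of_norm_bounded (g := fun n : ℕ => (n : ℝ) ^ (-(1 + s.re))) ?_ ?_
    · exact Real.summable_nat_rpow.2 (by linarith)
    · intro n
      rcases eq_or_ne n 0 with rfl | hn
      · simp only [LSeries.term_zero, norm_zero]
        exact Real.rpow_nonneg (Nat.cast_nonneg _) _
      · rw [LSeries.term_of_ne_zero hn, hf]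
        simp only
        have hn0 : (0 : ℝ) < n := Nat.cast_pos.2 (Nat.pos_of_ne_zero hn)
        have hμ : |(ArithmeticFunction.moebius n : ℝ)| ≤ 1 := by
          exact_mod_cast ArithmeticFunction.abs_moebius_le_one
        rw [norm_div, norm_div, Complex.norm_natCast_cpow_of_pos (Nat.pos_of_ne_zero hn),
          Complex.norm_natCast, Complex.norm_intCast, div_div, Real.rpow_neg hn0.le,
          Real.rpow_add hn0, Real.rpow_one, ← one_div]
        exact div_le_div_of_nonneg_right hμ (by positivity)
  have hL := LSeries_eq_mul_integral f le_rfl hs hS hO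
  have hint : (∫ t in Ioi (1 : ℝ), (∑ k ∈ Finset.Icc 1 ⌊t⌋₊, f k) * (t : ℂ) ^ (-(s + 1))) =
      leftMellin (fun x : ℝ => (moebiusDivSum x : ℂ)) s := by
    have h1 : ∀ t : ℝ, (∑ k ∈ Finset.Icc 1 ⌊t⌋₊, f k) * (t : ℂ) ^ (-(s + 1)) =
        (t : ℂ) ^ (-s - 1) * (moebiusDivSum t : ℂ) := by
      intro t
      rw [hpart', neg_add', mul_comm]
    simp_rw [h1]
    unfold leftMellin
    rw [← integral_Ici_eq_integral_Ioi]
    symm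
    refine setIntegral_eq_of_subset_of_forall_sdiff_eq_zero measurableSet_Ioi (fun x hx => ?_)
      (fun x hx => ?_)
    · exact lt_of_lt_of_le (zero_lt_one' ℝ) (mem_Ici.1 hx)
    · have hx1 : x < 1 := not_le.1 hx.2
      simp only [moebiusDivSum_of_lt_one hx1, Complex.ofReal_zero, mul_zero]
  have hLμ : LSeries f s = LSeries (fun n : ℕ => (ArithmeticFunction.moebius n : ℂ)) (s + 1) := by
    unfold LSeries
    refine tsum_congr fun n => ?_
    rcases eq_or_ne n 0 with rfl | hn
    · simp [LSeries.term_zero]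
    · rw [LSeries.term_of_ne_zero hn, LSeries.term_of_ne_zero hn, hf]
      simp only
      have hn' : (n : ℂ) ≠ 0 := Nat.cast_ne_zero.2 hn
      rw [Complex.cpow_add _ _ hn', Complex.cpow_one]
      field_simp
  have hζ : riemannZeta (s + 1) *
      LSeries (fun n : ℕ => (ArithmeticFunction.moebius n : ℂ)) (s + 1) = 1 := by
    have h1 : 1 < (s + 1).re := by simp only [Complex.add_re, Complex.one_re]; linarith
    have := LSeries_one_mul_Lseries_moebius h1
    rwa [LSeries_one_eq_riemannZeta h1] at this
  calc riemannZeta (s + 1) * (s * leftMellin (fun x : ℝ => (moebiusDivSum x : ℂ)) s)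
      = riemannZeta (s + 1) * LSeries f s := by rw [hL, hint]
    _ = 1 := by rw [hLμ]; exact hζ

/-- **(2.7) on the boundary line `Re s = 0`, `s ≠ 0`**: `ζ(s+1) · s g^∧(s) = 1` there too, by
continuity from the right half-plane (`g^∧` is continuous on `Re s ≥ 0` by dominated convergence
with majorant `|g(x)|/x` — this is where `g ∈ L¹(ℝ×)`, i.e. the prime number theorem, enters;
`ζ` is continuous at `1 + s ≠ 1`). The paper states (2.7) with `σ ≥ 0`.
[cite: BaezDuarte2005Moebius, §2 eq. (2.7) (σ ≥ 0)] -/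
theorem riemannZeta_mul_leftMellin_moebiusDivSum_of_re_eq_zero {s : ℂ} (hs : s.re = 0)
    (hs0 : s ≠ 0) :
    riemannZeta (s + 1) * (s * leftMellin (fun x : ℝ => (moebiusDivSum x : ℂ)) s) = 1 := by
  have hgm : Measurable (fun x : ℝ => (moebiusDivSum x : ℂ)) :=
    Complex.measurable_ofReal.comp measurable_moebiusDivSum
  have hcontM : ContinuousWithinAt (leftMellin (fun x : ℝ => (moebiusDivSum x : ℂ)))
      {z : ℂ | 0 ≤ z.re} s := by
    have h := continuousWithinAt_leftMellin hgm (hasFiniteMellinNorm_moebiusDivSum le_rfl)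
      (hasFiniteMellinNorm_moebiusDivSum zero_le_one) s
    refine h.mono_of_mem_nhdsWithin ?_
    have hlt : s ∈ {z : ℂ | z.re < 1} := by
      show s.re < 1
      rw [hs]
      exact one_pos
    have h2 := inter_mem_nhdsWithin {z : ℂ | 0 ≤ z.re}
      ((isOpen_lt Complex.continuous_re continuous_const).mem_nhds hlt)
    exact Filter.mem_of_superset h2 fun z hz => ⟨hz.1, le_of_lt hz.2⟩
  have hcontζ : ContinuousAt (fun z : ℂ => riemannZeta (z + 1)) s := by
    have h1 : s + 1 ≠ 1 := fun h => hs0 (by linear_combination h)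
    have h2 : ContinuousAt (fun z : ℂ => z + 1) s := (continuous_id.add continuous_const).continuousAt
    exact ContinuousAt.comp (f := fun z : ℂ => z + 1) (differentiableAt_riemannZeta h1).continuousAt h2
  have hcont : ContinuousWithinAt (fun z : ℂ =>
      riemannZeta (z + 1) * (z * leftMellin (fun x : ℝ => (moebiusDivSum x : ℂ)) z))
      {z : ℂ | 0 ≤ z.re} s :=
    hcontζ.continuousWithinAt.mul (continuousWithinAt_id.mul hcontM)
  have hmem : s ∈ closure {z : ℂ | 0 < z.re} := by
    rw [Complex.closure_setOf_lt_re]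
    show 0 ≤ s.re
    rw [hs]
  haveI hne : (𝓝[{z : ℂ | 0 < z.re}] s).NeBot := mem_closure_iff_nhdsWithin_neBot.1 hmem
  have hsub : {z : ℂ | 0 < z.re} ⊆ {z : ℂ | 0 ≤ z.re} := fun z hz => le_of_lt (α := ℝ) hz
  have h1 : Tendsto (fun z : ℂ =>
      riemannZeta (z + 1) * (z * leftMellin (fun x : ℝ => (moebiusDivSum x : ℂ)) z))
      (𝓝[{z : ℂ | 0 < z.re}] s)
      (𝓝 (riemannZeta (s + 1) * (s * leftMellin (fun x : ℝ => (moebiusDivSum x : ℂ)) s))) :=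
    (hcont.mono hsub).tendsto
  have h2 : Tendsto (fun z : ℂ =>
      riemannZeta (z + 1) * (z * leftMellin (fun x : ℝ => (moebiusDivSum x : ℂ)) z))
      (𝓝[{z : ℂ | 0 < z.re}] s) (𝓝 1) := by
    refine tendsto_const_nhds.congr' ?_
    exact eventually_nhdsWithin_of_forall fun z hz =>
      (riemannZeta_mul_leftMellin_moebiusDivSum hz).symm
  exact tendsto_nhds_unique h1 h2

/-! ## §5 Boundary uniqueness on the strip `−1/2 < Re s < 0` from the segment `{iτ : 1 < τ < 2}` -/

/-- **Boundary uniqueness on a vertical strip.** Let `D` be holomorphic on the open strip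
`−1/2 < Re s < 0`, continuous from the closed left half-plane `{Re s ≤ 0}` at the boundary points
`iτ`, `1 < τ < 2`, and zero there. Then `D = 0` on the strip. Proof: rotate by `z ↦ iz` to the
horizontal strip `0 < Im z < 1/2` with boundary values on the real interval `(1, 2)`, reflect across
that interval (Schwarz reflection / Painlevé: tree `Complex.differentiableOn_schwarzReflection` on the
disc `B(3/2, 1/2)`), so the zeros accumulate at an interior point of the reflected domain; identity
theorem in the disc, then in the (convex) strip. The continuous case of the F. and M. Riesz–Privalov
boundary uniqueness theorem (Rudin, *Real and Complex Analysis*, Thm. 17.18).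
[cite: Conway1978, Ch. IX Thm. 1.1] -/
theorem eq_zero_of_eqOn_boundary_segment {D : ℂ → ℂ}
    (hd : DifferentiableOn ℂ D {s : ℂ | -(1 / 2 : ℝ) < s.re ∧ s.re < 0})
    (hc : ∀ τ : ℝ, τ ∈ Ioo (1 : ℝ) 2 → ContinuousWithinAt D {s : ℂ | s.re ≤ 0} (τ * I))
    (h0 : ∀ τ : ℝ, τ ∈ Ioo (1 : ℝ) 2 → D (τ * I) = 0) {s : ℂ}
    (hs1 : -(1 / 2 : ℝ) < s.re) (hs2 : s.re < 0) : D s = 0 := by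
  -- rotate: `f z = D (I z)`; the strip becomes `V = {0 < Im z < 1/2}`, the segment `(1,2) ⊆ ℝ`
  set f : ℂ → ℂ := fun z => D (I * z) with hf
  have hIre : ∀ z : ℂ, (I * z).re = -z.im := fun z => by simp
  have hV : IsOpen {z : ℂ | 0 < z.im ∧ z.im < 1 / 2} :=
    (isOpen_lt continuous_const Complex.continuous_im).inter
      (isOpen_lt Complex.continuous_im continuous_const)
  have hfd : DifferentiableOn ℂ f {z : ℂ | 0 < z.im ∧ z.im < 1 / 2} := by
    refine hd.comp ((differentiable_id.const_mul I).differentiableOn) fun z hz => ?_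
    simp only [mem_setOf_eq, hIre]
    exact ⟨by linarith [hz.2], by linarith [hz.1]⟩
  -- the disc `B(3/2, 1/2)`, centred on the segment
  have hball_im : ∀ z ∈ Metric.ball (((3 / 2 : ℝ)) : ℂ) (1 / 2), z.im < 1 / 2 := by
    intro z hz
    rw [Metric.mem_ball, dist_eq_norm] at hz
    have h := Complex.abs_im_le_norm (z - ((3 / 2 : ℝ) : ℂ))
    rw [Complex.sub_im, Complex.ofReal_im, sub_zero] at h
    linarith [(abs_le.1 h).2, le_abs_self z.im]
  have hball_re : ∀ z ∈ Metric.ball (((3 / 2 : ℝ)) : ℂ) (1 / 2), z.re ∈ Ioo (1 : ℝ) 2 := by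
    intro z hz
    rw [Metric.mem_ball, dist_eq_norm] at hz
    have h := Complex.abs_re_le_norm (z - ((3 / 2 : ℝ) : ℂ))
    rw [Complex.sub_re, Complex.ofReal_re] at h
    have h' := abs_lt.1 (h.trans_lt hz)
    constructor <;> linarith [h'.1, h'.2]
  -- a real point `w` of the disc: `f` is continuous from above there and `f w = 0`
  have hreal_pt : ∀ w : ℂ, w ∈ Metric.ball (((3 / 2 : ℝ)) : ℂ) (1 / 2) → w.im = 0 →
      ContinuousWithinAt f {z : ℂ | 0 ≤ z.im} w ∧ f w = 0 := by
    intro w hwU hwim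
    have hweq : I * w = (w.re : ℂ) * I := by
      rw [mul_comm]
      congr 1
      exact Complex.ext (by simp) (by simp [hwim])
    have hτ : w.re ∈ Ioo (1 : ℝ) 2 := hball_re w hwU
    constructor
    · have hmap : MapsTo (fun z : ℂ => I * z) {z : ℂ | 0 ≤ z.im} {s : ℂ | s.re ≤ 0} := by
        intro z hz
        simp only [mem_setOf_eq, hIre]
        simp only [mem_setOf_eq] at hz
        linarith
      have h1 : ContinuousWithinAt D {s : ℂ | s.re ≤ 0} (I * w) := by
        rw [hweq]; exact hc w.re hτ
      exact h1.comp (continuous_const.mul continuous_id).continuousWithinAt hmap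
    · show D (I * w) = 0
      rw [hweq]
      exact h0 w.re hτ
  -- Step 1: the Schwarz reflection of `f` is holomorphic on the disc
  have hF : DifferentiableOn ℂ (_root_.Complex.schwarzReflection f)
      (Metric.ball (((3 / 2 : ℝ)) : ℂ) (1 / 2)) := by
    refine _root_.Complex.differentiableOn_schwarzReflection Metric.isOpen_ball
      (fun w hw => Literature.Analysis.Complex.conj_mem_ball_ofReal hw) ?_ ?_ ?_
    · rintro w ⟨hwU, hw⟩
      rcases eq_or_lt_of_le (show 0 ≤ w.im from hw) with him | him
      · exact (hreal_pt w hwU him.symm).1.mono inter_subset_right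
      · have hmem : w ∈ {z : ℂ | 0 < z.im ∧ z.im < 1 / 2} := ⟨him, hball_im w hwU⟩
        exact (hfd.differentiableAt (hV.mem_nhds hmem)).continuousAt.continuousWithinAt
    · exact hfd.mono fun w hw => ⟨hw.2, hball_im w hw.1⟩
    · intro w hwU hwim
      rw [(hreal_pt w hwU hwim).2, map_zero]
  have hFa : AnalyticOnNhd ℂ (_root_.Complex.schwarzReflection f)
      (Metric.ball (((3 / 2 : ℝ)) : ℂ) (1 / 2)) :=
    hF.analyticOnNhd Metric.isOpen_ball
  -- Step 2: the reflection vanishes near `3/2` (its zeros on the real axis accumulate there)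
  have hx₀mem : ((3 / 2 : ℝ) : ℂ) ∈ Metric.ball (((3 / 2 : ℝ)) : ℂ) (1 / 2) :=
    Metric.mem_ball_self (by norm_num)
  have hFzero : ∀ x : ℝ, (x : ℂ) ∈ Metric.ball (((3 / 2 : ℝ)) : ℂ) (1 / 2) →
      _root_.Complex.schwarzReflection f x = 0 := by
    intro x hx
    rw [_root_.Complex.schwarzReflection_ofReal]
    exact (hreal_pt x hx (Complex.ofReal_im x)).2
  have hev : ∀ᶠ w in 𝓝 ((3 / 2 : ℝ) : ℂ), _root_.Complex.schwarzReflection f w = 0 := by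
    refine ((hFa _ hx₀mem).frequently_zero_iff_eventually_zero).1 ?_
    have hrealev : ∀ᶠ t : ℝ in 𝓝 (3 / 2 : ℝ), _root_.Complex.schwarzReflection f t = 0 := by
      have : ∀ᶠ t : ℝ in 𝓝 (3 / 2 : ℝ), (t : ℂ) ∈ Metric.ball (((3 / 2 : ℝ)) : ℂ) (1 / 2) :=
        Complex.continuous_ofReal.continuousAt.preimage_mem_nhds
          (Metric.isOpen_ball.mem_nhds hx₀mem)
      filter_upwards [this] with t ht using hFzero t ht
    have htend : Tendsto (fun t : ℝ => (t : ℂ)) (𝓝[≠] (3 / 2 : ℝ)) (𝓝[≠] ((3 / 2 : ℝ) : ℂ)) := by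
      refine Complex.continuous_ofReal.continuousWithinAt.tendsto_nhdsWithin ?_
      intro t ht
      rw [mem_compl_iff, mem_singleton_iff, Complex.ofReal_inj]
      exact ht
    simpa using htend.frequently (eventually_nhdsWithin_of_eventually_nhds hrealev).frequently
  have hFball : EqOn (_root_.Complex.schwarzReflection f) 0
      (Metric.ball (((3 / 2 : ℝ)) : ℂ) (1 / 2)) :=
    hFa.eqOn_zero_of_preconnected_of_eventuallyEq_zero (convex_ball _ _).isPreconnected hx₀mem hev
  -- Step 3: `f` vanishes near the interior point `3/2 + i/4`
  have hw₀im : (((3 / 2 : ℝ) : ℂ) + ((1 / 4 : ℝ) : ℂ) * I).im = 1 / 4 := by simp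
  have hw₀V : ((3 / 2 : ℝ) : ℂ) + ((1 / 4 : ℝ) : ℂ) * I ∈ {z : ℂ | 0 < z.im ∧ z.im < 1 / 2} := by
    refine ⟨?_, ?_⟩
    · show 0 < (((3 / 2 : ℝ) : ℂ) + ((1 / 4 : ℝ) : ℂ) * I).im
      rw [hw₀im]; norm_num
    · show (((3 / 2 : ℝ) : ℂ) + ((1 / 4 : ℝ) : ℂ) * I).im < 1 / 2
      rw [hw₀im]; norm_num
  have hw₀ball : ((3 / 2 : ℝ) : ℂ) + ((1 / 4 : ℝ) : ℂ) * I ∈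
      Metric.ball (((3 / 2 : ℝ)) : ℂ) (1 / 2) := by
    rw [Metric.mem_ball, dist_eq_norm, add_sub_cancel_left, norm_mul, Complex.norm_real,
      Complex.norm_I, mul_one, Real.norm_eq_abs, abs_of_pos (by norm_num)]
    norm_num
  have hfev : ∀ᶠ w in 𝓝 (((3 / 2 : ℝ) : ℂ) + ((1 / 4 : ℝ) : ℂ) * I), f w = 0 := by
    filter_upwards [Metric.isOpen_ball.mem_nhds hw₀ball,
      (isOpen_lt continuous_const Complex.continuous_im).mem_nhds hw₀V.1] with w hw hwim
    have h1 := hFball hw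
    rw [Pi.zero_apply, _root_.Complex.schwarzReflection_of_nonneg (le_of_lt hwim)] at h1
    exact h1
  -- Step 4: identity theorem on the convex strip
  have hVconv : Convex ℝ {z : ℂ | 0 < z.im ∧ z.im < 1 / 2} :=
    (convex_halfSpace_im_gt (0 : ℝ)).inter (convex_halfSpace_im_lt _)
  have hfV : EqOn f 0 {z : ℂ | 0 < z.im ∧ z.im < 1 / 2} :=
    (hfd.analyticOnNhd hV).eqOn_zero_of_preconnected_of_eventuallyEq_zero hVconv.isPreconnected
      hw₀V hfev
  -- back to `s = I (−I s)`
  have hz : -I * s ∈ {z : ℂ | 0 < z.im ∧ z.im < 1 / 2} := by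
    refine ⟨?_, ?_⟩
    · show 0 < (-I * s).im
      simp
      linarith
    · show (-I * s).im < 1 / 2
      simp
      linarith
  have := hfV hz
  simpa [hf, ← mul_assoc] using this


/-! ## §6 `N_σ(Gφ) < ∞` on `(−1/2, 0)` from the hypothesis, and the assembly -/

/-- From the hypothesis `Gφ(x) ≪ x^e` at `+∞` with `e < σ < 0`, together with `N_0(Gφ) < ∞` (which
controls `(0, X₀]`: `x^{−σ−1} ≤ X₀^{−σ} x^{−1}` there), the weighted norm `N_σ(Gφ)` is finite — so
`(Gφ)^∧` is holomorphic on `−1/2 < Re s < 0` when the hypothesis holds for every `ε > 0`. This is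
the content of Báez-Duarte's Lemmas 3.2–3.3 ("we split the `N_σ(Gφ)` integral at `x = 1`…").
[cite: BaezDuarte2005Moebius, §3.1 Lemmas 3.2–3.3] -/
theorem hasFiniteMellinNorm_moebiusConv_of_isBigO {φ : ℝ → ℂ} (hφm : Measurable φ)
    (h0 : HasFiniteMellinNorm (moebiusConv φ) 0) {σ e : ℝ} (hσ : σ < 0) (he : e < σ)
    (hG : moebiusConv φ =O[atTop] fun x : ℝ => x ^ e) :
    HasFiniteMellinNorm (moebiusConv φ) σ := by
  obtain ⟨C, hC⟩ := hG.bound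
  rw [eventually_atTop] at hC
  obtain ⟨X, hX⟩ := hC
  have hX₀1 : (1 : ℝ) ≤ max X 1 := le_max_right _ _
  have hX₀0 : (0 : ℝ) < max X 1 := by linarith
  have hmeas : Measurable fun x : ℝ => x ^ (-σ - 1) * ‖moebiusConv φ x‖ :=
    (measurable_id.pow_const _).mul (measurable_moebiusConv hφm).norm
  unfold HasFiniteMellinNorm at h0 ⊢
  have hsplit : Ioi (0 : ℝ) = Ioc 0 (max X 1) ∪ Ioi (max X 1) :=
    (Ioc_union_Ioi_eq_Ioi hX₀0.le).symm
  rw [hsplit]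
  refine IntegrableOn.union ?_ ?_
  · have h1 : IntegrableOn
        (fun x : ℝ => (max X 1) ^ (-σ) * (x ^ (-(0 : ℝ) - 1) * ‖moebiusConv φ x‖))
        (Ioc 0 (max X 1)) :=
      (h0.mono_set Ioc_subset_Ioi_self).const_mul _
    refine Integrable.mono' h1 hmeas.aestronglyMeasurable ?_
    refine ae_restrict_of_forall_mem measurableSet_Ioc fun x hx => ?_
    have hx0 : 0 < x := hx.1
    rw [Real.norm_eq_abs, abs_of_nonneg (mul_nonneg (Real.rpow_nonneg hx0.le _) (norm_nonneg _))]
    have hpow : x ^ (-σ - 1) ≤ (max X 1) ^ (-σ) * x ^ (-(0 : ℝ) - 1) := by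
      rw [show -σ - 1 = -σ + (-(0 : ℝ) - 1) by ring, Real.rpow_add hx0]
      exact mul_le_mul_of_nonneg_right (Real.rpow_le_rpow hx0.le hx.2 (by linarith))
        (Real.rpow_nonneg hx0.le _)
    calc x ^ (-σ - 1) * ‖moebiusConv φ x‖
        ≤ (max X 1) ^ (-σ) * x ^ (-(0 : ℝ) - 1) * ‖moebiusConv φ x‖ :=
          mul_le_mul_of_nonneg_right hpow (norm_nonneg _)
      _ = (max X 1) ^ (-σ) * (x ^ (-(0 : ℝ) - 1) * ‖moebiusConv φ x‖) := by ring
  · have h2 : IntegrableOn (fun x : ℝ => C * x ^ (e + (-σ - 1))) (Ioi (max X 1)) :=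
      (integrableOn_Ioi_rpow_of_lt (by linarith) hX₀0).const_mul C
    refine Integrable.mono' h2 hmeas.aestronglyMeasurable ?_
    refine ae_restrict_of_forall_mem measurableSet_Ioi fun x hx => ?_
    have hxX : max X 1 < x := hx
    have hx0 : 0 < x := by linarith
    have hb := hX x ((le_max_left _ _).trans hxX.le)
    rw [Real.norm_of_nonneg (Real.rpow_nonneg hx0.le _)] at hb
    rw [Real.norm_eq_abs, abs_of_nonneg (mul_nonneg (Real.rpow_nonneg hx0.le _) (norm_nonneg _))]
    calc x ^ (-σ - 1) * ‖moebiusConv φ x‖ ≤ x ^ (-σ - 1) * (C * x ^ e) :=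
          mul_le_mul_of_nonneg_left hb (Real.rpow_nonneg hx0.le _)
      _ = C * x ^ (e + (-σ - 1)) := by rw [Real.rpow_add hx0]; ring

/-- `N_0(Gφ) < ∞` for proper `φ` (IJMMS Lemma 3.2, (3.9): `N_0(Gφ) ≤ N_0(g) N_0(φ)`).
[cite: BaezDuarte2005Moebius, Lemma 3.2 (3.9) (arXiv Lemma 3.1 (3.8))] -/
theorem hasFiniteMellinNorm_moebiusConv_zero {φ : ℝ → ℂ} (hφ : IsMoebiusProper φ) :
    HasFiniteMellinNorm (moebiusConv φ) 0 := by
  have h := hasFiniteMellinNorm_moebiusConv hφ.1 (s := 0)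
    (by rw [Complex.zero_re]; exact hφ.2 0 (by norm_num) le_rfl)
    (by rw [Complex.zero_re]; exact hasFiniteMellinNorm_moebiusDivSum le_rfl)
  rwa [Complex.zero_re] at h

end BaezDuarteMellin

open BaezDuarteMellin in
/-- **The continuation step of Báez-Duarte's Theorem 3.1/3.5 "⟸", from finiteness of the norms**: if
`φ` is Mellin-proper (typed range) and `N_σ(Gφ) < ∞` for every `σ ∈ (−1/2, 0)`, then RH. With
`D(s) = (Gφ)^∧(s) · s ζ(s+1) − φ^∧(s)`: `D` is holomorphic on the strip (§2), continuous from the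
left at `iτ` (`1 < τ < 2`) and zero there (Lemma 3.3 at `σ = 0` and (2.7) on the line, §§3–4), hence
`D ≡ 0` (§5); so `(Gφ)^∧(s) s ζ(s+1) = φ^∧(s) ≠ 0` and `ζ(s+1) ≠ 0` for `−1/2 < Re s < 0`, i.e. `ζ`
has no zero in `1/2 < Re < 1`, which is RH (`quasiRiemannHypothesis_one_half_iff_holds`). The
hypothesis `N_σ(Gφ) < ∞` is what `Gφ ≪ x^{−1/2+ε}` (Thm. 3.5) or `‖ψ‖_p < ∞ ∀ p < 2` (Thm. 4.2)
supply. [cite: BaezDuarte2005Moebius, Lemma 3.4 and Thm. 3.5 "⟸" (arXiv Lemma 3.3, Thm. 3.1); Thm. 4.2 proof (4.8)] -/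
theorem riemannHypothesis_of_isMellinProper_of_hasFiniteMellinNorm {φ : ℝ → ℂ}
    (hφ : IsMellinProper φ)
    (hGσ : ∀ σ : ℝ, -(1 / 2 : ℝ) < σ → σ < 0 → HasFiniteMellinNorm (moebiusConv φ) σ) :
    RiemannHypothesis := by
  obtain ⟨⟨hφm, hN⟩, hne⟩ := hφ
  have hN0 : HasFiniteMellinNorm φ 0 := hN 0 (by norm_num) le_rfl
  have hg0 : HasFiniteMellinNorm (fun x : ℝ => (moebiusDivSum x : ℂ)) 0 :=
    hasFiniteMellinNorm_moebiusDivSum le_rfl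
  have hG0 : HasFiniteMellinNorm (moebiusConv φ) 0 := by
    have h := hasFiniteMellinNorm_moebiusConv hφm (s := 0)
      (by rw [Complex.zero_re]; exact hN0) (by rw [Complex.zero_re]; exact hg0)
    rwa [Complex.zero_re] at h
  -- the boundary function `D`
  have hDd : DifferentiableOn ℂ (fun s : ℂ =>
      leftMellin (moebiusConv φ) s * (s * riemannZeta (s + 1)) - leftMellin φ s)
      {s : ℂ | -(1 / 2 : ℝ) < s.re ∧ s.re < 0} := by
    have h1 := differentiableOn_leftMellin (measurable_moebiusConv hφm) hGσ
    have h2 := differentiableOn_leftMellin hφm (fun σ ha hb => hN σ ha hb.le)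
    have h3 : DifferentiableOn ℂ (fun s : ℂ => s * riemannZeta (s + 1))
        {s : ℂ | -(1 / 2 : ℝ) < s.re ∧ s.re < 0} := by
      intro s hs
      have hs1 : s + 1 ≠ 1 := by
        intro h
        have h0 : s = 0 := by linear_combination h
        rw [h0] at hs
        simp at hs
      have h4 : DifferentiableAt ℂ (fun z : ℂ => z + 1) s := differentiableAt_id.add_const 1
      exact (differentiableAt_id.mul (DifferentiableAt.comp (f := fun z : ℂ => z + 1) s
        (differentiableAt_riemannZeta hs1) h4)).differentiableWithinAt
    exact (h1.mul h3).sub h2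
  have hDc : ∀ τ : ℝ, τ ∈ Ioo (1 : ℝ) 2 → ContinuousWithinAt (fun s : ℂ =>
      leftMellin (moebiusConv φ) s * (s * riemannZeta (s + 1)) - leftMellin φ s)
      {s : ℂ | s.re ≤ 0} (τ * I) := by
    intro τ hτ
    have hτ0 : ((τ : ℂ) * I).re = 0 := by simp
    have hnhds : {s : ℂ | -(1 / 4 : ℝ) ≤ s.re ∧ s.re ≤ 0} ∈ 𝓝[{s : ℂ | s.re ≤ 0}] ((τ : ℂ) * I) := by
      have hlt : (τ : ℂ) * I ∈ {s : ℂ | -(1 / 4 : ℝ) < s.re} := by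
        show -(1 / 4 : ℝ) < ((τ : ℂ) * I).re
        rw [hτ0]
        norm_num
      have h := inter_mem_nhdsWithin {s : ℂ | s.re ≤ 0}
        ((isOpen_lt continuous_const Complex.continuous_re).mem_nhds hlt)
      exact Filter.mem_of_superset h fun z hz => ⟨le_of_lt (α := ℝ) hz.2, hz.1⟩
    have h1 : ContinuousWithinAt (leftMellin (moebiusConv φ)) {s : ℂ | s.re ≤ 0} (τ * I) :=
      (continuousWithinAt_leftMellin (measurable_moebiusConv hφm)
        (hGσ _ (by norm_num) (by norm_num)) hG0 _).mono_of_mem_nhdsWithin hnhds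
    have h2 : ContinuousWithinAt (leftMellin φ) {s : ℂ | s.re ≤ 0} (τ * I) :=
      (continuousWithinAt_leftMellin hφm (hN _ (by norm_num) (by norm_num)) hN0 _).mono_of_mem_nhdsWithin hnhds
    have h3 : ContinuousAt (fun s : ℂ => s * riemannZeta (s + 1)) (τ * I) := by
      have hs1 : (τ : ℂ) * I + 1 ≠ 1 := by
        intro h
        have h0 : (τ : ℂ) * I = 0 := by linear_combination h
        rcases mul_eq_zero.1 h0 with h5 | h5
        · have : τ = 0 := by exact_mod_cast h5
          linarith [hτ.1]
        · exact Complex.I_ne_zero h5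
      have h4 : ContinuousAt (fun z : ℂ => z + 1) ((τ : ℂ) * I) :=
        (continuous_id.add continuous_const).continuousAt
      exact continuousAt_id.mul (ContinuousAt.comp (f := fun z : ℂ => z + 1)
        (differentiableAt_riemannZeta hs1).continuousAt h4)
    exact (h1.mul h3.continuousWithinAt).sub h2
  have hD0 : ∀ τ : ℝ, τ ∈ Ioo (1 : ℝ) 2 → (fun s : ℂ =>
      leftMellin (moebiusConv φ) s * (s * riemannZeta (s + 1)) - leftMellin φ s) (τ * I) = 0 := by
    intro τ hτ
    have hsre : ((τ : ℂ) * I).re = 0 := by simp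
    have hs0 : (τ : ℂ) * I ≠ 0 := by
      intro h0
      rcases mul_eq_zero.1 h0 with h5 | h5
      · have : τ = 0 := by exact_mod_cast h5
        linarith [hτ.1]
      · exact Complex.I_ne_zero h5
    have hfac := leftMellin_moebiusConv_eq hφm (s := (τ : ℂ) * I)
      (by rw [hsre]; exact hN0) (by rw [hsre]; exact hg0)
    have h27 := riemannZeta_mul_leftMellin_moebiusDivSum_of_re_eq_zero hsre hs0
    simp only
    rw [hfac]
    linear_combination (leftMellin φ ((τ : ℂ) * I)) * h27
  -- `D ≡ 0` on the strip, hence `ζ ≠ 0` on `1/2 < Re < 1`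
  have hq : QuasiRiemannHypothesis (1 / 2) := by
    intro w hw h1 h2
    have hs1 : -(1 / 2 : ℝ) < (w - 1).re := by
      simp only [Complex.sub_re, Complex.one_re]
      linarith
    have hs2 : (w - 1).re < 0 := by
      simp only [Complex.sub_re, Complex.one_re]
      linarith
    have hDs := eq_zero_of_eqOn_boundary_segment hDd hDc hD0 hs1 hs2
    have hΦ : leftMellin φ (w - 1) ≠ 0 := hne (w - 1) hs1 hs2
    simp only [sub_add_cancel, hw, mul_zero, zero_sub, neg_eq_zero] at hDs
    exact hΦ hDs
  have hiff : QuasiRiemannHypothesis (1 / 2) ↔ RiemannHypothesis :=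
    quasiRiemannHypothesis_one_half_iff_holds
  exact hiff.1 hq

open BaezDuarteMellin in
/-- **"⟸" of Báez-Duarte's Theorem 3.1, for the typed properness range**: if `φ` is Mellin-proper
(`N_σ(φ) < ∞` for `σ ∈ (−1/2, 0]`, `φ^∧ ≠ 0` on `−1/2 < Re s < 0`) and `Gφ(x) ≪_ε x^{−1/2+ε}` for
every `ε > 0`, then the Riemann hypothesis holds. With `D(s) = (Gφ)^∧(s) · s ζ(s+1) − φ^∧(s)`:
`D` is holomorphic on the strip (§2, §6), continuous from the left at `iτ` (`1 < τ < 2`) and zero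
there (Lemma 3.3 at `σ = 0` and (2.7) on the line, §§3–4), hence `D ≡ 0` (§5); so
`(Gφ)^∧(s) s ζ(s+1) = φ^∧(s) ≠ 0` and `ζ(s+1) ≠ 0` for `−1/2 < Re s < 0`, i.e. `ζ` has no zero in
`1/2 < Re < 1`, which is RH (`quasiRiemannHypothesis_one_half_iff_holds`).
[cite: BaezDuarte2005Moebius, Thm. 3.1 (arXiv) = Thm. 3.5 (IJMMS), "⟸"] -/
theorem riemannHypothesis_of_isMellinProper_of_isBigO {φ : ℝ → ℂ} (hφ : IsMellinProper φ)
    (hG : ∀ ε : ℝ, 0 < ε → moebiusConv φ =O[atTop] fun x : ℝ ↦ x ^ (-(1 / 2 : ℝ) + ε)) :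
    RiemannHypothesis := by
  have hG0 : HasFiniteMellinNorm (moebiusConv φ) 0 := hasFiniteMellinNorm_moebiusConv_zero hφ.1
  refine riemannHypothesis_of_isMellinProper_of_hasFiniteMellinNorm hφ fun σ h1 h2 => ?_
  exact hasFiniteMellinNorm_moebiusConv_of_isBigO hφ.1.1 hG0 h2
    (e := -(1 / 2 : ℝ) + (σ + 1 / 2) / 2) (by linarith) (hG _ (by linarith))

/-- **DISCHARGE of the named fact `BaezDuarte2005Moebius_thm_3_1`** (Báez-Duarte, IJMMS 2005:22,
Thm. 3.5 = arXiv:math/0504402 Thm. 3.1, (3.14): "if `φ` is mellin-proper then RH ⟺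
`Gφ(x) ≪ x^{−1/2+ε}`"), for the statement as typed in `RieszTypeSeriesCriteria.lean`: "⟹" is (3.12)
(`moebiusConv_isBigO_of_riemannHypothesis`, valid for every proper `φ`), "⟸" is
`riemannHypothesis_of_isMellinProper_of_isBigO`. An equivalence is proved; neither side is
asserted. [cite: BaezDuarte2005Moebius, Thm. 3.5 (arXiv Thm. 3.1, (3.14))] -/
theorem BaezDuarte2005Moebius_thm_3_1_holds : BaezDuarte2005Moebius_thm_3_1 := by
  intro f hf
  exact ⟨fun hRH ε hε => moebiusConv_isBigO_of_riemannHypothesis hRH hf.1 hε,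
    fun h => riemannHypothesis_of_isMellinProper_of_isBigO hf h⟩

/-- Báez-Duarte's convolution criterion as an `↔` theorem of the tree: for every Mellin-proper `φ`,
`RiemannHypothesis ↔ ∀ ε > 0, Gφ(x) = O_ε(x^{−1/2+ε})`. [cite: BaezDuarte2005Moebius, Thm. 3.5 (arXiv Thm. 3.1, (3.14))] -/
theorem riemannHypothesis_iff_moebiusConv_isBigO {φ : ℝ → ℂ} (hφ : IsMellinProper φ) :
    RiemannHypothesis ↔
      ∀ ε : ℝ, 0 < ε → moebiusConv φ =O[atTop] fun x : ℝ ↦ x ^ (-(1 / 2 : ℝ) + ε) :=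
  BaezDuarte2005Moebius_thm_3_1_holds φ hφ

/-! ## §7 Proposition 3.1 (`φ⋆(x) = Gφ(x)` for entire `φ` vanishing at `0`) and the entire-function
criterion, Thm. 3.2 = Broughan Vol. 2 Thm 2.7: the named fact `BaezDuarte2005Moebius_thm_3_2` DISCHARGED -/

namespace BaezDuarteMellin

/-- (2.7) at the integers after `t ↦ t/x`: for `x > 0` and `n ≥ 1`,
`∫₀^∞ t^{−n−1} g(tx) dt = x^n / (n ζ(n+1))`. [cite: BaezDuarte2005Moebius, §3.1 Prop. 3.1 (proof, via (2.7))] -/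
theorem integral_cpow_mul_moebiusDivSum_eq {x : ℝ} (hx : 0 < x) {n : ℕ} (hn : n ≠ 0) :
    ∫ t in Ioi (0 : ℝ), (t : ℂ) ^ (-(n : ℂ) - 1) * (moebiusDivSum (t * x) : ℂ) =
      (x : ℂ) ^ (n : ℂ) / ((n : ℂ) * riemannZeta ((n : ℂ) + 1)) := by
  rw [integral_cpow_mul_comp_mul_right (fun w : ℝ => (moebiusDivSum w : ℂ)) hx (n : ℂ)]
  have h27 := riemannZeta_mul_leftMellin_moebiusDivSum (s := (n : ℂ))
    (by rw [Complex.natCast_re]; exact_mod_cast Nat.pos_of_ne_zero hn)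
  unfold leftMellin at h27
  have hn' : (n : ℂ) ≠ 0 := Nat.cast_ne_zero.2 hn
  have hζ : riemannZeta ((n : ℂ) + 1) ≠ 0 := by
    intro h0
    rw [h0, zero_mul] at h27
    exact zero_ne_one h27
  field_simp
  linear_combination (x : ℂ) ^ (n : ℂ) * h27

/-- For `t > 0`: `(1/t)^n / t = t^{−n−1}` as a complex power. [cite: BaezDuarte2005Moebius, §3.1 Prop. 3.1 (proof)] -/
private theorem one_div_pow_div_eq_cpow {t : ℝ} (ht : 0 < t) (n : ℕ) :
    (((1 / t : ℝ)) : ℂ) ^ n / (t : ℂ) = (t : ℂ) ^ (-(n : ℂ) - 1) := by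
  have ht' : (t : ℂ) ≠ 0 := Complex.ofReal_ne_zero.2 ht.ne'
  have h1 : (-(n : ℂ) - 1) = -(((n + 1 : ℕ) : ℂ)) := by push_cast; ring
  rw [h1, Complex.cpow_neg, Complex.cpow_natCast, pow_succ, Complex.ofReal_div, Complex.ofReal_one,
    div_pow, one_pow, mul_inv, div_eq_mul_inv, one_div]

/-- **Báez-Duarte's Proposition 3.1** for an entire `φ(z) = Σ_{n≥1} a_n z^n` (coefficients with
infinite radius of convergence, `a_0 = 0`): for `x > 0`, `Gφ(x) = φ⋆(x) = Σ_{n≥1} a_n x^n/(n ζ(n+1))`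
— termwise integration of `g(xt) φ(1/t)/t = Σ_n a_n g(xt) t^{−n−1}` (justified by
`∫ |g(xt)| t^{−n−1} dt ≤ 2B x^n` and `Σ |a_n| x^n < ∞`) and `∫₀^∞ g(xt) t^{−n−1} dt = x^n/(n ζ(n+1))`.
[cite: BaezDuarte2005Moebius, §3.1 Prop. 3.1] -/
theorem moebiusConv_powerSeries_eq_bdStar {a : ℕ → ℂ} (ha0 : a 0 = 0) (ha : IsEntireCoeff a)
    {x : ℝ} (hx : 0 < x) :
    moebiusConv (fun u : ℝ => ∑' n : ℕ, a n * (u : ℂ) ^ n) x = bdStar a x := by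
  obtain ⟨B, hB, hgB⟩ := exists_abs_moebiusDivSum_le
  set F : ℕ → ℝ → ℂ := fun n t =>
    (moebiusDivSum (x * t) : ℂ) * (a n * (((1 / t : ℝ)) : ℂ) ^ n) / t with hF
  have hx1 : 0 < 1 / x := by positivity
  -- the integrand is `Σ_n F n t`
  have hsum : ∀ t : ℝ, (moebiusDivSum (x * t) : ℂ) * (∑' n : ℕ, a n * (((1 / t : ℝ)) : ℂ) ^ n) / t =
      ∑' n : ℕ, F n t := by
    intro t
    simp only [hF]
    rw [← tsum_mul_left, ← tsum_div_const]
  -- measurability of the terms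
  have hFm : ∀ n : ℕ, Measurable (F n) := by
    intro n
    exact ((Complex.measurable_ofReal.comp (measurable_moebiusDivSum.comp
      (measurable_id.const_mul x))).mul (measurable_const.mul
      ((Complex.measurable_ofReal.comp (measurable_id.const_div 1)).pow_const n))).div
      Complex.measurable_ofReal
  -- pointwise bounds for `n ≠ 0`
  have hF_small : ∀ n : ℕ, ∀ t ∈ Ioc (0 : ℝ) (1 / x), ‖F n t‖ ≤ B * ‖a n‖ * x ^ (n + 1) := by
    intro n t ht
    rcases lt_or_eq_of_le ht.2 with hlt | heq
    · have hxt : x * t < 1 := by rwa [lt_div_iff₀ hx, mul_comm] at hlt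
      simp only [hF, moebiusDivSum_of_lt_one hxt, Complex.ofReal_zero, zero_mul, zero_div, norm_zero]
      positivity
    · simp only [hF]
      rw [heq, norm_div, norm_mul, norm_mul, norm_pow, Complex.norm_real, Complex.norm_real,
        Complex.norm_real, one_div_one_div, Real.norm_of_nonneg hx.le, Real.norm_of_nonneg hx1.le,
        Real.norm_eq_abs]
      rw [div_eq_mul_inv, one_div, inv_inv, pow_succ]
      have h := hgB (x * x⁻¹)
      calc |moebiusDivSum (x * x⁻¹)| * (‖a n‖ * x ^ n) * x
          = |moebiusDivSum (x * x⁻¹)| * (‖a n‖ * (x ^ n * x)) := by ring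
        _ ≤ B * (‖a n‖ * (x ^ n * x)) := mul_le_mul_of_nonneg_right h (by positivity)
        _ = B * ‖a n‖ * (x ^ n * x) := by ring
  have hF_large : ∀ n : ℕ, ∀ t ∈ Ioi (1 / x), ‖F n t‖ ≤ B * ‖a n‖ * t ^ (-(n : ℝ) - 1) := by
    intro n t ht
    have ht0 : 0 < t := hx1.trans ht
    simp only [hF]
    rw [norm_div, norm_mul, norm_mul, norm_pow, Complex.norm_real, Complex.norm_real,
      Complex.norm_real, Real.norm_eq_abs, Real.norm_of_nonneg ht0.le,
      Real.norm_of_nonneg (by positivity : (0 : ℝ) ≤ 1 / t)]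
    have hpow : (1 / t) ^ n / t = t ^ (-(n : ℝ) - 1) := by
      rw [Real.rpow_sub ht0, Real.rpow_neg ht0.le, Real.rpow_natCast, Real.rpow_one, one_div,
        inv_pow, div_eq_mul_inv]
    calc |moebiusDivSum (x * t)| * (‖a n‖ * (1 / t) ^ n) / t
        = |moebiusDivSum (x * t)| * ‖a n‖ * ((1 / t) ^ n / t) := by ring
      _ ≤ B * ‖a n‖ * ((1 / t) ^ n / t) := by
          gcongr
          exact hgB _
      _ = B * ‖a n‖ * t ^ (-(n : ℝ) - 1) := by rw [hpow]
  -- integrability and the bound `∫ ‖F n‖ ≤ 2 B ‖a n‖ x^n` for `n ≠ 0`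
  have hsplit : Ioi (0 : ℝ) = Ioc 0 (1 / x) ∪ Ioi (1 / x) := (Ioc_union_Ioi_eq_Ioi hx1.le).symm
  have hint_small : ∀ n : ℕ, IntegrableOn (F n) (Ioc 0 (1 / x)) := by
    intro n
    refine Integrable.mono' (integrableOn_const (C := B * ‖a n‖ * x ^ (n + 1))
      (hs := measure_Ioc_lt_top.ne)) (hFm n).aestronglyMeasurable ?_
    exact ae_restrict_of_forall_mem measurableSet_Ioc (hF_small n)
  have hint_large : ∀ n : ℕ, n ≠ 0 → IntegrableOn (F n) (Ioi (1 / x)) := by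
    intro n hn
    have h1 : IntegrableOn (fun t : ℝ => B * ‖a n‖ * t ^ (-(n : ℝ) - 1)) (Ioi (1 / x)) := by
      refine (integrableOn_Ioi_rpow_of_lt ?_ hx1).const_mul _
      have : (1 : ℝ) ≤ n := by exact_mod_cast Nat.pos_of_ne_zero hn
      linarith
    refine Integrable.mono' h1 (hFm n).aestronglyMeasurable ?_
    exact ae_restrict_of_forall_mem measurableSet_Ioi (hF_large n)
  have hF0 : ∀ t : ℝ, F 0 t = 0 := by
    intro t
    simp only [hF, ha0, pow_zero, zero_mul, mul_zero, zero_div]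
  have hint : ∀ n : ℕ, IntegrableOn (F n) (Ioi 0) := by
    intro n
    rcases eq_or_ne n 0 with rfl | hn
    · have : F 0 = fun _ => 0 := funext hF0
      rw [this]
      exact integrableOn_zero
    · rw [hsplit]
      exact (hint_small n).union (hint_large n hn)
  have hnorm_le : ∀ n : ℕ, ∫ t in Ioi (0 : ℝ), ‖F n t‖ ≤ 2 * B * ‖a n‖ * x ^ n := by
    intro n
    rcases eq_or_ne n 0 with rfl | hn
    · simp only [hF0, norm_zero, integral_zero]
      positivity
    have hn1 : (1 : ℝ) ≤ n := by exact_mod_cast Nat.pos_of_ne_zero hn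
    have hdisj : Disjoint (Ioc (0 : ℝ) (1 / x)) (Ioi (1 / x)) :=
      Set.disjoint_left.2 fun t ht ht' => (not_lt.2 ht.2) ht'
    rw [hsplit, setIntegral_union hdisj measurableSet_Ioi (hint_small n).norm
      ((hint_large n hn).norm)]
    have h1 : ∫ t in Ioc (0 : ℝ) (1 / x), ‖F n t‖ ≤ B * ‖a n‖ * x ^ n := by
      have h2 : ∫ t in Ioc (0 : ℝ) (1 / x), ‖F n t‖ ≤
          ∫ t in Ioc (0 : ℝ) (1 / x), B * ‖a n‖ * x ^ (n + 1) := by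
        refine setIntegral_mono_on (hint_small n).norm (integrableOn_const
          (hs := measure_Ioc_lt_top.ne)) measurableSet_Ioc (hF_small n)
      rw [setIntegral_const, measureReal_def, Real.volume_Ioc, sub_zero,
        ENNReal.toReal_ofReal hx1.le, smul_eq_mul] at h2
      calc ∫ t in Ioc (0 : ℝ) (1 / x), ‖F n t‖ ≤ 1 / x * (B * ‖a n‖ * x ^ (n + 1)) := h2
        _ = B * ‖a n‖ * x ^ n := by rw [pow_succ]; field_simp
    have h2 : ∫ t in Ioi (1 / x), ‖F n t‖ ≤ B * ‖a n‖ * x ^ n := by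
      have h3 : ∫ t in Ioi (1 / x), ‖F n t‖ ≤ ∫ t in Ioi (1 / x), B * ‖a n‖ * t ^ (-(n : ℝ) - 1) := by
        refine setIntegral_mono_on (hint_large n hn).norm
          ((integrableOn_Ioi_rpow_of_lt (by linarith) hx1).const_mul _) measurableSet_Ioi
          (hF_large n)
      rw [integral_const_mul, integral_Ioi_rpow_of_lt (by linarith) hx1] at h3
      have h4 : -(1 / x) ^ (-(n : ℝ) - 1 + 1) / (-(n : ℝ) - 1 + 1) = x ^ n / n := by
        rw [show -(n : ℝ) - 1 + 1 = -(n : ℝ) by ring, one_div, Real.inv_rpow hx.le,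
          Real.rpow_neg hx.le, inv_inv, Real.rpow_natCast]
        field_simp
      rw [h4] at h3
      calc ∫ t in Ioi (1 / x), ‖F n t‖ ≤ B * ‖a n‖ * (x ^ n / n) := h3
        _ ≤ B * ‖a n‖ * (x ^ n / 1) := by
            gcongr
        _ = B * ‖a n‖ * x ^ n := by rw [div_one]
    linarith
  -- summability of `Σ ∫ ‖F n‖`
  have hS : Summable fun n : ℕ => ∫ t in Ioi (0 : ℝ), ‖F n t‖ := by
    refine Summable.of_nonneg_of_le (fun n => integral_nonneg fun t => norm_nonneg _) hnorm_le ?_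
    have := (ha x hx.le).mul_left (2 * B)
    refine this.congr fun n => ?_
    ring
  -- termwise values
  have hval : ∀ n : ℕ, ∫ t in Ioi (0 : ℝ), F n t =
      a n * (x : ℂ) ^ n / ((n : ℂ) * riemannZeta ((n : ℂ) + 1)) := by
    intro n
    rcases eq_or_ne n 0 with rfl | hn
    · simp only [hF0, integral_zero, ha0, zero_mul, zero_div]
    have h1 : ∀ t ∈ Ioi (0 : ℝ), F n t =
        a n * ((t : ℂ) ^ (-(n : ℂ) - 1) * (moebiusDivSum (t * x) : ℂ)) := by
      intro t ht
      have ht0 : (0 : ℝ) < t := ht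
      simp only [hF]
      rw [← one_div_pow_div_eq_cpow ht0 n, mul_comm t x]
      ring
    rw [setIntegral_congr_fun measurableSet_Ioi h1, integral_const_mul,
      integral_cpow_mul_moebiusDivSum_eq hx hn, Complex.cpow_natCast]
    ring
  -- assemble
  have hshift : Summable fun n : ℕ =>
      a (n + 1) * (x : ℂ) ^ (n + 1) / (((n + 1 : ℕ) : ℂ) * riemannZeta (((n + 1 : ℕ) : ℂ) + 1)) := by
    refine (summable_bdStar_term ha x).congr fun n => ?_
    push_cast
    rw [show (n : ℂ) + 1 + 1 = (n : ℂ) + 2 by ring]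
  unfold moebiusConv bdStar
  simp_rw [hsum]
  rw [← integral_tsum_of_summable_integral_norm hint hS]
  simp_rw [hval]
  rw [tsum_eq_zero_add'
    (f := fun n : ℕ => a n * (x : ℂ) ^ n / ((n : ℂ) * riemannZeta ((n : ℂ) + 1))) hshift]
  simp only [ha0, zero_mul, zero_div, zero_add]
  refine tsum_congr fun n => ?_
  push_cast
  rw [show (n : ℂ) + 1 + 1 = (n : ℂ) + 2 by ring]

end BaezDuarteMellin

open BaezDuarteMellin in
/-- **DISCHARGE of the named fact `BaezDuarte2005Moebius_thm_3_2`** = **Broughan Vol. 2 Thm 2.7**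
(Báez-Duarte, arXiv:math/0504402 Thm. 3.2 "Entire function RH criterion": for `φ(z) = Σ_{n≥1} a_n z^n`
entire and Mellin-proper, RH ⟺ `φ⋆(x) ≪ x^{−1/2+ε}`, `φ⋆(z) = Σ_{n≥1} a_n z^n/(n ζ(n+1))`): by
Proposition 3.1 (`moebiusConv_powerSeries_eq_bdStar`: `φ⋆(x) = Gφ(x)` for `x > 0`) the bound on
`φ⋆` is the bound on `Gφ`, and Theorem 3.1 (`BaezDuarte2005Moebius_thm_3_1_holds`) applies. An
equivalence is proved; neither side is asserted. [cite: BaezDuarte2005Moebius, Thm. 3.2 (arXiv; "Entire function RH criterion"); Broughan2017 Vol. 2 Thm 2.7 (§2.5)] -/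
theorem BaezDuarte2005Moebius_thm_3_2_holds : BaezDuarte2005Moebius_thm_3_2 := by
  intro a ha0 ha hφ
  rw [BaezDuarte2005Moebius_thm_3_1_holds _ hφ]
  have heq : moebiusConv (fun u : ℝ => ∑' n : ℕ, a n * (u : ℂ) ^ n) =ᶠ[atTop]
      fun x : ℝ => bdStar a x := by
    filter_upwards [eventually_gt_atTop (0 : ℝ)] with x hx
    exact moebiusConv_powerSeries_eq_bdStar ha0 ha hx
  exact forall₂_congr fun ε _ => isBigO_congr heq EventuallyEq.rfl

/-- Báez-Duarte's entire-function criterion (Broughan Vol. 2 Thm 2.7) as an `↔` theorem of the tree.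
[cite: BaezDuarte2005Moebius, Thm. 3.2 (arXiv; "Entire function RH criterion"); Broughan2017 Vol. 2 Thm 2.7 (§2.5)] -/
theorem riemannHypothesis_iff_bdStar_isBigO {a : ℕ → ℂ} (ha0 : a 0 = 0) (ha : IsEntireCoeff a)
    (hφ : IsMellinProper (fun x : ℝ ↦ ∑' n : ℕ, a n * (x : ℂ) ^ n)) :
    RiemannHypothesis ↔
      ∀ ε : ℝ, 0 < ε → (fun x : ℝ ↦ bdStar a x) =O[atTop] fun x : ℝ ↦ x ^ (-(1 / 2 : ℝ) + ε) :=
  BaezDuarte2005Moebius_thm_3_2_holds a ha0 ha hφ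

/-! ## §8 (appended) Báez-Duarte's (3.13) for merely proper `φ`, and non-vacuity: the
Hardy–Littlewood test function `β` is Mellin-proper (`β^∧(s) = −Γ(1 − s/2)`) -/

namespace BaezDuarteMellin

/-- **Báez-Duarte's Lemma 3.3, eq. (3.11)** (IJMMS Lemma 3.4 (3.12)) for a PROPER `φ`, from
finiteness of the norms `N_σ(Gφ)`, `−1/2 < σ < 0` (which `Gφ ≪ x^{−1/2+ε}` supplies):
`(Gφ)^∧(s) · s ζ(s+1) = φ^∧(s)` on the open strip `−1/2 < Re s < 0`. With
`D(s) = (Gφ)^∧(s) · s ζ(s+1) − φ^∧(s)` — holomorphic on the strip, continuous from the left and zero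
at `iτ` (`1 < τ < 2`) by (3.9) and (2.7) — boundary uniqueness gives `D ≡ 0` ("on account of (3.9)
and Lemma 2.1 … then invoke analytic continuation"). [cite: BaezDuarte2005Moebius, §3.1 Lemma 3.3 eq. (3.11)] -/
theorem leftMellin_moebiusConv_mul_eq_of_hasFiniteMellinNorm {φ : ℝ → ℂ} (hφ : IsMoebiusProper φ)
    (hGσ : ∀ σ : ℝ, -(1 / 2 : ℝ) < σ → σ < 0 → HasFiniteMellinNorm (moebiusConv φ) σ)
    {s : ℂ} (hs1 : -(1 / 2 : ℝ) < s.re) (hs2 : s.re < 0) :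
    leftMellin (moebiusConv φ) s * (s * riemannZeta (s + 1)) = leftMellin φ s := by
  obtain ⟨hφm, hN⟩ := hφ
  have hN0 : HasFiniteMellinNorm φ 0 := hN 0 (by norm_num) le_rfl
  have hg0 : HasFiniteMellinNorm (fun x : ℝ => (moebiusDivSum x : ℂ)) 0 :=
    hasFiniteMellinNorm_moebiusDivSum le_rfl
  have hG0 : HasFiniteMellinNorm (moebiusConv φ) 0 := by
    have h := hasFiniteMellinNorm_moebiusConv hφm (s := 0)
      (by rw [Complex.zero_re]; exact hN0) (by rw [Complex.zero_re]; exact hg0)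
    rwa [Complex.zero_re] at h
  -- the boundary function `D`
  have hDd : DifferentiableOn ℂ (fun s : ℂ =>
      leftMellin (moebiusConv φ) s * (s * riemannZeta (s + 1)) - leftMellin φ s)
      {s : ℂ | -(1 / 2 : ℝ) < s.re ∧ s.re < 0} := by
    have h1 := differentiableOn_leftMellin (measurable_moebiusConv hφm) hGσ
    have h2 := differentiableOn_leftMellin hφm (fun σ ha hb => hN σ ha hb.le)
    have h3 : DifferentiableOn ℂ (fun s : ℂ => s * riemannZeta (s + 1))
        {s : ℂ | -(1 / 2 : ℝ) < s.re ∧ s.re < 0} := by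
      intro z hz
      have hz1 : z + 1 ≠ 1 := by
        intro h
        have h0 : z = 0 := by linear_combination h
        rw [h0] at hz
        simp at hz
      have h4 : DifferentiableAt ℂ (fun w : ℂ => w + 1) z := differentiableAt_id.add_const 1
      exact (differentiableAt_id.mul (DifferentiableAt.comp (f := fun w : ℂ => w + 1) z
        (differentiableAt_riemannZeta hz1) h4)).differentiableWithinAt
    exact (h1.mul h3).sub h2
  have hDc : ∀ τ : ℝ, τ ∈ Ioo (1 : ℝ) 2 → ContinuousWithinAt (fun s : ℂ =>
      leftMellin (moebiusConv φ) s * (s * riemannZeta (s + 1)) - leftMellin φ s)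
      {s : ℂ | s.re ≤ 0} (τ * I) := by
    intro τ hτ
    have hτ0 : ((τ : ℂ) * I).re = 0 := by simp
    have hnhds : {s : ℂ | -(1 / 4 : ℝ) ≤ s.re ∧ s.re ≤ 0} ∈ 𝓝[{s : ℂ | s.re ≤ 0}] ((τ : ℂ) * I) := by
      have hlt : (τ : ℂ) * I ∈ {s : ℂ | -(1 / 4 : ℝ) < s.re} := by
        show -(1 / 4 : ℝ) < ((τ : ℂ) * I).re
        rw [hτ0]
        norm_num
      have h := inter_mem_nhdsWithin {s : ℂ | s.re ≤ 0}
        ((isOpen_lt continuous_const Complex.continuous_re).mem_nhds hlt)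
      exact Filter.mem_of_superset h fun z hz => ⟨le_of_lt (α := ℝ) hz.2, hz.1⟩
    have h1 : ContinuousWithinAt (leftMellin (moebiusConv φ)) {s : ℂ | s.re ≤ 0} (τ * I) :=
      (continuousWithinAt_leftMellin (measurable_moebiusConv hφm)
        (hGσ _ (by norm_num) (by norm_num)) hG0 _).mono_of_mem_nhdsWithin hnhds
    have h2 : ContinuousWithinAt (leftMellin φ) {s : ℂ | s.re ≤ 0} (τ * I) :=
      (continuousWithinAt_leftMellin hφm (hN _ (by norm_num) (by norm_num)) hN0 _).mono_of_mem_nhdsWithin hnhds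
    have h3 : ContinuousAt (fun s : ℂ => s * riemannZeta (s + 1)) (τ * I) := by
      have hs1 : (τ : ℂ) * I + 1 ≠ 1 := by
        intro h
        have h0 : (τ : ℂ) * I = 0 := by linear_combination h
        rcases mul_eq_zero.1 h0 with h5 | h5
        · have : τ = 0 := by exact_mod_cast h5
          linarith [hτ.1]
        · exact Complex.I_ne_zero h5
      have h4 : ContinuousAt (fun z : ℂ => z + 1) ((τ : ℂ) * I) :=
        (continuous_id.add continuous_const).continuousAt
      exact continuousAt_id.mul (ContinuousAt.comp (f := fun z : ℂ => z + 1)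
        (differentiableAt_riemannZeta hs1).continuousAt h4)
    exact (h1.mul h3.continuousWithinAt).sub h2
  have hD0 : ∀ τ : ℝ, τ ∈ Ioo (1 : ℝ) 2 → (fun s : ℂ =>
      leftMellin (moebiusConv φ) s * (s * riemannZeta (s + 1)) - leftMellin φ s) (τ * I) = 0 := by
    intro τ hτ
    have hsre : ((τ : ℂ) * I).re = 0 := by simp
    have hτ0 : (τ : ℂ) * I ≠ 0 := by
      intro h0
      rcases mul_eq_zero.1 h0 with h5 | h5
      · have : τ = 0 := by exact_mod_cast h5
        linarith [hτ.1]
      · exact Complex.I_ne_zero h5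
    have hfac := leftMellin_moebiusConv_eq hφm (s := (τ : ℂ) * I)
      (by rw [hsre]; exact hN0) (by rw [hsre]; exact hg0)
    have h27 := riemannZeta_mul_leftMellin_moebiusDivSum_of_re_eq_zero hsre hτ0
    simp only
    rw [hfac]
    linear_combination (leftMellin φ ((τ : ℂ) * I)) * h27
  -- `D ≡ 0` on the strip
  have hDs := eq_zero_of_eqOn_boundary_segment hDd hDc hD0 hs1 hs2
  exact sub_eq_zero.1 hDs



/-- **Báez-Duarte's Lemma 3.3, eq. (3.11)** (IJMMS Lemma 3.4 (3.12)) for a PROPER `φ` with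
`Gφ(x) ≪_ε x^{−1/2+ε}`: `(Gφ)^∧(s) · s ζ(s+1) = φ^∧(s)` on the open strip `−1/2 < Re s < 0`
(i.e. `(Gφ)^∧ = φ^∧/(s ζ(s+1))` there). [cite: BaezDuarte2005Moebius, §3.1 Lemma 3.3 eq. (3.11)] -/
theorem leftMellin_moebiusConv_mul_eq {φ : ℝ → ℂ} (hφ : IsMoebiusProper φ)
    (hG : ∀ ε : ℝ, 0 < ε → moebiusConv φ =O[atTop] fun x : ℝ ↦ x ^ (-(1 / 2 : ℝ) + ε))
    {s : ℂ} (hs1 : -(1 / 2 : ℝ) < s.re) (hs2 : s.re < 0) :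
    leftMellin (moebiusConv φ) s * (s * riemannZeta (s + 1)) = leftMellin φ s := by
  have hG0 : HasFiniteMellinNorm (moebiusConv φ) 0 := hasFiniteMellinNorm_moebiusConv_zero hφ
  refine leftMellin_moebiusConv_mul_eq_of_hasFiniteMellinNorm hφ (fun σ h1 h2 => ?_) hs1 hs2
  exact hasFiniteMellinNorm_moebiusConv_of_isBigO hφ.1 hG0 h2
    (e := -(1 / 2 : ℝ) + (σ + 1 / 2) / 2) (by linarith) (hG _ (by linarith))

/-- **Báez-Duarte's (3.13)** (Thm. 3.1 for PROPER `φ`, no non-vanishing assumed): if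
`Gφ(x) ≪_ε x^{−1/2+ε}` for every `ε > 0`, then `ζ(s+1) = 0 ⟹ φ^∧(s) = 0` for every `s` with
`Re s > −1/2` ("where only `σ > −1/2` is considered"; for `Re s ≥ 0` the hypothesis `ζ(s+1) = 0` is
void). "Just read off from Lemma 3.3": (3.11) at a zero of `ζ(s+1)` reads `φ^∧(s) = 0`.
[cite: BaezDuarte2005Moebius, Thm. 3.1 eq. (3.13) (via Lemma 3.3 eq. (3.11))] -/
theorem leftMellin_eq_zero_of_riemannZeta_eq_zero {φ : ℝ → ℂ} (hφ : IsMoebiusProper φ)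
    (hG : ∀ ε : ℝ, 0 < ε → moebiusConv φ =O[atTop] fun x : ℝ ↦ x ^ (-(1 / 2 : ℝ) + ε))
    {s : ℂ} (hs : -(1 / 2 : ℝ) < s.re) (hζ : riemannZeta (s + 1) = 0) : leftMellin φ s = 0 := by
  -- for `Re s ≥ 0` there is nothing to prove: `ζ(s+1) ≠ 0`
  rcases le_or_gt 0 s.re with hs0 | hs0
  · exact absurd hζ (riemannZeta_ne_zero_of_one_le_re
      (by simp only [Complex.add_re, Complex.one_re]; linarith))
  have h := leftMellin_moebiusConv_mul_eq hφ hG hs hs0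
  rw [hζ, mul_zero, mul_zero] at h
  exact h.symm

/-- The Mellin integrand of `β` in closed form: for `x > 0`,
`x^{−s−1} · (−2x²e^{−x²}) = −2 x^{1−s} e^{−x²}`. [cite: BaezDuarte2005Moebius, §3.1 eq. (3.7)] -/
private theorem cpow_mul_hlBeta {x : ℝ} (hx : 0 < x) (s : ℂ) :
    (x : ℂ) ^ (-s - 1) * ((((-2 * x ^ 2 * Real.exp (-x ^ 2)) : ℝ)) : ℂ) =
      -2 * ((x : ℂ) ^ (1 - s) * (Real.exp (-x ^ 2) : ℂ)) := by
  have hx' : (x : ℂ) ≠ 0 := Complex.ofReal_ne_zero.2 hx.ne'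
  have h1 : (x : ℂ) ^ (1 - s) = (x : ℂ) ^ (-s - 1) * (x : ℂ) ^ 2 := by
    rw [← Complex.cpow_two, ← Complex.cpow_add _ _ hx']
    ring_nf
  rw [h1]
  push_cast
  ring

/-- **`β^∧(s) = −Γ(1 − s/2)` for `Re s < 2`** (`β(x) = −2x²e^{−x²}`; substitution `u = x²` and
Euler's integral): the Mellin transform Báez-Duarte alludes to after (3.7) ("It is quite easy to see
that both `α` and `β` are mellin-proper"). [cite: BaezDuarte2005Moebius, §3.1 eq. (3.7)] -/
theorem leftMellin_hlBeta {s : ℂ} (hs : s.re < 2) :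
    leftMellin (fun u : ℝ ↦ (((-2 * u ^ 2 * Real.exp (-u ^ 2)) : ℝ) : ℂ)) s =
      -Complex.Gamma (1 - s / 2) := by
  unfold leftMellin
  rw [setIntegral_congr_fun measurableSet_Ioi (fun x hx => cpow_mul_hlBeta hx s),
    integral_const_mul]
  -- `∫₀^∞ x^{1−s} e^{−x²} dx = (1/2) Γ(1 − s/2)` by `u = x²`
  have hsub : ∫ x in Ioi (0 : ℝ), (x : ℂ) ^ (1 - s) * (Real.exp (-x ^ 2) : ℂ) =
      ∫ u in Ioi (0 : ℝ), (1 / 2 : ℂ) * ((Real.exp (-u) : ℂ) * (u : ℂ) ^ (1 - s / 2 - 1)) := by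
    rw [← integral_comp_rpow_Ioi_of_pos (g := fun u : ℝ =>
      (1 / 2 : ℂ) * ((Real.exp (-u) : ℂ) * (u : ℂ) ^ (1 - s / 2 - 1))) two_pos]
    refine setIntegral_congr_fun measurableSet_Ioi fun x hx => ?_
    have hx0 : (0 : ℝ) < x := hx
    have hx' : (x : ℂ) ≠ 0 := Complex.ofReal_ne_zero.2 hx0.ne'
    have hlog : (Complex.log (x : ℂ) * 2).im = 0 := by
      rw [Complex.mul_im, ← Complex.ofReal_log hx0.le]
      simp
    have h2 : ((x ^ (2 : ℝ) : ℝ) : ℂ) ^ (1 - s / 2 - 1) = (x : ℂ) ^ (-s) := by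
      rw [Complex.ofReal_cpow hx0.le, show ((2 : ℝ) : ℂ) = 2 by norm_num,
        ← Complex.cpow_mul _ (by rw [hlog]; exact neg_lt_zero.2 Real.pi_pos)
          (by rw [hlog]; exact Real.pi_pos.le)]
      ring_nf
    rw [Complex.real_smul, show (2 : ℝ) - 1 = 1 by norm_num, Real.rpow_one, h2, Real.rpow_two]
    push_cast
    have h3 : (x : ℂ) ^ (1 - s) = (x : ℂ) * (x : ℂ) ^ (-s) := by
      rw [show (1 : ℂ) - s = 1 + -s by ring, Complex.cpow_add _ _ hx', Complex.cpow_one]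
    rw [h3]
    ring
  rw [hsub, integral_const_mul, ← Complex.GammaIntegral, ← Complex.Gamma_eq_integral
    (by simp only [Complex.sub_re, Complex.one_re, Complex.div_ofNat_re]; linarith)]
  ring

/-- **The Hardy–Littlewood test function `β(x) = −2x²e^{−x²}` is Mellin-proper** ("It is quite easy to
see that both `α` and `β` are mellin-proper"): proper (tree: `isMoebiusProper_hlBeta`) and
`β^∧(s) = −Γ(1 − s/2) ≠ 0`. So the hypothesis class of Theorem 3.1 is inhabited, and Theorem 3.1 at
`φ = β` with (3.7) `Gβ(x) = H(x²)` is the Hardy–Littlewood criterion.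
[cite: BaezDuarte2005Moebius, §3.1 eq. (3.7) (β is mellin-proper)] -/
theorem isMellinProper_hlBeta :
    IsMellinProper (fun u : ℝ ↦ (((-2 * u ^ 2 * Real.exp (-u ^ 2)) : ℝ) : ℂ)) := by
  refine ⟨isMoebiusProper_hlBeta, fun s _ h2 => ?_⟩
  rw [leftMellin_hlBeta (by linarith)]
  exact neg_ne_zero.2 (Complex.Gamma_ne_zero_of_re_pos
    (by simp only [Complex.sub_re, Complex.one_re, Complex.div_ofNat_re]; linarith))

end BaezDuarteMellin

open BaezDuarteMellin in
/-- **Theorem 3.1 at `φ = β`** (the instance that "immediately proves the Hardy–Littlewood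
criterion" via (3.7) `Gβ(x) = H(x²)`): RH ⟺ `Gβ(x) ≪_ε x^{−1/2+ε}`.
[cite: BaezDuarte2005Moebius, Thm. 3.2 and eq. (3.7) ("immediately proves … the Hardy–Littlewood criteria")] -/
theorem riemannHypothesis_iff_moebiusConv_hlBeta_isBigO :
    RiemannHypothesis ↔ ∀ ε : ℝ, 0 < ε →
      moebiusConv (fun u : ℝ ↦ (((-2 * u ^ 2 * Real.exp (-u ^ 2)) : ℝ) : ℂ)) =O[atTop]
        fun x : ℝ ↦ x ^ (-(1 / 2 : ℝ) + ε) :=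
  BaezDuarte2005Moebius_thm_3_1_holds _ isMellinProper_hlBeta

/-! ## §9 (appended) The published sufficient condition for properness (IJMMS p. 3604) -/

namespace BaezDuarteMellin

/-- An entire power series `Σ a_n x^n` (infinite radius of convergence) is continuous on `ℝ`
(locally uniform convergence: on `(x₀−1, x₀+1)` the terms are bounded by `‖a_n‖ (|x₀|+1)^n`).
[cite: BaezDuarte2005Moebius, §3 eq. (3.2) (φ entire)] -/
theorem continuous_powerSeries {a : ℕ → ℂ} (ha : IsEntireCoeff a) :
    Continuous fun x : ℝ => ∑' n : ℕ, a n * (x : ℂ) ^ n := by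
  refine continuous_iff_continuousAt.2 fun x₀ => ?_
  have hcont : ContinuousOn (fun x : ℝ => ∑' n : ℕ, a n * (x : ℂ) ^ n) (Metric.ball x₀ 1) := by
    refine continuousOn_tsum (fun n => ?_) (ha (|x₀| + 1) (by positivity)) fun n x hx => ?_
    · exact (continuous_const.mul ((Complex.continuous_ofReal).pow n)).continuousOn
    · rw [Metric.mem_ball, Real.dist_eq] at hx
      rw [norm_mul, norm_pow, Complex.norm_real, Real.norm_eq_abs]
      gcongr
      have := abs_sub_abs_le_abs_sub x x₀
      linarith
  exact hcont.continuousAt (Metric.ball_mem_nhds x₀ one_pos)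

/-- Near `0` an entire power series vanishing at `0` is `O(x)`: for `0 ≤ x ≤ 1`,
`‖Σ a_n x^n‖ ≤ x · Σ_n ‖a_n‖` (`a_0 = 0`, `x^n ≤ x` for `n ≥ 1`).
[cite: BaezDuarte2005Moebius, §3 eq. (3.2) (φ vanishing at zero)] -/
theorem norm_powerSeries_le_mul {a : ℕ → ℂ} (ha0 : a 0 = 0) (ha : IsEntireCoeff a) {x : ℝ}
    (hx0 : 0 ≤ x) (hx1 : x ≤ 1) :
    ‖∑' n : ℕ, a n * (x : ℂ) ^ n‖ ≤ x * ∑' n : ℕ, ‖a n‖ * 1 ^ n := by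
  have hs1 : Summable fun n : ℕ => ‖a n‖ * 1 ^ n := ha 1 zero_le_one
  have hbound : ∀ n : ℕ, ‖a n * (x : ℂ) ^ n‖ ≤ x * (‖a n‖ * 1 ^ n) := by
    intro n
    rcases Nat.eq_zero_or_pos n with rfl | hn
    · simp [ha0]
    · rw [norm_mul, norm_pow, Complex.norm_real, Real.norm_of_nonneg hx0, one_pow, mul_one]
      have hxn : x ^ n ≤ x := by
        calc x ^ n ≤ x ^ 1 := pow_le_pow_of_le_one hx0 hx1 hn
          _ = x := pow_one x
      nlinarith [norm_nonneg (a n), pow_nonneg hx0 n]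
  have hs2 : Summable fun n : ℕ => a n * (x : ℂ) ^ n :=
    .of_norm_bounded (hs1.mul_left x) hbound
  calc ‖∑' n : ℕ, a n * (x : ℂ) ^ n‖ ≤ ∑' n : ℕ, ‖a n * (x : ℂ) ^ n‖ := norm_tsum_le_tsum_norm hs2.norm
    _ ≤ ∑' n : ℕ, x * (‖a n‖ * 1 ^ n) :=
        Summable.tsum_le_tsum hbound hs2.norm (hs1.mul_left x)
    _ = x * ∑' n : ℕ, ‖a n‖ * 1 ^ n := tsum_mul_left

/-- **The published sufficient condition for properness** (IJMMS 2005:22, p. 3604, after Thm. 3.5):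
"If an entire function `φ` vanishes at zero, and `φ(x) ≪ x^{−a}` for some `a ≥ 1/2`, then it is
proper" — here for `φ(x) = Σ_{n≥1} a_n x^n` with infinite radius of convergence: `N_σ(φ) < ∞` for
`σ ∈ (−1/2, 0]` (near `0`, `x^{−σ−1}|φ(x)| ≤ S x^{−σ} ≤ S`; on `[1, X]` continuity; beyond `X`,
`x^{−σ−1−a}` is integrable since `σ + a > 0`). [cite: BaezDuarte2005Moebius, Thm. 3.5 (IJMMS; remark following it, p. 3604)] -/
theorem isMoebiusProper_powerSeries_of_isBigO {a : ℕ → ℂ} (ha0 : a 0 = 0) (ha : IsEntireCoeff a)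
    {A : ℝ} (hA : 1 / 2 ≤ A)
    (hφ : (fun x : ℝ => ∑' n : ℕ, a n * (x : ℂ) ^ n) =O[atTop] fun x : ℝ => x ^ (-A)) :
    IsMoebiusProper (fun x : ℝ => ∑' n : ℕ, a n * (x : ℂ) ^ n) := by
  have hcont := continuous_powerSeries ha
  refine ⟨hcont.measurable, fun σ hσ1 hσ2 => ?_⟩
  obtain ⟨C, hC⟩ := hφ.bound
  rw [eventually_atTop] at hC
  obtain ⟨X, hX⟩ := hC
  have hX₀1 : (1 : ℝ) ≤ max X 1 := le_max_right _ _
  have hX₀0 : (0 : ℝ) < max X 1 := by linarith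
  set S : ℝ := ∑' n : ℕ, ‖a n‖ * 1 ^ n with hS
  have hS0 : 0 ≤ S := tsum_nonneg fun n => by positivity
  -- a bound `M` for `‖φ‖` on `[1, max X 1]`
  obtain ⟨M, hM⟩ := (isCompact_Icc (a := (1 : ℝ)) (b := max X 1)).exists_bound_of_continuousOn
    hcont.continuousOn
  have hM0 : 0 ≤ M := (norm_nonneg _).trans (hM 1 ⟨le_rfl, hX₀1⟩)
  have hmeas : Measurable fun x : ℝ => x ^ (-σ - 1) * ‖∑' n : ℕ, a n * (x : ℂ) ^ n‖ :=
    (measurable_id.pow_const _).mul hcont.measurable.norm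
  unfold HasFiniteMellinNorm
  have hsplit : Ioi (0 : ℝ) = Ioc 0 (max X 1) ∪ Ioi (max X 1) :=
    (Ioc_union_Ioi_eq_Ioi hX₀0.le).symm
  rw [hsplit]
  refine IntegrableOn.union ?_ ?_
  · -- on `(0, max X 1]` the integrand is bounded by `S + M (max X 1)^{−σ}`
    refine Integrable.mono' (integrableOn_const (C := S + M * (max X 1) ^ (-σ))
      (hs := measure_Ioc_lt_top.ne)) hmeas.aestronglyMeasurable ?_
    refine ae_restrict_of_forall_mem measurableSet_Ioc fun x hx => ?_
    have hx0 : 0 < x := hx.1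
    rw [Real.norm_eq_abs, abs_of_nonneg (mul_nonneg (Real.rpow_nonneg hx0.le _) (norm_nonneg _))]
    have hpow1 : (0 : ℝ) ≤ M * (max X 1) ^ (-σ) := mul_nonneg hM0 (Real.rpow_nonneg hX₀0.le _)
    rcases le_or_gt x 1 with hx1 | hx1
    · -- `x ≤ 1`: `x^{−σ−1} ‖φ x‖ ≤ x^{−σ−1} · x S = x^{−σ} S ≤ S`
      have h1 := norm_powerSeries_le_mul ha0 ha hx0.le hx1
      have hxσ : x ^ (-σ) ≤ 1 := Real.rpow_le_one hx0.le hx1 (by linarith)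
      calc x ^ (-σ - 1) * ‖∑' n : ℕ, a n * (x : ℂ) ^ n‖ ≤ x ^ (-σ - 1) * (x * S) :=
            mul_le_mul_of_nonneg_left h1 (Real.rpow_nonneg hx0.le _)
        _ = x ^ (-σ) * S := by
            rw [show -σ - 1 = -σ + (-1) by ring, Real.rpow_add hx0, Real.rpow_neg_one]
            field_simp
        _ ≤ 1 * S := mul_le_mul_of_nonneg_right hxσ hS0
        _ ≤ S + M * (max X 1) ^ (-σ) := by linarith
    · -- `1 < x ≤ max X 1`: `x^{−σ−1} ≤ x^{−σ} ≤ (max X 1)^{−σ}` and `‖φ x‖ ≤ M`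
      have h1 : ‖∑' n : ℕ, a n * (x : ℂ) ^ n‖ ≤ M := hM x ⟨hx1.le, hx.2⟩
      have h2 : x ^ (-σ - 1) ≤ (max X 1) ^ (-σ) :=
        calc x ^ (-σ - 1) ≤ x ^ (-σ) := Real.rpow_le_rpow_of_exponent_le hx1.le (by linarith)
          _ ≤ (max X 1) ^ (-σ) := Real.rpow_le_rpow hx0.le hx.2 (by linarith)
      calc x ^ (-σ - 1) * ‖∑' n : ℕ, a n * (x : ℂ) ^ n‖ ≤ (max X 1) ^ (-σ) * M :=
            mul_le_mul h2 h1 (norm_nonneg _) (Real.rpow_nonneg hX₀0.le _)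
        _ ≤ S + M * (max X 1) ^ (-σ) := by linarith [mul_comm M ((max X 1) ^ (-σ))]
  · -- beyond `max X 1`: `≤ C x^{−A−σ−1}`, integrable since `−A − σ − 1 < −1`
    have h2 : IntegrableOn (fun x : ℝ => C * x ^ (-A + (-σ - 1))) (Ioi (max X 1)) :=
      (integrableOn_Ioi_rpow_of_lt (by linarith) hX₀0).const_mul C
    refine Integrable.mono' h2 hmeas.aestronglyMeasurable ?_
    refine ae_restrict_of_forall_mem measurableSet_Ioi fun x hx => ?_
    have hxX : max X 1 < x := hx
    have hx0 : 0 < x := by linarith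
    have hb := hX x ((le_max_left _ _).trans hxX.le)
    rw [Real.norm_of_nonneg (Real.rpow_nonneg hx0.le _)] at hb
    rw [Real.norm_eq_abs, abs_of_nonneg (mul_nonneg (Real.rpow_nonneg hx0.le _) (norm_nonneg _))]
    calc x ^ (-σ - 1) * ‖∑' n : ℕ, a n * (x : ℂ) ^ n‖ ≤ x ^ (-σ - 1) * (C * x ^ (-A)) :=
          mul_le_mul_of_nonneg_left hb (Real.rpow_nonneg hx0.le _)
      _ = C * x ^ (-A + (-σ - 1)) := by rw [Real.rpow_add hx0]; ring

end BaezDuarteMellin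

open BaezDuarteMellin in
/-- **The entire-function criterion with the published properness test**: if `φ(z) = Σ_{n≥1} a_n z^n`
is entire, `φ(x) ≪ x^{−a}` at `+∞` for some `a ≥ 1/2` (so `φ` is proper, IJMMS p. 3604), and
`φ^∧ ≠ 0` on `−1/2 < Re s < 0`, then RH ⟺ `φ⋆(x) ≪_ε x^{−1/2+ε}`.
[cite: BaezDuarte2005Moebius, Thm. 3.2 (arXiv) with the properness remark of IJMMS p. 3604] -/
theorem riemannHypothesis_iff_bdStar_isBigO_of_decay {a : ℕ → ℂ} (ha0 : a 0 = 0)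
    (ha : IsEntireCoeff a) {A : ℝ} (hA : 1 / 2 ≤ A)
    (hdecay : (fun x : ℝ => ∑' n : ℕ, a n * (x : ℂ) ^ n) =O[atTop] fun x : ℝ => x ^ (-A))
    (hne : ∀ s : ℂ, -(1 / 2 : ℝ) < s.re → s.re < 0 →
      leftMellin (fun x : ℝ => ∑' n : ℕ, a n * (x : ℂ) ^ n) s ≠ 0) :
    RiemannHypothesis ↔
      ∀ ε : ℝ, 0 < ε → (fun x : ℝ ↦ bdStar a x) =O[atTop] fun x : ℝ ↦ x ^ (-(1 / 2 : ℝ) + ε) :=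
  BaezDuarte2005Moebius_thm_3_2_holds a ha0 ha ⟨isMoebiusProper_powerSeries_of_isBigO ha0 ha hA hdecay, hne⟩

/-! ## §10 (appended) Theorem 4.1: `Gφ(x) ≪ x^{−1/2}` (no `ε`) gives RH *with simple zeros* ("RHS") -/

namespace BaezDuarteMellin

/-- `ε`-weakening of a power bound at `+∞`: `f = O(x^e)` implies `f = O(x^{e+ε})` for `ε ≥ 0`.
[cite: BaezDuarte2005Moebius, §4 Thm. 4.1 (proof: the `ε`-free bound implies the bounds of Thm. 3.1)] -/
theorem isBigO_rpow_add {f : ℝ → ℂ} {e ε : ℝ} (hε : 0 ≤ ε) (h : f =O[atTop] fun x : ℝ => x ^ e) :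
    f =O[atTop] fun x : ℝ => x ^ (e + ε) := by
  refine h.trans (IsBigO.of_bound 1 ?_)
  filter_upwards [eventually_ge_atTop (1 : ℝ)] with x hx
  rw [one_mul, Real.norm_of_nonneg (Real.rpow_nonneg (by linarith) _),
    Real.norm_of_nonneg (Real.rpow_nonneg (by linarith) _)]
  exact Real.rpow_le_rpow_of_exponent_le hx (by linarith)

/-- **The key estimate of Thm. 4.1, with the constant kept**: for proper `φ` with
`|Gφ(x)| ≤ C x^{−1/2}` eventually (`C > 0`) there is `A ≥ 0` with
`‖(Gφ)^∧(s)‖ ≤ A + C/(Re s + 1/2)` on the whole strip `−1/2 < Re s < 0` — the part over `(0, X]`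
is controlled by `N_0(Gφ)` (Lemma 3.2: `x^{−σ} ≤ X^{1/2}` there), the tail by
`C ∫_X^∞ x^{−σ−3/2} dx ≤ C/(σ + 1/2)` (`X ≥ 1`). [cite: BaezDuarte2005Moebius, §4 Thm. 4.1 (proof, (4.3)) and Prop. 4.3 (proof)] -/
theorem norm_leftMellin_moebiusConv_le_of_isBigOWith {φ : ℝ → ℂ} (hφ : IsMoebiusProper φ) {C : ℝ}
    (hC0 : 0 < C) (hG : IsBigOWith C atTop (moebiusConv φ) fun x : ℝ ↦ x ^ (-(1 / 2 : ℝ))) :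
    ∃ A : ℝ, 0 ≤ A ∧ ∀ s : ℂ, -(1 / 2 : ℝ) < s.re → s.re < 0 →
      ‖leftMellin (moebiusConv φ) s‖ ≤ A + C / (s.re + 1 / 2) := by
  obtain ⟨hφm, hN⟩ := hφ
  have hC := hG.bound
  rw [eventually_atTop] at hC
  obtain ⟨X, hX⟩ := hC
  have hX₁1 : (1 : ℝ) ≤ max X 1 := le_max_right _ _
  have hX₁0 : (0 : ℝ) < max X 1 := by linarith
  have hN0 : HasFiniteMellinNorm φ 0 := hN 0 (by norm_num) le_rfl
  have hg0 : HasFiniteMellinNorm (fun x : ℝ => (moebiusDivSum x : ℂ)) 0 :=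
    hasFiniteMellinNorm_moebiusDivSum le_rfl
  have hG0 : HasFiniteMellinNorm (moebiusConv φ) 0 := by
    have h := hasFiniteMellinNorm_moebiusConv hφm (s := 0)
      (by rw [Complex.zero_re]; exact hN0) (by rw [Complex.zero_re]; exact hg0)
    rwa [Complex.zero_re] at h
  set N : ℝ := ∫ x in Ioi (0 : ℝ), x ^ (-(0 : ℝ) - 1) * ‖moebiusConv φ x‖ with hNdef
  have hNnn : 0 ≤ N := setIntegral_nonneg measurableSet_Ioi fun x hx =>
    mul_nonneg (Real.rpow_nonneg (le_of_lt hx) _) (norm_nonneg _)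
  refine ⟨(max X 1) ^ (1 / 2 : ℝ) * N, by positivity, fun s hs1 hs2 => ?_⟩
  have hGσ : HasFiniteMellinNorm (moebiusConv φ) s.re :=
    hasFiniteMellinNorm_moebiusConv_of_isBigO hφm hG0 hs2 (e := -(1 / 2 : ℝ)) hs1 hG.isBigO
  unfold HasFiniteMellinNorm at hGσ hG0
  -- `‖∫‖ ≤ ∫ ‖·‖`
  have h1 : ‖leftMellin (moebiusConv φ) s‖ ≤
      ∫ x in Ioi (0 : ℝ), x ^ (-s.re - 1) * ‖moebiusConv φ x‖ := by
    unfold leftMellin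
    refine (norm_integral_le_integral_norm _).trans (le_of_eq ?_)
    exact setIntegral_congr_fun measurableSet_Ioi fun x hx => norm_cpow_mul hx s
  have hsplit : Ioi (0 : ℝ) = Ioc 0 (max X 1) ∪ Ioi (max X 1) :=
    (Ioc_union_Ioi_eq_Ioi hX₁0.le).symm
  have hdisj : Disjoint (Ioc (0 : ℝ) (max X 1)) (Ioi (max X 1)) :=
    Set.disjoint_left.2 fun t ht ht' => (not_lt.2 ht.2) ht'
  rw [hsplit, setIntegral_union hdisj measurableSet_Ioi (hGσ.mono_set Ioc_subset_Ioi_self)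
    (hGσ.mono_set (Ioi_subset_Ioi hX₁0.le))] at h1
  -- piece over `(0, max X 1]`
  have hp1 : ∫ x in Ioc (0 : ℝ) (max X 1), x ^ (-s.re - 1) * ‖moebiusConv φ x‖ ≤
      (max X 1) ^ (1 / 2 : ℝ) * N := by
    have hle : ∀ x ∈ Ioc (0 : ℝ) (max X 1), x ^ (-s.re - 1) * ‖moebiusConv φ x‖ ≤
        (max X 1) ^ (1 / 2 : ℝ) * (x ^ (-(0 : ℝ) - 1) * ‖moebiusConv φ x‖) := by
      intro x hx
      have hx0 : 0 < x := hx.1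
      have hxσ : x ^ (-s.re) ≤ (max X 1) ^ (1 / 2 : ℝ) := by
        rcases le_or_gt x 1 with hx1 | hx1
        · exact (Real.rpow_le_one hx0.le hx1 (by linarith)).trans
            (Real.one_le_rpow hX₁1 (by norm_num))
        · calc x ^ (-s.re) ≤ (max X 1) ^ (-s.re) := Real.rpow_le_rpow hx0.le hx.2 (by linarith)
            _ ≤ (max X 1) ^ (1 / 2 : ℝ) := Real.rpow_le_rpow_of_exponent_le hX₁1 (by linarith)
      calc x ^ (-s.re - 1) * ‖moebiusConv φ x‖
          = x ^ (-s.re) * (x ^ (-(0 : ℝ) - 1) * ‖moebiusConv φ x‖) := by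
            rw [show -s.re - 1 = -s.re + (-(0 : ℝ) - 1) by ring, Real.rpow_add hx0]; ring
        _ ≤ (max X 1) ^ (1 / 2 : ℝ) * (x ^ (-(0 : ℝ) - 1) * ‖moebiusConv φ x‖) :=
            mul_le_mul_of_nonneg_right hxσ (mul_nonneg (Real.rpow_nonneg hx0.le _) (norm_nonneg _))
    calc ∫ x in Ioc (0 : ℝ) (max X 1), x ^ (-s.re - 1) * ‖moebiusConv φ x‖
        ≤ ∫ x in Ioc (0 : ℝ) (max X 1), (max X 1) ^ (1 / 2 : ℝ) * (x ^ (-(0 : ℝ) - 1) * ‖moebiusConv φ x‖) :=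
          setIntegral_mono_on (hGσ.mono_set Ioc_subset_Ioi_self)
            ((hG0.mono_set Ioc_subset_Ioi_self).const_mul _) measurableSet_Ioc hle
      _ = (max X 1) ^ (1 / 2 : ℝ) * ∫ x in Ioc (0 : ℝ) (max X 1), x ^ (-(0 : ℝ) - 1) * ‖moebiusConv φ x‖ :=
          integral_const_mul _ _
      _ ≤ (max X 1) ^ (1 / 2 : ℝ) * N := by
          refine mul_le_mul_of_nonneg_left ?_ (Real.rpow_nonneg hX₁0.le _)
          exact setIntegral_mono_set hG0
            (ae_restrict_of_forall_mem measurableSet_Ioi fun x hx =>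
              mul_nonneg (Real.rpow_nonneg (le_of_lt hx) _) (norm_nonneg _))
            Ioc_subset_Ioi_self.eventuallyLE
  -- tail piece
  have hp2 : ∫ x in Ioi (max X 1), x ^ (-s.re - 1) * ‖moebiusConv φ x‖ ≤
      C / (s.re + 1 / 2) := by
    have hint2 : IntegrableOn (fun x : ℝ => C * x ^ (-(1 / 2 : ℝ) + (-s.re - 1)))
        (Ioi (max X 1)) :=
      (integrableOn_Ioi_rpow_of_lt (by linarith) hX₁0).const_mul _
    have hle : ∀ x ∈ Ioi (max X 1), x ^ (-s.re - 1) * ‖moebiusConv φ x‖ ≤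
        C * x ^ (-(1 / 2 : ℝ) + (-s.re - 1)) := by
      intro x hx
      have hxX : max X 1 < x := hx
      have hx0 : 0 < x := by linarith
      have hb := hX x ((le_max_left _ _).trans hxX.le)
      rw [Real.norm_of_nonneg (Real.rpow_nonneg hx0.le _)] at hb
      have hb' : ‖moebiusConv φ x‖ ≤ C * x ^ (-(1 / 2 : ℝ)) := hb
      calc x ^ (-s.re - 1) * ‖moebiusConv φ x‖ ≤ x ^ (-s.re - 1) * (C * x ^ (-(1 / 2 : ℝ))) :=
            mul_le_mul_of_nonneg_left hb' (Real.rpow_nonneg hx0.le _)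
        _ = C * x ^ (-(1 / 2 : ℝ) + (-s.re - 1)) := by rw [Real.rpow_add hx0]; ring
    calc ∫ x in Ioi (max X 1), x ^ (-s.re - 1) * ‖moebiusConv φ x‖
        ≤ ∫ x in Ioi (max X 1), C * x ^ (-(1 / 2 : ℝ) + (-s.re - 1)) :=
          setIntegral_mono_on (hGσ.mono_set (Ioi_subset_Ioi hX₁0.le)) hint2 measurableSet_Ioi hle
      _ = C * ((max X 1) ^ (-(s.re + 1 / 2)) / (s.re + 1 / 2)) := by
          rw [integral_const_mul, integral_Ioi_rpow_of_lt (by linarith) hX₁0,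
            show -(1 / 2 : ℝ) + (-s.re - 1) + 1 = -(s.re + 1 / 2) by ring, div_neg, neg_div, neg_neg]
      _ ≤ C * (1 / (s.re + 1 / 2)) := by
          refine mul_le_mul_of_nonneg_left ?_ (by positivity)
          exact div_le_div_of_nonneg_right
            (Real.rpow_le_one_of_one_le_of_nonpos hX₁1 (by linarith)) (by linarith)
      _ = C / (s.re + 1 / 2) := by ring
  linarith

/-- **The key estimate of Thm. 4.1**: for proper `φ` with `Gφ(x) ≪ x^{−1/2}` there are `A ≥ 0`,
`C > 0` with `‖(Gφ)^∧(s)‖ ≤ A + C/(Re s + 1/2)` on the whole strip `−1/2 < Re s < 0`.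
[cite: BaezDuarte2005Moebius, §4 Thm. 4.1 (proof)] -/
theorem norm_leftMellin_moebiusConv_le {φ : ℝ → ℂ} (hφ : IsMoebiusProper φ)
    (hG : moebiusConv φ =O[atTop] fun x : ℝ ↦ x ^ (-(1 / 2 : ℝ))) :
    ∃ A C : ℝ, 0 ≤ A ∧ 0 < C ∧ ∀ s : ℂ, -(1 / 2 : ℝ) < s.re → s.re < 0 →
      ‖leftMellin (moebiusConv φ) s‖ ≤ A + C / (s.re + 1 / 2) := by
  obtain ⟨C, hC0, hGC⟩ := hG.exists_pos
  obtain ⟨A, hA, h⟩ := norm_leftMellin_moebiusConv_le_of_isBigOWith hφ hC0 hGC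
  exact ⟨A, C, hA, hC0, h⟩

end BaezDuarteMellin

open BaezDuarteMellin in
/-- **Báez-Duarte 2005, Theorem 4.1 (PROVED)** (IJMMS 2005:22 Thm. 4.1 = arXiv:math/0504402 Thm. 4.1:
"If `φ` is mellin-proper, and additionally `φ^∧ ∈ A^c[−1/2, 1]` does not vanish on the line
`σ = −1/2`, then `Gφ(x) ≪ x^{−1/2} ⟹ RHS`", RHS = "RH and simple zeros"; "in view of (2.4)
[`g(x) ≪ x^{−1/2} ⟹ RHS`] it is more interesting"). Hypotheses as used by the printed proof:
`φ` Mellin-proper, `N_{−1/2}(φ) < ∞` (so `φ^∧` is continuous on `−1/2 ≤ Re s ≤ 0`), `φ^∧ ≠ 0` on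
`Re s = −1/2`, and the `ε`-FREE bound `Gφ(x) = O(x^{−1/2})`. Proof as printed: RH by Thm. 3.1; at a
non-trivial zero `ρ = 1/2 + iτ`, `s₀ = ρ − 1`: by (3.11) `φ^∧(s) = (Gφ)^∧(s) · s ζ(s+1)` for
`s = s₀ + h`, `0 < h` small, where `|(Gφ)^∧(s)| ≤ A + C/h` (`norm_leftMellin_moebiusConv_le`) and
`|φ^∧(s)| ≥ b > 0`; hence `c·h ≤ |ζ(ρ + h)|`, "which shows that `s₀` is a simple zero"
(`deriv_ne_zero_of_mul_le_norm`); trivial zeros are simple unconditionally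
(`deriv_riemannZeta_trivialZero_ne_zero`). [cite: BaezDuarte2005Moebius, §4 Thm. 4.1 eq. (4.1)] -/
theorem BaezDuarte2005Moebius_thm_4_1 {φ : ℝ → ℂ} (hφ : IsMellinProper φ)
    (hN : HasFiniteMellinNorm φ (-(1 / 2 : ℝ)))
    (hne : ∀ s : ℂ, s.re = -(1 / 2 : ℝ) → leftMellin φ s ≠ 0)
    (hG : moebiusConv φ =O[atTop] fun x : ℝ ↦ x ^ (-(1 / 2 : ℝ))) :
    RiemannHypothesis ∧ ∀ s : ℂ, riemannZeta s = 0 → deriv riemannZeta s ≠ 0 := by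
  have hGε : ∀ ε : ℝ, 0 < ε → moebiusConv φ =O[atTop] fun x : ℝ ↦ x ^ (-(1 / 2 : ℝ) + ε) :=
    fun ε hε => isBigO_rpow_add hε.le hG
  have hRH : RiemannHypothesis := riemannHypothesis_of_isMellinProper_of_isBigO hφ hGε
  refine ⟨hRH, fun ρ hρ => ?_⟩
  by_cases htriv : ∃ n : ℕ, ρ = -2 * ((n : ℂ) + 1)
  · obtain ⟨n, rfl⟩ := htriv
    exact deriv_riemannZeta_trivialZero_ne_zero n
  have hρ1 : ρ ≠ 1 := by
    rintro rfl
    exact riemannZeta_one_ne_zero hρ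
  have hre : ρ.re = 1 / 2 := hRH ρ hρ htriv hρ1
  obtain ⟨A, C, hA, hC, hbound⟩ := norm_leftMellin_moebiusConv_le hφ.1 hG
  -- `s₀ = ρ − 1` on the line `Re s = −1/2`; `φ^∧` is continuous there with `φ^∧(s₀) ≠ 0`
  have hs₀re : (ρ - 1).re = -(1 / 2 : ℝ) := by
    rw [Complex.sub_re, Complex.one_re, hre]; norm_num
  have hb0 : 0 < ‖leftMellin φ (ρ - 1)‖ := norm_pos_iff.2 (hne _ hs₀re)
  have hcont : ContinuousWithinAt (leftMellin φ) {s : ℂ | -(1 / 2 : ℝ) ≤ s.re ∧ s.re ≤ 0} (ρ - 1) :=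
    continuousWithinAt_leftMellin hφ.1.1 hN (hφ.1.2 0 (by norm_num) le_rfl) (ρ - 1)
  obtain ⟨δ, hδ0, hδ⟩ := Metric.continuousWithinAt_iff.1 hcont (‖leftMellin φ (ρ - 1)‖ / 2)
    (by positivity)
  -- the lower bound `c · h ≤ |ζ(ρ + h)|` for `0 < h < min δ (1/2)`
  set b : ℝ := ‖leftMellin φ (ρ - 1)‖ / 2 with hb
  set L : ℝ := ‖ρ - 1‖ + 1 with hL
  have hbpos : 0 < b := by rw [hb]; positivity
  have hLpos : 0 < L := by rw [hL]; positivity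
  have hACL : 0 < (A + C) * L := by positivity
  have key : ∀ h : ℝ, 0 < h → h < min δ (1 / 2) →
      b / ((A + C) * L) * h ≤ ‖riemannZeta (ρ + h)‖ := by
    intro h hh0 hh1
    have hhδ : h < δ := lt_of_lt_of_le hh1 (min_le_left _ _)
    have hh2 : h < 1 / 2 := lt_of_lt_of_le hh1 (min_le_right _ _)
    have hsre : (ρ - 1 + h).re = -(1 / 2 : ℝ) + h := by
      rw [Complex.add_re, hs₀re, Complex.ofReal_re]
    have hs1 : -(1 / 2 : ℝ) < (ρ - 1 + h).re := by rw [hsre]; linarith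
    have hs2 : (ρ - 1 + h).re < 0 := by rw [hsre]; linarith
    have h311 := leftMellin_moebiusConv_mul_eq hφ.1 hGε hs1 hs2
    have hsζ : ρ - 1 + (h : ℂ) + 1 = ρ + h := by ring
    -- `b ≤ ‖φ^∧(s)‖`
    have hbs : b ≤ ‖leftMellin φ (ρ - 1 + h)‖ := by
      have hd : dist (ρ - 1 + (h : ℂ)) (ρ - 1) < δ := by
        rw [dist_eq_norm, add_sub_cancel_left, Complex.norm_real, Real.norm_of_nonneg hh0.le]
        exact hhδ
      have h1 := hδ ⟨hs1.le, hs2.le⟩ hd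
      rw [dist_eq_norm] at h1
      have h2 := norm_sub_norm_le (leftMellin φ (ρ - 1)) (leftMellin φ (ρ - 1 + h))
      rw [norm_sub_rev] at h2
      rw [hb]
      linarith
    -- `‖φ^∧(s)‖ ≤ (A + C/h) · L · ‖ζ(ρ + h)‖`
    have hGs := hbound _ hs1 hs2
    rw [hsre, show -(1 / 2 : ℝ) + h + 1 / 2 = h by ring] at hGs
    have hsL : ‖ρ - 1 + (h : ℂ)‖ ≤ L := by
      rw [hL]
      calc ‖ρ - 1 + (h : ℂ)‖ ≤ ‖ρ - 1‖ + ‖(h : ℂ)‖ := norm_add_le _ _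
        _ ≤ ‖ρ - 1‖ + 1 := by
            rw [Complex.norm_real, Real.norm_of_nonneg hh0.le]; linarith
    have hACh : 0 ≤ A + C / h := by positivity
    have hup : ‖leftMellin φ (ρ - 1 + h)‖ ≤ (A + C / h) * L * ‖riemannZeta (ρ + h)‖ := by
      rw [← h311, hsζ, norm_mul, norm_mul, mul_assoc]
      exact mul_le_mul hGs (mul_le_mul_of_nonneg_right hsL (norm_nonneg _))
        (mul_nonneg (norm_nonneg _) (norm_nonneg _)) hACh
    -- combine
    have hAC : 0 < (A + C / h) * L := by positivity
    have hζlow : b / ((A + C / h) * L) ≤ ‖riemannZeta (ρ + h)‖ := by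
      rw [div_le_iff₀ hAC]
      linarith [mul_comm ((A + C / h) * L) ‖riemannZeta (ρ + h)‖]
    calc b / ((A + C) * L) * h = b * h / ((A + C) * L) := by ring
      _ ≤ b * h / ((A * h + C) * L) := by
          refine div_le_div_of_nonneg_left (by positivity) (by positivity) ?_
          refine mul_le_mul_of_nonneg_right ?_ hLpos.le
          nlinarith
      _ = b / ((A + C / h) * L) := by
          field_simp
      _ ≤ ‖riemannZeta (ρ + h)‖ := hζlow
  -- the `ρ + 2h` form of the tree lemma
  refine deriv_ne_zero_of_mul_le_norm (differentiableAt_riemannZeta hρ1) hρ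
    (c := 2 * (b / ((A + C) * L))) (h₀ := min δ (1 / 2) / 2) (by positivity) (by positivity)
    fun h hh0 hh1 => ?_
  have hk := key (2 * h) (by positivity) (by linarith)
  calc 2 * (b / ((A + C) * L)) * h = b / ((A + C) * L) * (2 * h) := by ring
    _ ≤ ‖riemannZeta (ρ + ((2 * h : ℝ) : ℂ))‖ := hk
    _ = ‖riemannZeta (ρ + 2 * (h : ℂ))‖ := by push_cast; ring_nf

/-! ## §11 (appended) Theorem 2.3 (IJMMS) = Theorem 2.2 (arXiv): the `L^p` form of Littlewood's
criterion, `RH ⟺ ‖g₁‖_p < ∞ for all p ∈ [1,2)`, `g₁(x) = x⁻¹ g(x⁻¹)` -/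

namespace BaezDuarteMellin

/-- The substitution `x = 1/u` behind `‖g₁‖_p`, `g₁(x) = x⁻¹ g(x⁻¹)`: for `p > 0`,
`∫₀^∞ |x⁻¹ g(x⁻¹)|^p dx < ∞ ⟺ ∫₁^∞ |g(u)|^p u^{p−2} du < ∞` (`g = 0` on `(0,1)`, so `(0,1]`
carries nothing). [cite: BaezDuarte2005Moebius, Thm. 2.3 proof, (2.15) (arXiv Thm. 2.2)] -/
theorem integrableOn_abs_inv_mul_moebiusDivSum_rpow_iff {p : ℝ} (hp : 0 < p) :
    IntegrableOn (fun x : ℝ => |x⁻¹ * moebiusDivSum x⁻¹| ^ p) (Ioi 0) ↔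
      IntegrableOn (fun u : ℝ => |moebiusDivSum u| ^ p * u ^ (p - 2)) (Ioi 1) := by
  set F : ℝ → ℝ := fun u => |moebiusDivSum u| ^ p * u ^ (p - 2) with hF
  have hFm : Measurable F :=
    ((continuous_abs.measurable.comp measurable_moebiusDivSum).pow_const _).mul
      (measurable_id.pow_const _)
  -- on `(0, 1]` the function `F` is bounded by `1`
  have h01 : IntegrableOn F (Ioc 0 1) := by
    refine Integrable.mono' (integrableOn_const (C := (1 : ℝ)) (hs := measure_Ioc_lt_top.ne))
      hFm.aestronglyMeasurable ?_
    refine ae_restrict_of_forall_mem measurableSet_Ioc fun u hu => ?_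
    rw [Real.norm_eq_abs, hF]
    simp only
    rw [abs_of_nonneg (mul_nonneg (Real.rpow_nonneg (abs_nonneg _) _) (Real.rpow_nonneg hu.1.le _))]
    rcases eq_or_lt_of_le hu.2 with h1 | h1
    · rw [h1, Real.one_rpow, mul_one]
      exact Real.rpow_le_one (abs_nonneg _) (abs_moebiusDivSum_le_self zero_le_one) hp.le
    · rw [moebiusDivSum_of_lt_one h1, abs_zero, Real.zero_rpow hp.ne', zero_mul]
      exact zero_le_one
  have hsplit : IntegrableOn F (Ioi 0) ↔ IntegrableOn F (Ioi 1) := by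
    constructor
    · exact fun h => h.mono_set (Ioi_subset_Ioi zero_le_one)
    · intro h
      rw [← Ioc_union_Ioi_eq_Ioi (zero_le_one : (0 : ℝ) ≤ 1)]
      exact h01.union h
  -- the substitution `x ↦ x^{-1}`
  have hsub := integrableOn_Ioi_comp_rpow_iff' F (p := -1) (by norm_num)
  have heq : EqOn (fun x : ℝ => x ^ ((-1 : ℝ) - 1) • F (x ^ (-1 : ℝ)))
      (fun x : ℝ => |x⁻¹ * moebiusDivSum x⁻¹| ^ p) (Ioi 0) := by
    intro x hx
    have hx0 : (0 : ℝ) < x := hx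
    simp only [hF, smul_eq_mul, Real.rpow_neg_one]
    rw [abs_mul, Real.mul_rpow (abs_nonneg _) (abs_nonneg _), abs_of_pos (inv_pos.2 hx0),
      Real.inv_rpow hx0.le, Real.inv_rpow hx0.le, ← Real.rpow_neg hx0.le, ← Real.rpow_neg hx0.le,
      show ((-1 : ℝ) - 1) = -2 by norm_num]
    have h2 : x ^ (-2 : ℝ) * x ^ (-(p - 2)) = x ^ (-p) := by
      rw [← Real.rpow_add hx0]; ring_nf
    rw [← h2]; ring
  rw [← integrableOn_congr_fun heq measurableSet_Ioi, hsub]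
  exact hsplit

/-- The Hölder step of the proof of IJMMS Thm. 2.3, in Young's-inequality form: if `1 < p`,
`p(σ+1) > 1` and `∫₁^∞ |g(u)|^p u^{p−2} du < ∞`, then `N_σ(g) < ∞`. Pointwise on `(1, ∞)`,
`u^{−σ−1}|g(u)| = (|g(u)| u^{c}) · u^{−σ−1−c} ≤ |g(u)|^p u^{p−2}/p + u^{(−σ−1−c)q}/q` with
`c = (p−2)/p`, `q = p/(p−1)`, and `(−σ−1−c)q < −1` exactly when `p(σ+1) > 1` (as printed:
"`∫₀^∞ x^{−σ−1}|g(x)| dx ≤ ‖g₁‖_p (∫₀¹ x^{σq} dx)^{1/q} < ∞` for `σ > 1/p − 1`").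
[cite: BaezDuarte2005Moebius, Thm. 2.3 proof, (2.15) (arXiv Thm. 2.2)] -/
theorem hasFiniteMellinNorm_moebiusDivSum_of_integrableOn_rpow {p σ : ℝ} (hp : 1 < p)
    (hσ : 1 < p * (σ + 1))
    (hF : IntegrableOn (fun u : ℝ => |moebiusDivSum u| ^ p * u ^ (p - 2)) (Ioi 1)) :
    HasFiniteMellinNorm (fun x : ℝ => (moebiusDivSum x : ℂ)) σ := by
  unfold HasFiniteMellinNorm
  have hp0 : 0 < p := by linarith
  have hp0' : p ≠ 0 := hp0.ne'
  have hp1 : 0 < p - 1 := by linarith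
  have hp1' : p - 1 ≠ 0 := hp1.ne'
  have hpq : p.HolderConjugate (p / (p - 1)) := Real.HolderConjugate.conjExponent hp
  set q : ℝ := p / (p - 1) with hq
  set c : ℝ := (p - 2) / p with hc
  have hcp : c * p = p - 2 := by rw [hc]; field_simp
  have he' : (-σ - 1 - c) * q = (2 - σ * p - 2 * p) / (p - 1) := by
    rw [hq, hc]; field_simp; ring
  have he1 : (-σ - 1 - c) * q < -1 := by
    rw [he', div_lt_iff₀ hp1]; nlinarith
  have hmeas : Measurable fun x : ℝ => x ^ (-σ - 1) * ‖(moebiusDivSum x : ℂ)‖ :=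
    (measurable_id.pow_const _).mul (Complex.measurable_ofReal.comp measurable_moebiusDivSum).norm
  rw [← Ioc_union_Ioi_eq_Ioi (zero_le_one : (0 : ℝ) ≤ 1)]
  refine IntegrableOn.union ?_ ?_
  · -- `(0, 1]`: the integrand vanishes on `(0,1)` and is `|g(1)| ≤ 1` at `1`
    refine Integrable.mono' (integrableOn_const (C := (1 : ℝ)) (hs := measure_Ioc_lt_top.ne))
      hmeas.aestronglyMeasurable ?_
    refine ae_restrict_of_forall_mem measurableSet_Ioc fun u hu => ?_
    rw [Real.norm_eq_abs, abs_mul, abs_of_nonneg (Real.rpow_nonneg hu.1.le _), abs_norm,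
      Complex.norm_real, Real.norm_eq_abs]
    rcases eq_or_lt_of_le hu.2 with h1 | h1
    · rw [h1, Real.one_rpow, one_mul]
      exact abs_moebiusDivSum_le_self zero_le_one
    · rw [moebiusDivSum_of_lt_one h1, abs_zero, mul_zero]
      exact zero_le_one
  · -- `(1, ∞)`: Young's inequality against the integrable majorant
    have hmaj : IntegrableOn
        (fun u : ℝ => (|moebiusDivSum u| ^ p * u ^ (p - 2)) / p + u ^ ((-σ - 1 - c) * q) / q)
        (Ioi 1) :=
      (hF.div_const p).add ((integrableOn_Ioi_rpow_of_lt he1 zero_lt_one).div_const q)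
    refine Integrable.mono' hmaj hmeas.aestronglyMeasurable ?_
    refine ae_restrict_of_forall_mem measurableSet_Ioi fun u hu => ?_
    have hu0 : (0 : ℝ) < u := lt_trans zero_lt_one hu
    rw [Real.norm_eq_abs, abs_mul, abs_of_nonneg (Real.rpow_nonneg hu0.le _), abs_norm,
      Complex.norm_real, Real.norm_eq_abs]
    have hsplit : u ^ (-σ - 1) * |moebiusDivSum u| =
        (|moebiusDivSum u| * u ^ c) * u ^ (-σ - 1 - c) := by
      rw [mul_assoc, ← Real.rpow_add hu0, show c + (-σ - 1 - c) = -σ - 1 by ring, mul_comm]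
    have hyoung := Real.young_inequality_of_nonneg
      (mul_nonneg (abs_nonneg (moebiusDivSum u)) (Real.rpow_nonneg hu0.le c))
      (Real.rpow_nonneg hu0.le (-σ - 1 - c)) hpq
    rw [hsplit]
    refine hyoung.trans (le_of_eq ?_)
    rw [Real.mul_rpow (abs_nonneg _) (Real.rpow_nonneg hu0.le _), ← Real.rpow_mul hu0.le,
      ← Real.rpow_mul hu0.le, hcp]

/-- With `∫₁^∞ |g(u)|^p u^{p−2} du < ∞` for EVERY `p ∈ [1,2)`, all the norms `N_σ(g)`, `σ > −1/2`,
are finite: for `−1/2 < σ < 0` take `p = (3 − 2σ)/2 ∈ (1/(σ+1), 2)`; for `σ ≥ 0` this is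
unconditional (`hasFiniteMellinNorm_moebiusDivSum`). [cite: BaezDuarte2005Moebius, Thm. 2.3 proof (arXiv Thm. 2.2)] -/
theorem hasFiniteMellinNorm_moebiusDivSum_of_forall_integrableOn_rpow
    (H : ∀ p : ℝ, 1 ≤ p → p < 2 →
      IntegrableOn (fun u : ℝ => |moebiusDivSum u| ^ p * u ^ (p - 2)) (Ioi 1))
    {σ : ℝ} (hσ : -(1 / 2 : ℝ) < σ) :
    HasFiniteMellinNorm (fun x : ℝ => (moebiusDivSum x : ℂ)) σ := by
  rcases le_or_gt 0 σ with h0 | h0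
  · exact hasFiniteMellinNorm_moebiusDivSum h0
  · have hp1 : 1 < (3 - 2 * σ) / 2 := by linarith
    have hp2 : (3 - 2 * σ) / 2 < 2 := by linarith
    have hpσ : 1 < (3 - 2 * σ) / 2 * (σ + 1) := by
      nlinarith [mul_pos (by linarith : (0 : ℝ) < 1 + 2 * σ) (by linarith : (0 : ℝ) < 1 - σ)]
    exact hasFiniteMellinNorm_moebiusDivSum_of_integrableOn_rpow hp1 hpσ (H _ hp1.le hp2)

/-- ("⟹" of IJMMS Thm. 2.3) Under RH, `∫₁^∞ |g(u)|^p u^{p−2} du < ∞` for `1 ≤ p < 2`: Littlewood's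
`|g(u)| ≤ C u^{−1/2+ε}` (`u ≥ 1`) with `ε = (2−p)/(4p)` gives the majorant `C^p u^{p/4 − 3/2}`.
[cite: BaezDuarte2005Moebius, Thm. 2.3 proof ("the direct implication"), Thm. 2.2 (2.8) (arXiv Thm. 2.1 (2.3))] -/
theorem integrableOn_abs_moebiusDivSum_rpow_of_riemannHypothesis (hRH : RiemannHypothesis)
    {p : ℝ} (hp1 : 1 ≤ p) (hp2 : p < 2) :
    IntegrableOn (fun u : ℝ => |moebiusDivSum u| ^ p * u ^ (p - 2)) (Ioi 1) := by
  have hp0 : 0 < p := by linarith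
  have hp0' : p ≠ 0 := hp0.ne'
  set ε : ℝ := (2 - p) / (4 * p) with hε
  have hε0 : 0 < ε := by rw [hε]; exact div_pos (by linarith) (by linarith)
  have hε1 : ε < 1 / 2 := by rw [hε, div_lt_iff₀ (by linarith)]; linarith
  obtain ⟨C, hC0, hC⟩ := abs_moebiusDivSum_le_rpow_of_riemannHypothesis hRH hε0 hε1
  have hexp' : (-(1 / 2 : ℝ) + ε) * p + (p - 2) = p / 4 - 3 / 2 := by
    rw [hε]; field_simp; ring
  have hexp : (-(1 / 2 : ℝ) + ε) * p + (p - 2) < -1 := by rw [hexp']; linarith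
  have hmeas : Measurable fun u : ℝ => |moebiusDivSum u| ^ p * u ^ (p - 2) :=
    ((continuous_abs.measurable.comp measurable_moebiusDivSum).pow_const _).mul
      (measurable_id.pow_const _)
  have hmaj : IntegrableOn (fun u : ℝ => C ^ p * u ^ ((-(1 / 2 : ℝ) + ε) * p + (p - 2))) (Ioi 1) :=
    (integrableOn_Ioi_rpow_of_lt hexp zero_lt_one).const_mul _
  refine Integrable.mono' hmaj hmeas.aestronglyMeasurable ?_
  refine ae_restrict_of_forall_mem measurableSet_Ioi fun u hu => ?_
  have hu1 : (1 : ℝ) < u := hu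
  have hu0 : 0 < u := by linarith
  rw [Real.norm_eq_abs,
    abs_of_nonneg (mul_nonneg (Real.rpow_nonneg (abs_nonneg _) _) (Real.rpow_nonneg hu0.le _))]
  have hg : |moebiusDivSum u| ^ p ≤ (C * u ^ (-(1 / 2 : ℝ) + ε)) ^ p :=
    Real.rpow_le_rpow (abs_nonneg _) (hC u hu1.le) hp0.le
  rw [Real.mul_rpow hC0 (Real.rpow_nonneg hu0.le _), ← Real.rpow_mul hu0.le] at hg
  calc |moebiusDivSum u| ^ p * u ^ (p - 2)
      ≤ C ^ p * u ^ ((-(1 / 2 : ℝ) + ε) * p) * u ^ (p - 2) :=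
        mul_le_mul_of_nonneg_right hg (Real.rpow_nonneg hu0.le _)
    _ = C ^ p * u ^ ((-(1 / 2 : ℝ) + ε) * p + (p - 2)) := by
        rw [Real.rpow_add hu0]; ring

end BaezDuarteMellin

open BaezDuarteMellin in
/-- **Báez-Duarte 2005, Theorem 2.3 (IJMMS p. 3602, (2.14)) = arXiv Theorem 2.2 ((2.9))** — the
`L^p` form of Littlewood's criterion, equivalence part: with `g₁(x) := x⁻¹ g(x⁻¹)`,
"`RH ⟺ (‖g₁‖_p < ∞, ∀ p ∈ [1,2))`", norms in `L^p((0,∞), dx)`; `‖g₁‖_p < ∞` is rendered as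
integrability of `|g₁|^p` on `(0,∞)`. "⟹": Littlewood's bound under RH. "⟸", as printed: Hölder
gives `N_σ(g) < ∞` for `σ > 1/p − 1`, and Lemma 2.1 continues `(sζ(s+1))⁻¹ = g^∧(s)` ((2.12)) to
the left; with every `p < 2` available, `N_σ(g) < ∞` for all `σ > −1/2`, `g^∧` is holomorphic on
`−1/2 < Re s < 2`, and `ζ(s+1)·s g^∧(s) = 1` propagates from `Re s > 0` by the identity theorem to
the upper half-strip and then to `−1/2 < Re s < 0`, where it forbids zeros of `ζ(s+1)` (the printed
"for some `p ∈ (1,2)`" alone yields `ζ ≠ 0` only on `Re s > 1/p`). The unconditional clause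
`‖g₁‖₂ = ∞` of the theorem (resting on [1, Lemmas 2.1, 2.3]) is NOT formalised here. An
equivalence is proved; neither side is asserted. [cite: BaezDuarte2005Moebius, Thm. 2.3 (2.14) (arXiv Thm. 2.2 (2.9))] -/
theorem BaezDuarte2005Moebius_thm_2_3 :
    RiemannHypothesis ↔ ∀ p : ℝ, 1 ≤ p → p < 2 →
      IntegrableOn (fun x : ℝ ↦ |x⁻¹ * moebiusDivSum x⁻¹| ^ p) (Ioi 0) := by
  constructor
  · intro hRH p hp1 hp2
    rw [integrableOn_abs_inv_mul_moebiusDivSum_rpow_iff (by linarith)]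
    exact integrableOn_abs_moebiusDivSum_rpow_of_riemannHypothesis hRH hp1 hp2
  · intro H
    have H' : ∀ p : ℝ, 1 ≤ p → p < 2 →
        IntegrableOn (fun u : ℝ => |moebiusDivSum u| ^ p * u ^ (p - 2)) (Ioi 1) :=
      fun p hp1 hp2 => (integrableOn_abs_inv_mul_moebiusDivSum_rpow_iff (by linarith)).1
        (H p hp1 hp2)
    -- `g^∧` is holomorphic on `−1/2 < Re s < 2`
    set M : ℂ → ℂ := leftMellin (fun x : ℝ => (moebiusDivSum x : ℂ)) with hM
    have hSo : IsOpen {s : ℂ | -(1 / 2 : ℝ) < s.re ∧ s.re < 2} :=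
      (isOpen_lt continuous_const Complex.continuous_re).inter
        (isOpen_lt Complex.continuous_re continuous_const)
    have hMd : DifferentiableOn ℂ M {s : ℂ | -(1 / 2 : ℝ) < s.re ∧ s.re < 2} :=
      differentiableOn_leftMellin (Complex.measurable_ofReal.comp measurable_moebiusDivSum)
        fun σ h1 _ => hasFiniteMellinNorm_moebiusDivSum_of_forall_integrableOn_rpow H' h1
    -- `E(s) = ζ(s+1)·(s·g^∧(s)) − 1` is holomorphic off `s = 0` in that strip
    set E : ℂ → ℂ := fun s => riemannZeta (s + 1) * (s * M s) - 1 with hE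
    have hEan : ∀ U : Set ℂ, IsOpen U → U ⊆ {s : ℂ | -(1 / 2 : ℝ) < s.re ∧ s.re < 2} →
        (∀ s ∈ U, s + 1 ≠ 1) → AnalyticOnNhd ℂ E U := by
      intro U hU hsub hne
      refine DifferentiableOn.analyticOnNhd (fun s hs => ?_) hU
      have h1 : DifferentiableAt ℂ (fun z : ℂ => riemannZeta (z + 1)) s :=
        (differentiableAt_riemannZeta (hne s hs)).comp s (f := fun z : ℂ => z + 1)
          (differentiableAt_id.add_const 1)
      have h2 : DifferentiableAt ℂ M s := hMd.differentiableAt (hSo.mem_nhds (hsub hs))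
      exact ((h1.mul (differentiableAt_id.mul h2)).sub_const 1).differentiableWithinAt
    -- Step 1: `E ≡ 0` on the upper half-strip (identity theorem from `Re s > 0`, (2.12))
    have hUpo : IsOpen {s : ℂ | (-(1 / 2 : ℝ) < s.re ∧ s.re < 2) ∧ 0 < s.im} :=
      hSo.inter (isOpen_lt continuous_const Complex.continuous_im)
    have hUpc : Convex ℝ {s : ℂ | (-(1 / 2 : ℝ) < s.re ∧ s.re < 2) ∧ 0 < s.im} :=
      ((convex_halfSpace_re_gt _).inter (convex_halfSpace_re_lt _)).inter
        (convex_halfSpace_im_gt _)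
    have hEp : EqOn E 0 {s : ℂ | (-(1 / 2 : ℝ) < s.re ∧ s.re < 2) ∧ 0 < s.im} := by
      have ha : AnalyticOnNhd ℂ E {s : ℂ | (-(1 / 2 : ℝ) < s.re ∧ s.re < 2) ∧ 0 < s.im} :=
        hEan _ hUpo (fun s hs => hs.1) fun s hs h => by
          have := congrArg Complex.im h
          simp only [Complex.add_im, Complex.one_im, add_zero] at this
          exact hs.2.ne' this
      have hz₁ : (1 : ℂ) + I ∈ {s : ℂ | (-(1 / 2 : ℝ) < s.re ∧ s.re < 2) ∧ 0 < s.im} := by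
        simp only [mem_setOf_eq, Complex.add_re, Complex.one_re, Complex.I_re, Complex.add_im,
          Complex.one_im, Complex.I_im]
        norm_num
      have hev : E =ᶠ[𝓝 ((1 : ℂ) + I)] 0 := by
        filter_upwards [(isOpen_lt continuous_const Complex.continuous_re).mem_nhds
          (show (0 : ℝ) < ((1 : ℂ) + I).re by simp)] with s hs
        have hs' : 0 < s.re := hs
        simp only [hE, hM, Pi.zero_apply]
        rw [riemannZeta_mul_leftMellin_moebiusDivSum hs', sub_self]
      exact ha.eqOn_zero_of_preconnected_of_eventuallyEq_zero hUpc.isPreconnected hz₁ hev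
    -- Step 2: `E ≡ 0` on the strip `−1/2 < Re s < 0` (identity theorem from Step 1)
    have hU0o : IsOpen {s : ℂ | -(1 / 2 : ℝ) < s.re ∧ s.re < 0} :=
      (isOpen_lt continuous_const Complex.continuous_re).inter
        (isOpen_lt Complex.continuous_re continuous_const)
    have hU0c : Convex ℝ {s : ℂ | -(1 / 2 : ℝ) < s.re ∧ s.re < 0} :=
      (convex_halfSpace_re_gt _).inter (convex_halfSpace_re_lt _)
    have hE0 : EqOn E 0 {s : ℂ | -(1 / 2 : ℝ) < s.re ∧ s.re < 0} := by
      have ha : AnalyticOnNhd ℂ E {s : ℂ | -(1 / 2 : ℝ) < s.re ∧ s.re < 0} :=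
        hEan _ hU0o (fun s hs => ⟨hs.1, by linarith [hs.2]⟩) fun s hs h => by
          have := congrArg Complex.re h
          simp only [Complex.add_re, Complex.one_re] at this
          linarith [hs.2]
      have hz0re : ((-(1 / 4 : ℝ) : ℂ) + I).re = -(1 / 4 : ℝ) := by simp
      have hz0im : ((-(1 / 4 : ℝ) : ℂ) + I).im = 1 := by simp
      have hz0U0 : (-(1 / 4 : ℝ) : ℂ) + I ∈ {s : ℂ | -(1 / 2 : ℝ) < s.re ∧ s.re < 0} := by
        refine ⟨?_, ?_⟩
        · show -(1 / 2 : ℝ) < ((-(1 / 4 : ℝ) : ℂ) + I).re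
          rw [hz0re]; norm_num
        · show ((-(1 / 4 : ℝ) : ℂ) + I).re < 0
          rw [hz0re]; norm_num
      have hz0Up : (-(1 / 4 : ℝ) : ℂ) + I ∈
          {s : ℂ | (-(1 / 2 : ℝ) < s.re ∧ s.re < 2) ∧ 0 < s.im} := by
        refine ⟨⟨hz0U0.1, ?_⟩, ?_⟩
        · show ((-(1 / 4 : ℝ) : ℂ) + I).re < 2
          rw [hz0re]; norm_num
        · show 0 < ((-(1 / 4 : ℝ) : ℂ) + I).im
          rw [hz0im]; norm_num
      have hev : E =ᶠ[𝓝 ((-(1 / 4 : ℝ) : ℂ) + I)] 0 :=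
        Filter.eventuallyEq_of_mem (hUpo.mem_nhds hz0Up) hEp
      exact ha.eqOn_zero_of_preconnected_of_eventuallyEq_zero hU0c.isPreconnected hz0U0 hev
    -- Step 3: no zero of `ζ` with `1/2 < Re w < 1`, i.e. RH
    have hq : QuasiRiemannHypothesis (1 / 2) := by
      intro w hw h1 h2
      have hs : w - 1 ∈ {s : ℂ | -(1 / 2 : ℝ) < s.re ∧ s.re < 0} := by
        refine ⟨?_, ?_⟩
        · show -(1 / 2 : ℝ) < (w - 1).re
          simp only [Complex.sub_re, Complex.one_re]; linarith
        · show (w - 1).re < 0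
          simp only [Complex.sub_re, Complex.one_re]; linarith
      have h := hE0 hs
      simp only [hE, Pi.zero_apply, sub_add_cancel, hw, zero_mul, zero_sub, neg_eq_zero,
        one_ne_zero] at h
    exact quasiRiemannHypothesis_one_half_iff_holds.1 hq

/-! ## §12 (appended) IJMMS Theorem 4.2: the `L^p` convolution criterion
`RH ⟺ ‖ψ‖_p < ∞ for all p ∈ [1,2)`, `ψ(x) = x⁻¹ Gφ(x⁻¹)`, for Mellin-proper `φ` -/

namespace BaezDuarteMellin

/-- The substitution `x = 1/u` behind `‖ψ‖_p`, `ψ(x) = x⁻¹ f(x⁻¹)`: for any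
`f : (0,∞) → ℂ` (and any real `p`), `∫₀^∞ |x⁻¹ f(x⁻¹)|^p dx < ∞ ⟺ ∫₀^∞ |f(u)|^p u^{p−2} du < ∞`.
[cite: BaezDuarte2005Moebius, Thm. 4.2 proof, (4.7)] -/
theorem integrableOn_norm_inv_mul_rpow_iff (f : ℝ → ℂ) (p : ℝ) :
    IntegrableOn (fun x : ℝ => ‖(x : ℂ)⁻¹ * f x⁻¹‖ ^ p) (Ioi 0) ↔
      IntegrableOn (fun u : ℝ => ‖f u‖ ^ p * u ^ (p - 2)) (Ioi 0) := by
  set F : ℝ → ℝ := fun u => ‖f u‖ ^ p * u ^ (p - 2) with hF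
  have hsub := integrableOn_Ioi_comp_rpow_iff' F (p := -1) (by norm_num)
  have heq : EqOn (fun x : ℝ => x ^ ((-1 : ℝ) - 1) • F (x ^ (-1 : ℝ)))
      (fun x : ℝ => ‖(x : ℂ)⁻¹ * f x⁻¹‖ ^ p) (Ioi 0) := by
    intro x hx
    have hx0 : (0 : ℝ) < x := hx
    simp only [hF, smul_eq_mul, Real.rpow_neg_one]
    rw [norm_mul, norm_inv, Complex.norm_real, Real.norm_eq_abs, abs_of_pos hx0,
      Real.mul_rpow (inv_nonneg.2 hx0.le) (norm_nonneg _),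
      Real.inv_rpow hx0.le, Real.inv_rpow hx0.le, ← Real.rpow_neg hx0.le, ← Real.rpow_neg hx0.le,
      show ((-1 : ℝ) - 1) = -2 by norm_num]
    have h2 : x ^ (-2 : ℝ) * x ^ (-(p - 2)) = x ^ (-p) := by
      rw [← Real.rpow_add hx0]; ring_nf
    rw [← h2]; ring
  rw [← integrableOn_congr_fun heq measurableSet_Ioi, hsub]

/-- `Gφ` is bounded for proper `φ`: `‖Gφ(x)‖ ≤ B N_0(φ)` for all `x > 0`, `B = sup |g|`
(IJMMS Lemma 3.2: "In particular, `Gφ` is bounded"). [cite: BaezDuarte2005Moebius, Lemma 3.2 (arXiv Lemma 3.1)] -/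
theorem exists_norm_moebiusConv_le {φ : ℝ → ℂ} (hφ : IsMoebiusProper φ) :
    ∃ K : ℝ, 0 ≤ K ∧ ∀ x : ℝ, 0 < x → ‖moebiusConv φ x‖ ≤ K := by
  obtain ⟨B, hB, hgB⟩ := exists_abs_moebiusDivSum_le
  have hN : IntegrableOn (fun u : ℝ ↦ u ^ (-(0 : ℝ) - 1) * ‖φ u‖) (Ioi 0) :=
    hφ.2 0 (by norm_num) le_rfl
  refine ⟨B * ∫ u in Ioi (0 : ℝ), u ^ (-(0 : ℝ) - 1) * ‖φ u‖, ?_, fun x hx => ?_⟩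
  · exact mul_nonneg hB.le (setIntegral_nonneg measurableSet_Ioi fun u hu =>
      mul_nonneg (Real.rpow_nonneg (le_of_lt (α := ℝ) hu) _) (norm_nonneg _))
  · have h := norm_moebiusConv_le_of_bound (e := 0) hB.le
      (fun u _ => by rw [Real.rpow_zero, mul_one]; exact hgB u) hN hx
    rwa [Real.rpow_zero, mul_one] at h

/-- The Hölder step of the proof of IJMMS Thm. 4.2 (as for Thm. 2.3, in Young's-inequality form):
for proper `φ`, `1 < p`, `σ < 0`, `p(σ+1) > 1` and `∫₁^∞ |Gφ(u)|^p u^{p−2} du < ∞` give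
`N_σ(Gφ) < ∞` — on `(0,1]` by `x^{−σ−1} ≤ x^{−1}` and `N_0(Gφ) < ∞` (Lemma 3.3), on `(1,∞)` by
`u^{−σ−1}|Gφ(u)| ≤ |Gφ(u)|^p u^{p−2}/p + u^{(−σ−1−c)q}/q`, `c = (p−2)/p`, `q = p/(p−1)`.
[cite: BaezDuarte2005Moebius, Thm. 4.2 proof, (4.8)] -/
theorem hasFiniteMellinNorm_moebiusConv_of_integrableOn_rpow {φ : ℝ → ℂ} (hφ : IsMoebiusProper φ)
    {p σ : ℝ} (hp : 1 < p) (hσ0 : σ < 0) (hσ : 1 < p * (σ + 1))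
    (hF : IntegrableOn (fun u : ℝ => ‖moebiusConv φ u‖ ^ p * u ^ (p - 2)) (Ioi 1)) :
    HasFiniteMellinNorm (moebiusConv φ) σ := by
  have h0 := hasFiniteMellinNorm_moebiusConv_zero hφ
  unfold HasFiniteMellinNorm at h0 ⊢
  have hp0 : 0 < p := by linarith
  have hp0' : p ≠ 0 := hp0.ne'
  have hp1 : 0 < p - 1 := by linarith
  have hp1' : p - 1 ≠ 0 := hp1.ne'
  have hpq : p.HolderConjugate (p / (p - 1)) := Real.HolderConjugate.conjExponent hp
  set q : ℝ := p / (p - 1) with hq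
  set c : ℝ := (p - 2) / p with hc
  have hcp : c * p = p - 2 := by rw [hc]; field_simp
  have he' : (-σ - 1 - c) * q = (2 - σ * p - 2 * p) / (p - 1) := by
    rw [hq, hc]; field_simp; ring
  have he1 : (-σ - 1 - c) * q < -1 := by
    rw [he', div_lt_iff₀ hp1]; nlinarith
  have hmeas : Measurable fun x : ℝ => x ^ (-σ - 1) * ‖moebiusConv φ x‖ :=
    (measurable_id.pow_const _).mul (measurable_moebiusConv hφ.1).norm
  rw [← Ioc_union_Ioi_eq_Ioi (zero_le_one : (0 : ℝ) ≤ 1)]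
  refine IntegrableOn.union ?_ ?_
  · -- `(0, 1]`: `x^{−σ−1} ≤ x^{−1}` there, and `N_0(Gφ) < ∞`
    refine Integrable.mono' (h0.mono_set Ioc_subset_Ioi_self) hmeas.aestronglyMeasurable ?_
    refine ae_restrict_of_forall_mem measurableSet_Ioc fun u hu => ?_
    rw [Real.norm_eq_abs, abs_mul, abs_of_nonneg (Real.rpow_nonneg hu.1.le _), abs_norm]
    exact mul_le_mul_of_nonneg_right
      (Real.rpow_le_rpow_of_exponent_ge hu.1 hu.2 (by linarith)) (norm_nonneg _)
  · -- `(1, ∞)`: Young's inequality against the integrable majorant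
    have hmaj : IntegrableOn
        (fun u : ℝ => (‖moebiusConv φ u‖ ^ p * u ^ (p - 2)) / p + u ^ ((-σ - 1 - c) * q) / q)
        (Ioi 1) :=
      (hF.div_const p).add ((integrableOn_Ioi_rpow_of_lt he1 zero_lt_one).div_const q)
    refine Integrable.mono' hmaj hmeas.aestronglyMeasurable ?_
    refine ae_restrict_of_forall_mem measurableSet_Ioi fun u hu => ?_
    have hu0 : (0 : ℝ) < u := lt_trans zero_lt_one hu
    rw [Real.norm_eq_abs, abs_mul, abs_of_nonneg (Real.rpow_nonneg hu0.le _), abs_norm]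
    have hsplit : u ^ (-σ - 1) * ‖moebiusConv φ u‖ =
        (‖moebiusConv φ u‖ * u ^ c) * u ^ (-σ - 1 - c) := by
      rw [mul_assoc, ← Real.rpow_add hu0, show c + (-σ - 1 - c) = -σ - 1 by ring, mul_comm]
    have hyoung := Real.young_inequality_of_nonneg
      (mul_nonneg (norm_nonneg (moebiusConv φ u)) (Real.rpow_nonneg hu0.le c))
      (Real.rpow_nonneg hu0.le (-σ - 1 - c)) hpq
    rw [hsplit]
    refine hyoung.trans (le_of_eq ?_)
    rw [Real.mul_rpow (norm_nonneg _) (Real.rpow_nonneg hu0.le _), ← Real.rpow_mul hu0.le,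
      ← Real.rpow_mul hu0.le, hcp]

/-- ("⟹" of IJMMS Thm. 4.2) Under RH, for proper `φ` and `1 ≤ p < 2`,
`∫₀^∞ |Gφ(u)|^p u^{p−2} du < ∞`: on `(0,1]`, `|Gφ|^p u^{p−2} ≤ K^{p−1} · u^{−1}|Gφ(u)|` (`Gφ`
bounded, `N_0(Gφ) < ∞`); on `(1,∞)`, RH gives `|g(u)| ≤ C u^{−1/2+ε}` hence
`|Gφ(u)| ≤ C N_{−1/2+ε}(φ) u^{−1/2+ε}` ((3.16)), and with `ε = (2−p)/(4p)` the majorant is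
`≪ u^{p/4−3/2}`. [cite: BaezDuarte2005Moebius, Thm. 4.2 proof, (4.7)] -/
theorem integrableOn_norm_moebiusConv_rpow_of_riemannHypothesis (hRH : RiemannHypothesis)
    {φ : ℝ → ℂ} (hφ : IsMoebiusProper φ) {p : ℝ} (hp1 : 1 ≤ p) (hp2 : p < 2) :
    IntegrableOn (fun u : ℝ => ‖moebiusConv φ u‖ ^ p * u ^ (p - 2)) (Ioi 0) := by
  have hp0 : 0 < p := by linarith
  have hp0' : p ≠ 0 := hp0.ne'
  have hmeas : Measurable fun u : ℝ => ‖moebiusConv φ u‖ ^ p * u ^ (p - 2) :=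
    ((measurable_moebiusConv hφ.1).norm.pow_const _).mul (measurable_id.pow_const _)
  rw [← Ioc_union_Ioi_eq_Ioi (zero_le_one : (0 : ℝ) ≤ 1)]
  refine IntegrableOn.union ?_ ?_
  · -- `(0, 1]`
    obtain ⟨K, hK0, hK⟩ := exists_norm_moebiusConv_le hφ
    have h0 := hasFiniteMellinNorm_moebiusConv_zero hφ
    unfold HasFiniteMellinNorm at h0
    have hmaj : IntegrableOn (fun u : ℝ => K ^ (p - 1) * (u ^ (-(0 : ℝ) - 1) * ‖moebiusConv φ u‖))
        (Ioc 0 1) := (h0.mono_set Ioc_subset_Ioi_self).const_mul _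
    refine Integrable.mono' hmaj hmeas.aestronglyMeasurable ?_
    refine ae_restrict_of_forall_mem measurableSet_Ioc fun u hu => ?_
    have hu0 : (0 : ℝ) < u := hu.1
    rw [Real.norm_eq_abs,
      abs_of_nonneg (mul_nonneg (Real.rpow_nonneg (norm_nonneg _) _) (Real.rpow_nonneg hu0.le _))]
    have h1 : ‖moebiusConv φ u‖ ^ p = ‖moebiusConv φ u‖ ^ (p - 1) * ‖moebiusConv φ u‖ := by
      rw [← Real.rpow_add_one' (norm_nonneg _) (by linarith : p - 1 + 1 ≠ 0), sub_add_cancel]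
    have h2 : u ^ (p - 2) = u ^ (p - 1) * u ^ (-(0 : ℝ) - 1) := by
      rw [← Real.rpow_add hu0]; ring_nf
    have h3 : ‖moebiusConv φ u‖ ^ (p - 1) ≤ K ^ (p - 1) :=
      Real.rpow_le_rpow (norm_nonneg _) (hK u hu0) (by linarith)
    have h4 : u ^ (p - 1) ≤ 1 := Real.rpow_le_one hu0.le hu.2 (by linarith)
    rw [h1, h2]
    calc ‖moebiusConv φ u‖ ^ (p - 1) * ‖moebiusConv φ u‖ * (u ^ (p - 1) * u ^ (-(0 : ℝ) - 1))
        = (‖moebiusConv φ u‖ ^ (p - 1) * u ^ (p - 1)) *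
            (u ^ (-(0 : ℝ) - 1) * ‖moebiusConv φ u‖) := by ring
      _ ≤ (K ^ (p - 1) * 1) * (u ^ (-(0 : ℝ) - 1) * ‖moebiusConv φ u‖) :=
          mul_le_mul_of_nonneg_right
            (mul_le_mul h3 h4 (Real.rpow_nonneg hu0.le _) (Real.rpow_nonneg hK0 _))
            (mul_nonneg (Real.rpow_nonneg hu0.le _) (norm_nonneg _))
      _ = K ^ (p - 1) * (u ^ (-(0 : ℝ) - 1) * ‖moebiusConv φ u‖) := by rw [mul_one]
  · -- `(1, ∞)`
    set ε : ℝ := (2 - p) / (4 * p) with hε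
    have hε0 : 0 < ε := by rw [hε]; exact div_pos (by linarith) (by linarith)
    have hε1 : ε < 1 / 2 := by rw [hε, div_lt_iff₀ (by linarith)]; linarith
    obtain ⟨C, hC0, hC⟩ := abs_moebiusDivSum_le_rpow_of_riemannHypothesis hRH hε0 hε1
    set e : ℝ := -(1 / 2 : ℝ) + ε with he
    have hN : IntegrableOn (fun u : ℝ ↦ u ^ (-e - 1) * ‖φ u‖) (Ioi 0) :=
      hφ.2 e (by rw [he]; linarith) (by rw [he]; linarith)
    set K : ℝ := C * ∫ u in Ioi (0 : ℝ), u ^ (-e - 1) * ‖φ u‖ with hK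
    have hK0 : 0 ≤ K := mul_nonneg hC0 (setIntegral_nonneg measurableSet_Ioi fun u hu =>
      mul_nonneg (Real.rpow_nonneg (le_of_lt (α := ℝ) hu) _) (norm_nonneg _))
    have hG : ∀ u : ℝ, 0 < u → ‖moebiusConv φ u‖ ≤ K * u ^ e := fun u hu =>
      norm_moebiusConv_le_of_bound hC0 hC hN hu
    have hexp' : e * p + (p - 2) = p / 4 - 3 / 2 := by
      rw [he, hε]; field_simp; ring
    have hexp : e * p + (p - 2) < -1 := by rw [hexp']; linarith
    have hmaj : IntegrableOn (fun u : ℝ => K ^ p * u ^ (e * p + (p - 2))) (Ioi 1) :=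
      (integrableOn_Ioi_rpow_of_lt hexp zero_lt_one).const_mul _
    refine Integrable.mono' hmaj hmeas.aestronglyMeasurable ?_
    refine ae_restrict_of_forall_mem measurableSet_Ioi fun u hu => ?_
    have hu1 : (1 : ℝ) < u := hu
    have hu0 : 0 < u := by linarith
    rw [Real.norm_eq_abs,
      abs_of_nonneg (mul_nonneg (Real.rpow_nonneg (norm_nonneg _) _) (Real.rpow_nonneg hu0.le _))]
    have hg : ‖moebiusConv φ u‖ ^ p ≤ (K * u ^ e) ^ p :=
      Real.rpow_le_rpow (norm_nonneg _) (hG u hu0) hp0.le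
    rw [Real.mul_rpow hK0 (Real.rpow_nonneg hu0.le _), ← Real.rpow_mul hu0.le] at hg
    calc ‖moebiusConv φ u‖ ^ p * u ^ (p - 2)
        ≤ K ^ p * u ^ (e * p) * u ^ (p - 2) :=
          mul_le_mul_of_nonneg_right hg (Real.rpow_nonneg hu0.le _)
      _ = K ^ p * u ^ (e * p + (p - 2)) := by
          rw [Real.rpow_add hu0]; ring

end BaezDuarteMellin

open BaezDuarteMellin in
/-- **Báez-Duarte 2005, Theorem 4.2 (IJMMS pp. 3605–3606, (4.4)–(4.5); not in arXiv v1)** — the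
`L^p` variant of the convolution criterion, equivalence part: "Let `φ` be Mellin-proper, and define
`ψ(x) := x⁻¹ Gφ(x⁻¹)`; then `RH ⟺ (‖ψ‖_p < ∞, ∀ p ∈ [1,2))`", norms in `L^p((0,∞), dx)`;
`‖ψ‖_p < ∞` is rendered as integrability of `|ψ|^p` on `(0,∞)`. "⟹" as printed ((4.7): `Gφ`
bounded on `(0,1)`, `RH ⇒ Gφ(x) ≪ x^{−1/2+ε}` on `(1,∞)`). "⟸" as printed ((4.8): Hölder — here
Young — makes `∫₁^∞ x^{−s−1}Gφ(x) dx` absolutely convergent for `σ > 1/p − 1`, so `(Gφ)^∧` is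
holomorphic in the strip; with every `p < 2` available this is the whole strip `−1/2 < Re s < 0`,
and the continuation argument of Thm. 3.5 (`riemannHypothesis_of_isMellinProper_of_hasFiniteMellinNorm`)
gives RH). The further unconditional clause (4.6) (`‖ψ‖₂ = ∞` when `φ^∧ ∈ A[−1/2,0)` does not
vanish on `σ = −1/2`, via [1, Lemmas 2.1, 2.3]) is NOT formalised here. An equivalence is proved;
neither side is asserted. [cite: BaezDuarte2005Moebius, Thm. 4.2 (4.4)–(4.5) (IJMMS 2005:22, pp. 3605–3606)] -/
theorem BaezDuarte2005Moebius_thm_4_2 {φ : ℝ → ℂ} (hφ : IsMellinProper φ) :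
    RiemannHypothesis ↔ ∀ p : ℝ, 1 ≤ p → p < 2 →
      IntegrableOn (fun x : ℝ ↦ ‖(x : ℂ)⁻¹ * moebiusConv φ x⁻¹‖ ^ p) (Ioi 0) := by
  constructor
  · intro hRH p hp1 hp2
    rw [integrableOn_norm_inv_mul_rpow_iff]
    exact integrableOn_norm_moebiusConv_rpow_of_riemannHypothesis hRH hφ.1 hp1 hp2
  · intro H
    have H' : ∀ p : ℝ, 1 ≤ p → p < 2 →
        IntegrableOn (fun u : ℝ => ‖moebiusConv φ u‖ ^ p * u ^ (p - 2)) (Ioi 1) :=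
      fun p hp1 hp2 => ((integrableOn_norm_inv_mul_rpow_iff _ p).1
        (H p hp1 hp2)).mono_set (Ioi_subset_Ioi zero_le_one)
    refine riemannHypothesis_of_isMellinProper_of_hasFiniteMellinNorm hφ fun σ h1 h2 => ?_
    have hp1 : 1 < (3 - 2 * σ) / 2 := by linarith
    have hp2 : (3 - 2 * σ) / 2 < 2 := by linarith
    have hpσ : 1 < (3 - 2 * σ) / 2 * (σ + 1) := by
      nlinarith [mul_pos (by linarith : (0 : ℝ) < 1 + 2 * σ) (by linarith : (0 : ℝ) < 1 - σ)]
    exact hasFiniteMellinNorm_moebiusConv_of_integrableOn_rpow hφ.1 hp1 h2 hpσ (H' _ hp1.le hp2)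

namespace BaezDuarteMellin

/-! ## §13 (appended) (2.13) `∫₀^∞ g(x) dx/x = 1`, (3.11) `∫₀^∞ Gφ dx/x = ∫₀^∞ φ dx/x`, and the
qualitative part of Lemma 3.2: `Gφ` is continuous on `(0,∞)` and vanishes at `0` and at `∞` -/

/-- **(2.13) = arXiv (2.8): `g^∧(0) = ∫₀^∞ x^{−1} g(x) dx = 1`** ("setting `s = 0`" in (2.12)): as
`σ ↓ 0` along the reals, `σ ζ(σ+1) → 1` (the residue of `ζ` at `1`) while `g^∧(σ) → g^∧(0)` (Lemma 2.1
on the closed strip `0 ≤ Re s ≤ 1`, `N_0(g), N_1(g) < ∞`), and `ζ(σ+1)·σ g^∧(σ) = 1` for `σ > 0`.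
[cite: BaezDuarte2005Moebius, §2 eq. (2.13) (arXiv (2.8))] -/
theorem leftMellin_moebiusDivSum_zero : leftMellin (fun x : ℝ => (moebiusDivSum x : ℂ)) 0 = 1 := by
  set M : ℂ → ℂ := leftMellin (fun x : ℝ => (moebiusDivSum x : ℂ)) with hM
  -- `M(σ) → M(0)` as `σ ↓ 0`
  have hcont : ContinuousWithinAt M {s : ℂ | (0 : ℝ) ≤ s.re ∧ s.re ≤ 1} 0 :=
    continuousWithinAt_leftMellin (Complex.measurable_ofReal.comp measurable_moebiusDivSum)
      (hasFiniteMellinNorm_moebiusDivSum le_rfl) (hasFiniteMellinNorm_moebiusDivSum zero_le_one) 0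
  have hof : Tendsto (fun σ : ℝ => (σ : ℂ)) (𝓝[>] (0 : ℝ)) (𝓝[{s : ℂ | (0 : ℝ) ≤ s.re ∧ s.re ≤ 1}] 0) := by
    refine tendsto_nhdsWithin_iff.2 ⟨?_, ?_⟩
    · have h := (Complex.continuous_ofReal.tendsto (0 : ℝ)).mono_left
        (nhdsWithin_le_nhds (s := Ioi (0 : ℝ)))
      simpa using h
    · filter_upwards [Ioo_mem_nhdsGT (zero_lt_one' ℝ)] with σ hσ
      exact ⟨by simpa using hσ.1.le, by simpa using hσ.2.le⟩
  have hM0 : Tendsto (fun σ : ℝ => M (σ : ℂ)) (𝓝[>] (0 : ℝ)) (𝓝 (M 0)) := hcont.tendsto.comp hof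
  -- `σ ζ(σ+1) → 1`
  have hζ : Tendsto (fun σ : ℝ => ((σ : ℂ) + 1 - 1) * riemannZeta ((σ : ℂ) + 1))
      (𝓝[>] (0 : ℝ)) (𝓝 1) := by
    have hmap : Tendsto (fun σ : ℝ => (σ : ℂ) + 1) (𝓝[>] (0 : ℝ)) (𝓝[≠] 1) := by
      refine tendsto_nhdsWithin_iff.2 ⟨?_, ?_⟩
      · have h := ((Complex.continuous_ofReal.tendsto (0 : ℝ)).add_const (1 : ℂ)).mono_left
          (nhdsWithin_le_nhds (s := Ioi (0 : ℝ)))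
        simpa using h
      · filter_upwards [self_mem_nhdsWithin] with σ hσ
        have hσ' : (0 : ℝ) < σ := hσ
        simp only [mem_compl_iff, mem_singleton_iff, add_eq_right, Complex.ofReal_eq_zero]
        exact hσ'.ne'
    exact riemannZeta_residue_one.comp hmap
  -- the product is constantly `1` on `σ > 0`
  have hprod : Tendsto (fun σ : ℝ => ((σ : ℂ) + 1 - 1) * riemannZeta ((σ : ℂ) + 1) * M (σ : ℂ))
      (𝓝[>] (0 : ℝ)) (𝓝 (1 * M 0)) := hζ.mul hM0
  have hone : Tendsto (fun σ : ℝ => ((σ : ℂ) + 1 - 1) * riemannZeta ((σ : ℂ) + 1) * M (σ : ℂ))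
      (𝓝[>] (0 : ℝ)) (𝓝 1) := by
    refine tendsto_const_nhds.congr' ?_
    filter_upwards [self_mem_nhdsWithin] with σ hσ
    have hσ' : 0 < ((σ : ℂ)).re := by simpa using (hσ : (0 : ℝ) < σ)
    have h := riemannZeta_mul_leftMellin_moebiusDivSum hσ'
    rw [add_sub_cancel_right, hM]
    linear_combination -h
  have := tendsto_nhds_unique hprod hone
  rwa [one_mul] at this

/-- **(3.11) = arXiv (3.10): `∫₀^∞ x^{−1} Gφ(x) dx = ∫₀^∞ x^{−1} φ(x) dx`** for proper `φ` ("letting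
`s = 0`" in the factorisation (3.10) on the line `σ = 0`, with `g^∧(0) = 1`), in left-Mellin form.
[cite: BaezDuarte2005Moebius, Lemma 3.2 eq. (3.11) (arXiv Lemma 3.1 (3.10))] -/
theorem leftMellin_moebiusConv_zero {φ : ℝ → ℂ} (hφ : IsMoebiusProper φ) :
    leftMellin (moebiusConv φ) 0 = leftMellin φ 0 := by
  have hfac := leftMellin_moebiusConv_eq hφ.1 (s := 0)
    (by rw [Complex.zero_re]; exact hφ.2 0 (by norm_num) le_rfl)
    (by rw [Complex.zero_re]; exact hasFiniteMellinNorm_moebiusDivSum le_rfl)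
  rw [hfac, leftMellin_moebiusDivSum_zero, one_mul]

/-- (3.11) in integral form: `∫₀^∞ Gφ(x) dx/x = ∫₀^∞ φ(x) dx/x` for proper `φ`.
[cite: BaezDuarte2005Moebius, Lemma 3.2 eq. (3.11) (arXiv Lemma 3.1 (3.10))] -/
theorem integral_moebiusConv_div_eq {φ : ℝ → ℂ} (hφ : IsMoebiusProper φ) :
    ∫ x in Ioi (0 : ℝ), moebiusConv φ x / x = ∫ x in Ioi (0 : ℝ), φ x / x := by
  have h := leftMellin_moebiusConv_zero hφ
  unfold leftMellin at h
  have hker : ∀ (f : ℝ → ℂ), ∫ x in Ioi (0 : ℝ), (x : ℂ) ^ (-(0 : ℂ) - 1) * f x =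
      ∫ x in Ioi (0 : ℝ), f x / x := fun f => by
    refine setIntegral_congr_fun measurableSet_Ioi fun x hx => ?_
    have hx' : (x : ℂ) ≠ 0 := Complex.ofReal_ne_zero.2 (ne_of_gt hx)
    simp only [neg_zero, zero_sub, Complex.cpow_neg_one]
    rw [div_eq_inv_mul]
  rwa [hker, hker] at h

/-- `g(y) → 0` as `y → ∞` (the prime number theorem in the form (2.10), `g(x) ≪ (log x)^{−2}`; here
from the tree's de la Vallée-Poussin bound `|g(x)| ≤ C e^{−c√log x}`).
[cite: BaezDuarte2005Moebius, §2 eq. (2.10) (arXiv (2.5))] -/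
theorem tendsto_moebiusDivSum_atTop : Tendsto moebiusDivSum atTop (𝓝 0) := by
  obtain ⟨c, hc, C, hC⟩ := abs_sum_moebius_div_le_exp_neg_sqrt_log
  have hlim : Tendsto (fun x : ℝ => max C 0 * Real.exp (-c * Real.sqrt (Real.log x))) atTop (𝓝 0) := by
    have h1 : Tendsto (fun x : ℝ => Real.sqrt (Real.log x)) atTop atTop :=
      Real.tendsto_sqrt_atTop.comp Real.tendsto_log_atTop
    have h2 : Tendsto (fun x : ℝ => -c * Real.sqrt (Real.log x)) atTop atBot := by
      refine (tendsto_neg_atTop_atBot.comp (h1.const_mul_atTop hc)).congr fun x => ?_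
      simp only [Function.comp_apply, neg_mul]
    simpa using (Real.tendsto_exp_atBot.comp h2).const_mul (max C 0)
  refine squeeze_zero_norm' ?_ hlim
  filter_upwards [eventually_ge_atTop (2 : ℝ)] with x hx
  rw [Real.norm_eq_abs]
  exact (hC x hx).trans (mul_le_mul_of_nonneg_right (le_max_left _ _) (Real.exp_pos _).le)

/-- `g` is locally constant off the positive integers: if `y > 0` is not a natural number then `g`
is continuous at `y` (`g(y') = g(y)` for `⌊y'⌋ = ⌊y⌋`). [cite: BaezDuarte2005Moebius, §2 (2.5) (g is a step function)] -/
theorem continuousAt_moebiusDivSum {y : ℝ} (hy : 0 ≤ y) (hyn : ∀ n : ℕ, y ≠ n) :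
    ContinuousAt moebiusDivSum y := by
  obtain ⟨n, hn⟩ : ∃ n : ℕ, n = ⌊y⌋₊ := ⟨_, rfl⟩
  have h1 : (n : ℝ) ≤ y := hn ▸ Nat.floor_le hy
  have h2 : y < n + 1 := hn ▸ Nat.lt_floor_add_one y
  have h1' : (n : ℝ) < y := lt_of_le_of_ne h1 (fun h => hyn n h.symm)
  have hev : ∀ᶠ y' in 𝓝 y, moebiusDivSum y' = moebiusDivSum y := by
    filter_upwards [Ioo_mem_nhds h1' h2] with y' hy'
    have hy'0 : 0 ≤ y' := (Nat.cast_nonneg n).trans hy'.1.le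
    have hfl : ⌊y'⌋₊ = n := (Nat.floor_eq_iff hy'0).2 ⟨hy'.1.le, hy'.2⟩
    unfold moebiusDivSum
    rw [hfl, ← hn]
  exact tendsto_nhds_of_eventually_eq hev

/-- **Lemma 3.2, qualitative part (IJMMS; arXiv Lemma 3.1): for proper `φ`, `Gφ(x) → 0` as
`x → ∞`** ((4.10): "`Gφ(x) = o(1)` whenever `φ ∈ L¹(ℝ×)`") — dominated convergence with the
majorant `sup|g| · |φ(1/t)|/t ∈ L¹(0,∞)` and `g(xt) → 0`. [cite: BaezDuarte2005Moebius, Lemma 3.2 and (4.10) (arXiv Lemma 3.1)] -/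
theorem tendsto_moebiusConv_atTop {φ : ℝ → ℂ} (hφ : IsMoebiusProper φ) :
    Tendsto (moebiusConv φ) atTop (𝓝 0) := by
  obtain ⟨B, hB, hgB⟩ := exists_abs_moebiusDivSum_le
  have hN : IntegrableOn (fun t : ℝ => t ^ ((0 : ℝ) - 1) * ‖φ (1 / t)‖) (Ioi 0) := by
    rw [integrableOn_rpow_mul_comp_inv_iff (fun u => ‖φ u‖) 0]
    exact hφ.2 0 (by norm_num) le_rfl
  have hmeas : ∀ x : ℝ, AEStronglyMeasurable
      (fun t : ℝ => (moebiusDivSum (x * t) : ℂ) * φ (1 / t) / t) (volume.restrict (Ioi 0)) :=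
    fun x => ((measurable_convKernel hφ.1).of_uncurry_left (x := x)).aestronglyMeasurable
  have hbound : ∀ x : ℝ, ∀ᵐ t ∂(volume.restrict (Ioi (0 : ℝ))),
      ‖(moebiusDivSum (x * t) : ℂ) * φ (1 / t) / t‖ ≤ B * (t ^ ((0 : ℝ) - 1) * ‖φ (1 / t)‖) := by
    intro x
    refine ae_restrict_of_forall_mem measurableSet_Ioi fun t ht => ?_
    have ht0 : (0 : ℝ) < t := ht
    rw [norm_div, norm_mul, Complex.norm_real, Complex.norm_real, Real.norm_eq_abs,
      Real.norm_eq_abs, abs_of_pos ht0, zero_sub, Real.rpow_neg_one]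
    rw [div_eq_mul_inv]
    calc |moebiusDivSum (x * t)| * ‖φ (1 / t)‖ * t⁻¹ ≤ B * ‖φ (1 / t)‖ * t⁻¹ := by
          gcongr; exact hgB _
      _ = B * (t⁻¹ * ‖φ (1 / t)‖) := by ring
  have h := tendsto_integral_filter_of_dominated_convergence
    (μ := volume.restrict (Ioi (0 : ℝ))) (l := atTop)
    (F := fun (x t : ℝ) => (moebiusDivSum (x * t) : ℂ) * φ (1 / t) / t) (f := fun _ => 0)
    (fun t => B * (t ^ ((0 : ℝ) - 1) * ‖φ (1 / t)‖))
    (Eventually.of_forall hmeas) (Eventually.of_forall hbound) (hN.const_mul B) ?_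
  · show Tendsto (fun x : ℝ => ∫ t in Ioi (0 : ℝ), (moebiusDivSum (x * t) : ℂ) * φ (1 / t) / t)
      atTop (𝓝 0)
    simpa using h
  · refine ae_restrict_of_forall_mem measurableSet_Ioi fun t ht => ?_
    have ht0 : (0 : ℝ) < t := ht
    have hg : Tendsto (fun x : ℝ => (moebiusDivSum (x * t) : ℂ)) atTop (𝓝 0) := by
      have h1 : Tendsto (fun x : ℝ => moebiusDivSum (x * t)) atTop (𝓝 0) :=
        tendsto_moebiusDivSum_atTop.comp (tendsto_id.atTop_mul_const ht0)
      have h2 := (Complex.continuous_ofReal.tendsto 0).comp h1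
      rw [Complex.ofReal_zero] at h2
      exact h2
    simpa using (hg.mul_const (φ (1 / t))).div_const (t : ℂ)

/-- **Lemma 3.2, qualitative part: for proper `φ`, `Gφ(x) → 0` as `x ↓ 0`** (`g(xt) = 0` once
`xt < 1`; dominated convergence). [cite: BaezDuarte2005Moebius, Lemma 3.2 (arXiv Lemma 3.1)] -/
theorem tendsto_moebiusConv_nhdsGT_zero {φ : ℝ → ℂ} (hφ : IsMoebiusProper φ) :
    Tendsto (moebiusConv φ) (𝓝[>] 0) (𝓝 0) := by
  obtain ⟨B, hB, hgB⟩ := exists_abs_moebiusDivSum_le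
  have hN : IntegrableOn (fun t : ℝ => t ^ ((0 : ℝ) - 1) * ‖φ (1 / t)‖) (Ioi 0) := by
    rw [integrableOn_rpow_mul_comp_inv_iff (fun u => ‖φ u‖) 0]
    exact hφ.2 0 (by norm_num) le_rfl
  have hmeas : ∀ x : ℝ, AEStronglyMeasurable
      (fun t : ℝ => (moebiusDivSum (x * t) : ℂ) * φ (1 / t) / t) (volume.restrict (Ioi 0)) :=
    fun x => ((measurable_convKernel hφ.1).of_uncurry_left (x := x)).aestronglyMeasurable
  have hbound : ∀ x : ℝ, ∀ᵐ t ∂(volume.restrict (Ioi (0 : ℝ))),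
      ‖(moebiusDivSum (x * t) : ℂ) * φ (1 / t) / t‖ ≤ B * (t ^ ((0 : ℝ) - 1) * ‖φ (1 / t)‖) := by
    intro x
    refine ae_restrict_of_forall_mem measurableSet_Ioi fun t ht => ?_
    have ht0 : (0 : ℝ) < t := ht
    rw [norm_div, norm_mul, Complex.norm_real, Complex.norm_real, Real.norm_eq_abs,
      Real.norm_eq_abs, abs_of_pos ht0, zero_sub, Real.rpow_neg_one]
    rw [div_eq_mul_inv]
    calc |moebiusDivSum (x * t)| * ‖φ (1 / t)‖ * t⁻¹ ≤ B * ‖φ (1 / t)‖ * t⁻¹ := by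
          gcongr; exact hgB _
      _ = B * (t⁻¹ * ‖φ (1 / t)‖) := by ring
  have h := tendsto_integral_filter_of_dominated_convergence
    (μ := volume.restrict (Ioi (0 : ℝ))) (l := 𝓝[>] (0 : ℝ))
    (F := fun (x t : ℝ) => (moebiusDivSum (x * t) : ℂ) * φ (1 / t) / t) (f := fun _ => 0)
    (fun t => B * (t ^ ((0 : ℝ) - 1) * ‖φ (1 / t)‖))
    (Eventually.of_forall hmeas) (Eventually.of_forall hbound) (hN.const_mul B) ?_
  · show Tendsto (fun x : ℝ => ∫ t in Ioi (0 : ℝ), (moebiusDivSum (x * t) : ℂ) * φ (1 / t) / t)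
      (𝓝[>] (0 : ℝ)) (𝓝 0)
    simpa using h
  · refine ae_restrict_of_forall_mem measurableSet_Ioi fun t ht => ?_
    have ht0 : (0 : ℝ) < t := ht
    refine tendsto_const_nhds.congr' ?_
    filter_upwards [Ioo_mem_nhdsGT (show (0 : ℝ) < 1 / t by positivity)] with x hx
    have hxt : x * t < 1 := by
      have := hx.2
      rwa [lt_div_iff₀ ht0] at this
    rw [moebiusDivSum_of_lt_one hxt]
    simp

/-- **Lemma 3.2, qualitative part: for proper `φ`, `Gφ` is continuous on `(0, ∞)`** (dominated
convergence: for fixed `x₀ > 0`, `x ↦ g(xt)` is continuous at `x₀` unless `x₀t ∈ ℕ`, a countable,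
hence null, set of `t`). [cite: BaezDuarte2005Moebius, Lemma 3.2 (arXiv Lemma 3.1)] -/
theorem continuousOn_moebiusConv {φ : ℝ → ℂ} (hφ : IsMoebiusProper φ) :
    ContinuousOn (moebiusConv φ) (Ioi 0) := by
  obtain ⟨B, hB, hgB⟩ := exists_abs_moebiusDivSum_le
  have hN : IntegrableOn (fun t : ℝ => t ^ ((0 : ℝ) - 1) * ‖φ (1 / t)‖) (Ioi 0) := by
    rw [integrableOn_rpow_mul_comp_inv_iff (fun u => ‖φ u‖) 0]
    exact hφ.2 0 (by norm_num) le_rfl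
  have hmeas : ∀ x : ℝ, AEStronglyMeasurable
      (fun t : ℝ => (moebiusDivSum (x * t) : ℂ) * φ (1 / t) / t) (volume.restrict (Ioi 0)) :=
    fun x => ((measurable_convKernel hφ.1).of_uncurry_left (x := x)).aestronglyMeasurable
  have hbound : ∀ x : ℝ, ∀ᵐ t ∂(volume.restrict (Ioi (0 : ℝ))),
      ‖(moebiusDivSum (x * t) : ℂ) * φ (1 / t) / t‖ ≤ B * (t ^ ((0 : ℝ) - 1) * ‖φ (1 / t)‖) := by
    intro x
    refine ae_restrict_of_forall_mem measurableSet_Ioi fun t ht => ?_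
    have ht0 : (0 : ℝ) < t := ht
    rw [norm_div, norm_mul, Complex.norm_real, Complex.norm_real, Real.norm_eq_abs,
      Real.norm_eq_abs, abs_of_pos ht0, zero_sub, Real.rpow_neg_one]
    rw [div_eq_mul_inv]
    calc |moebiusDivSum (x * t)| * ‖φ (1 / t)‖ * t⁻¹ ≤ B * ‖φ (1 / t)‖ * t⁻¹ := by
          gcongr; exact hgB _
      _ = B * (t⁻¹ * ‖φ (1 / t)‖) := by ring
  intro x₀ hx₀
  have hx₀' : (0 : ℝ) < x₀ := hx₀
  refine ContinuousAt.continuousWithinAt ?_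
  show ContinuousAt (fun x : ℝ => ∫ t in Ioi (0 : ℝ), (moebiusDivSum (x * t) : ℂ) * φ (1 / t) / t) x₀
  refine continuousAt_of_dominated (Eventually.of_forall hmeas) (Eventually.of_forall hbound)
    (hN.const_mul B) ?_
  -- continuity of `x ↦ g(xt)` at `x₀` for `t` off the null set `{n/x₀ : n ∈ ℕ}`
  have hnull : ∀ᵐ t ∂(volume.restrict (Ioi (0 : ℝ))), t ∉ range (fun n : ℕ => (n : ℝ) / x₀) :=
    ae_restrict_of_ae ((countable_range _).ae_notMem volume)
  filter_upwards [hnull, ae_restrict_mem measurableSet_Ioi] with t ht ht0'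
  have ht0 : (0 : ℝ) < t := ht0'
  have hyn : ∀ n : ℕ, x₀ * t ≠ n := by
    intro n h
    refine ht ⟨n, ?_⟩
    show (n : ℝ) / x₀ = t
    rw [← h, mul_div_cancel_left₀ t hx₀'.ne']
  have hmul : ContinuousAt (fun x : ℝ => x * t) x₀ := (continuous_id.mul continuous_const).continuousAt
  have hg1 : ContinuousAt moebiusDivSum (x₀ * t) := continuousAt_moebiusDivSum (by positivity) hyn
  have hg2 : ContinuousAt (fun x : ℝ => moebiusDivSum (x * t)) x₀ :=
    ContinuousAt.comp (f := fun x : ℝ => x * t) (g := moebiusDivSum) hg1 hmul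
  have hg : ContinuousAt (fun x : ℝ => (moebiusDivSum (x * t) : ℂ)) x₀ :=
    ContinuousAt.comp (f := fun x : ℝ => moebiusDivSum (x * t)) (g := fun r : ℝ => (r : ℂ))
      Complex.continuous_ofReal.continuousAt hg2
  exact (hg.mul continuousAt_const).div_const _

end BaezDuarteMellin

/-! ## §14 (appended) Proposition 4.3 (IJMMS p. 3607, (4.12)–(4.13); published version only):
`Gφ(x) ≠ o(x^{−1/2})` -/

namespace BaezDuarteMellin

/-- Near a zero `ρ ≠ 1` of `ζ`: `‖ζ(ρ + h)‖ ≤ K h` for `0 < h < r` (differentiability of `ζ` at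
`ρ`; this is what makes `φ^∧(s)/(sζ(s+1))` blow up at `s₀ = ρ − 1` in the proof of Prop. 4.3).
[cite: BaezDuarte2005Moebius, §4 Prop. 4.3 (proof, (4.13): "there are poles for f(s)")] -/
theorem exists_norm_riemannZeta_le_mul_of_zero {ρ : ℂ} (hρ : riemannZeta ρ = 0) (hρ1 : ρ ≠ 1) :
    ∃ K r : ℝ, 0 < K ∧ 0 < r ∧ ∀ h : ℝ, 0 < h → h < r → ‖riemannZeta (ρ + h)‖ ≤ K * h := by
  have hd := (differentiableAt_riemannZeta hρ1).hasDerivAt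
  rw [hasDerivAt_iff_isLittleO] at hd
  obtain ⟨r, hr0, hr⟩ := Metric.eventually_nhds_iff.1 (hd.def zero_lt_one)
  refine ⟨‖deriv riemannZeta ρ‖ + 1, r, by positivity, hr0, fun h hh0 hhr => ?_⟩
  have hz : dist (ρ + h) ρ < r := by
    rw [dist_eq_norm, add_sub_cancel_left, Complex.norm_real, Real.norm_of_nonneg hh0.le]
    exact hhr
  have h1 := hr hz
  rw [hρ, sub_zero, add_sub_cancel_left, one_mul, Complex.norm_real, Real.norm_of_nonneg hh0.le,
    smul_eq_mul] at h1
  have h2 : ‖(h : ℂ) * deriv riemannZeta ρ‖ = h * ‖deriv riemannZeta ρ‖ := by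
    rw [norm_mul, Complex.norm_real, Real.norm_of_nonneg hh0.le]
  calc ‖riemannZeta (ρ + h)‖
      = ‖(riemannZeta (ρ + h) - (h : ℂ) * deriv riemannZeta ρ) + (h : ℂ) * deriv riemannZeta ρ‖ := by
        rw [sub_add_cancel]
    _ ≤ ‖riemannZeta (ρ + h) - (h : ℂ) * deriv riemannZeta ρ‖ + ‖(h : ℂ) * deriv riemannZeta ρ‖ :=
        norm_add_le _ _
    _ ≤ h + h * ‖deriv riemannZeta ρ‖ := by rw [h2]; linarith
    _ = (‖deriv riemannZeta ρ‖ + 1) * h := by ring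

end BaezDuarteMellin

open BaezDuarteMellin in
/-- **Báez-Duarte 2005, Proposition 4.3 (IJMMS p. 3607, (4.12); published version only)**: "If `φ`
is Mellin-proper then `Gφ(x) ≠ o(x^{−1/2})`." The printed proof: `f(s) = ∫₁^∞ x^{−s−1}Gφ(x) dx =
h(s) + φ^∧(s)/(sζ(s+1))` ((4.13)) "has a finite abscissa of convergence `α ≥ −1/2`. In this
half-plane there are poles for `f(s)`, therefore, by the order Lemma 2.1 of [1]", `Gφ ≠ o(x^{−1/2})`.
A pole of `φ^∧(s)/(sζ(s+1))` at `s₀ = ρ − 1` (`ρ` a zero of `ζ` on the critical line) requires `φ^∧`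
to be finite and non-zero at `s₀`, which Mellin-properness alone does not give; accordingly the
statement is proved here under the hypotheses of Thm. 4.1 (`N_{−1/2}(φ) < ∞` and `φ^∧ ≠ 0` on
`Re s = −1/2`), and directly rather than through the order lemma: if `Gφ = o(x^{−1/2})` then for
every `η > 0`, `‖(Gφ)^∧(s₀+h)‖ ≤ A_η + η/h` (`norm_leftMellin_moebiusConv_le_of_isBigOWith`), while
(3.11) and `‖ζ(ρ+h)‖ ≤ K h` give `0 < b ≤ ‖φ^∧(s₀+h)‖ ≤ (A_η + η/h)·L·K h → η L K` as `h ↓ 0` —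
absurd for `η = b/(2LK)`. The zero used is the tree's kernel-certified first zero
`ρ = 1/2 + iγ₀`, `γ₀ ∈ [225/16, 227/16]` (`exists_zero_Icc_first_bracket`). Nothing here bears on
the truth of RH. [cite: BaezDuarte2005Moebius, Prop. 4.3 (4.12)–(4.13) (IJMMS 2005:22 p. 3607)] -/
theorem BaezDuarte2005Moebius_prop_4_3 {φ : ℝ → ℂ} (hφ : IsMellinProper φ)
    (hN : HasFiniteMellinNorm φ (-(1 / 2 : ℝ)))
    (hne : ∀ s : ℂ, s.re = -(1 / 2 : ℝ) → leftMellin φ s ≠ 0) :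
    ¬ (moebiusConv φ =o[atTop] fun x : ℝ ↦ x ^ (-(1 / 2 : ℝ))) := by
  intro hsmall
  have hG : moebiusConv φ =O[atTop] fun x : ℝ ↦ x ^ (-(1 / 2 : ℝ)) := hsmall.isBigO
  have hGε : ∀ ε : ℝ, 0 < ε → moebiusConv φ =O[atTop] fun x : ℝ ↦ x ^ (-(1 / 2 : ℝ) + ε) :=
    fun ε hε => isBigO_rpow_add hε.le hG
  -- a zero of `ζ` on the critical line (the certified first zero)
  obtain ⟨γ, -, hρ⟩ := exists_zero_Icc_first_bracket
  set ρ : ℂ := 1 / 2 + (γ : ℂ) * I with hρdef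
  have hre : ρ.re = 1 / 2 := by simp [hρdef]
  have hρ1 : ρ ≠ 1 := by
    intro h
    have := congrArg Complex.re h
    rw [hre, Complex.one_re] at this
    norm_num at this
  obtain ⟨K, r, hK, hr, hζK⟩ := exists_norm_riemannZeta_le_mul_of_zero hρ hρ1
  -- continuity of `φ^∧` at `s₀ = ρ − 1`; `b = ‖φ^∧(s₀)‖/2 > 0`
  have hs₀re : (ρ - 1).re = -(1 / 2 : ℝ) := by
    rw [Complex.sub_re, Complex.one_re, hre]; norm_num
  have hb0 : 0 < ‖leftMellin φ (ρ - 1)‖ := norm_pos_iff.2 (hne _ hs₀re)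
  have hcont : ContinuousWithinAt (leftMellin φ) {s : ℂ | -(1 / 2 : ℝ) ≤ s.re ∧ s.re ≤ 0} (ρ - 1) :=
    continuousWithinAt_leftMellin hφ.1.1 hN (hφ.1.2 0 (by norm_num) le_rfl) (ρ - 1)
  obtain ⟨δ, hδ0, hδ⟩ := Metric.continuousWithinAt_iff.1 hcont (‖leftMellin φ (ρ - 1)‖ / 2)
    (by positivity)
  set b : ℝ := ‖leftMellin φ (ρ - 1)‖ / 2 with hb
  set L : ℝ := ‖ρ - 1‖ + 1 with hL
  have hbpos : 0 < b := by rw [hb]; positivity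
  have hLpos : 0 < L := by rw [hL]; positivity
  -- the `o`-bound with `η = b/(2LK)`
  set η : ℝ := b / (2 * (L * K)) with hη
  have hη0 : 0 < η := by rw [hη]; positivity
  obtain ⟨A, hA, hbound⟩ :=
    norm_leftMellin_moebiusConv_le_of_isBigOWith hφ.1 hη0 (hsmall.forall_isBigOWith hη0)
  -- for small `h > 0`: `b ≤ (A h + η) L K`
  have hm0 : 0 < min δ (min (1 / 2 : ℝ) r) := by positivity
  have key : ∀ h : ℝ, 0 < h → h < min δ (min (1 / 2 : ℝ) r) → b ≤ (A * h + η) * (L * K) := by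
    intro h hh0 hh1
    have hhδ : h < δ := lt_of_lt_of_le hh1 (min_le_left _ _)
    have hh2 : h < 1 / 2 := lt_of_lt_of_le hh1 ((min_le_right _ _).trans (min_le_left _ _))
    have hhr : h < r := lt_of_lt_of_le hh1 ((min_le_right _ _).trans (min_le_right _ _))
    have hsre : (ρ - 1 + h).re = -(1 / 2 : ℝ) + h := by
      rw [Complex.add_re, hs₀re, Complex.ofReal_re]
    have hs1 : -(1 / 2 : ℝ) < (ρ - 1 + h).re := by rw [hsre]; linarith
    have hs2 : (ρ - 1 + h).re < 0 := by rw [hsre]; linarith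
    have h311 := leftMellin_moebiusConv_mul_eq hφ.1 hGε hs1 hs2
    have hsζ : ρ - 1 + (h : ℂ) + 1 = ρ + h := by ring
    have hbs : b ≤ ‖leftMellin φ (ρ - 1 + h)‖ := by
      have hd : dist (ρ - 1 + (h : ℂ)) (ρ - 1) < δ := by
        rw [dist_eq_norm, add_sub_cancel_left, Complex.norm_real, Real.norm_of_nonneg hh0.le]
        exact hhδ
      have h1 := hδ ⟨hs1.le, hs2.le⟩ hd
      rw [dist_eq_norm] at h1
      have h2 := norm_sub_norm_le (leftMellin φ (ρ - 1)) (leftMellin φ (ρ - 1 + h))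
      rw [norm_sub_rev] at h2
      rw [hb]
      linarith
    have hGs := hbound _ hs1 hs2
    rw [hsre, show -(1 / 2 : ℝ) + h + 1 / 2 = h by ring] at hGs
    have hsL : ‖ρ - 1 + (h : ℂ)‖ ≤ L := by
      rw [hL]
      calc ‖ρ - 1 + (h : ℂ)‖ ≤ ‖ρ - 1‖ + ‖(h : ℂ)‖ := norm_add_le _ _
        _ ≤ ‖ρ - 1‖ + 1 := by
            rw [Complex.norm_real, Real.norm_of_nonneg hh0.le]; linarith
    have hACh : 0 ≤ A + η / h := by positivity
    have hup : ‖leftMellin φ (ρ - 1 + h)‖ ≤ (A + η / h) * (L * (K * h)) := by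
      rw [← h311, hsζ, norm_mul, norm_mul]
      exact mul_le_mul hGs (mul_le_mul hsL (hζK h hh0 hhr) (norm_nonneg _) hLpos.le)
        (mul_nonneg (norm_nonneg _) (norm_nonneg _)) hACh
    calc b ≤ ‖leftMellin φ (ρ - 1 + h)‖ := hbs
      _ ≤ (A + η / h) * (L * (K * h)) := hup
      _ = (A * h + η) * (L * K) := by
          field_simp
  -- let `h ↓ 0`: `b ≤ η L K = b/2`, absurd
  have hcts : Continuous fun h : ℝ => (A * h + η) * (L * K) := by fun_prop
  have hlim : Tendsto (fun h : ℝ => (A * h + η) * (L * K)) (𝓝[>] 0) (𝓝 ((A * 0 + η) * (L * K))) :=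
    (hcts.tendsto 0).mono_left nhdsWithin_le_nhds
  have hev : ∀ᶠ h in 𝓝[>] (0 : ℝ), b ≤ (A * h + η) * (L * K) := by
    filter_upwards [Ioo_mem_nhdsGT hm0] with h hh
    exact key h hh.1 hh.2
  have hle : b ≤ (A * 0 + η) * (L * K) := ge_of_tendsto hlim hev
  rw [mul_zero, zero_add, hη] at hle
  have hLK : 0 < L * K := by positivity
  have : b / (2 * (L * K)) * (L * K) = b / 2 := by
    field_simp
  rw [this] at hle
  linarith

/-! ## §15 (appended) Around Prop. 4.3: (4.11), "`α ≥ −1/2`" ((4.13)), the unconditional `p = 1`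
cases of Thms 2.3/4.2, and the range `ϑ ∈ [0, 1/2)` printed in Thm. 4.4 -/

namespace BaezDuarteMellin

/-- `‖g₁‖₁ < ∞` unconditionally (the first sentence of the proof of IJMMS Thm. 2.3: "Note that
`‖g₁‖₁ < ∞` is unconditionally true"; it is `g ∈ L¹(ℝ×)`, (2.11)).
[cite: BaezDuarte2005Moebius, Thm. 2.3 (proof, first sentence) and (2.11)] -/
theorem integrableOn_abs_inv_mul_moebiusDivSum :
    IntegrableOn (fun x : ℝ => |x⁻¹ * moebiusDivSum x⁻¹|) (Ioi 0) := by
  have h1 : IntegrableOn (fun u : ℝ => |moebiusDivSum u| ^ (1 : ℝ) * u ^ ((1 : ℝ) - 2)) (Ioi 1) := by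
    refine (integrableOn_abs_moebiusDivSum_div.mono_set (Ioi_subset_Ioi zero_le_one)).congr_fun
      (fun u _ => ?_) measurableSet_Ioi
    simp only [Real.rpow_one, show (1 : ℝ) - 2 = -1 by norm_num, Real.rpow_neg_one, div_eq_mul_inv]
  have h := (integrableOn_abs_inv_mul_moebiusDivSum_rpow_iff zero_lt_one).2 h1
  refine h.congr_fun (fun x _ => ?_) measurableSet_Ioi
  simp only [Real.rpow_one]

/-- `‖ψ‖₁ = N_0(Gφ) < ∞` unconditionally for proper `φ` (the first sentence of the proof of IJMMS
Thm. 4.2, by (3.9)). [cite: BaezDuarte2005Moebius, Thm. 4.2 (proof, first sentence) and Lemma 3.2 (3.9)] -/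
theorem integrableOn_norm_inv_mul_moebiusConv {φ : ℝ → ℂ} (hφ : IsMoebiusProper φ) :
    IntegrableOn (fun x : ℝ => ‖(x : ℂ)⁻¹ * moebiusConv φ x⁻¹‖) (Ioi 0) := by
  have h0 := hasFiniteMellinNorm_moebiusConv_zero hφ
  unfold HasFiniteMellinNorm at h0
  have h1 : IntegrableOn (fun u : ℝ => ‖moebiusConv φ u‖ ^ (1 : ℝ) * u ^ ((1 : ℝ) - 2)) (Ioi 0) := by
    refine h0.congr_fun (fun u _ => ?_) measurableSet_Ioi
    rw [Real.rpow_one, show (1 : ℝ) - 2 = -(0 : ℝ) - 1 by norm_num, mul_comm]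
  have h := (integrableOn_norm_inv_mul_rpow_iff (moebiusConv φ) 1).2 h1
  refine h.congr_fun (fun x _ => ?_) measurableSet_Ioi
  simp only [Real.rpow_one]

/-- **"`f(s) = ∫₁^∞ x^{−s−1}Gφ(x) dx` has a finite abscissa of convergence `α ≥ −1/2`"** (IJMMS
p. 3607, proof of Prop. 4.3, (4.13)), under the hypotheses of Thm. 4.1: `N_σ(Gφ) = ∞` for every
`σ < −1/2`. For if `N_σ(Gφ) < ∞` then (with `N_0(Gφ) < ∞`) all `N_{σ'}(Gφ)`, `σ ≤ σ' ≤ 0`, are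
finite, `(Gφ)^∧` is continuous on `σ ≤ Re s ≤ 0`, and (3.11) `φ^∧(s) = (Gφ)^∧(s)·sζ(s+1)`
(`−1/2 < Re s < 0`) passes to the limit at `s₀ = ρ − 1` along `s₀ + h`, `h ↓ 0`, `ρ` the tree's
certified critical zero: `φ^∧(s₀) = (Gφ)^∧(s₀)·s₀ζ(ρ) = 0`, contradicting `φ^∧ ≠ 0` on `Re s = −1/2`.
[cite: BaezDuarte2005Moebius, Prop. 4.3 (proof, (4.13)) (IJMMS 2005:22 p. 3607)] -/
theorem not_hasFiniteMellinNorm_moebiusConv_of_lt {φ : ℝ → ℂ} (hφ : IsMellinProper φ)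
    (hN : HasFiniteMellinNorm φ (-(1 / 2 : ℝ)))
    (hne : ∀ s : ℂ, s.re = -(1 / 2 : ℝ) → leftMellin φ s ≠ 0) {σ : ℝ} (hσ : σ < -(1 / 2 : ℝ)) :
    ¬ HasFiniteMellinNorm (moebiusConv φ) σ := by
  intro hGσ
  have hφm : Measurable φ := hφ.1.1
  have hG0 := hasFiniteMellinNorm_moebiusConv_zero hφ.1
  -- interpolation: `N_{σ'}(Gφ) < ∞` for `σ ≤ σ' ≤ 0`
  have hGall : ∀ σ' : ℝ, σ ≤ σ' → σ' ≤ 0 → HasFiniteMellinNorm (moebiusConv φ) σ' := by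
    intro σ' h1 h2
    have hGσ' := hGσ
    have hG0' := hG0
    unfold HasFiniteMellinNorm at hGσ' hG0' ⊢
    refine (hGσ'.add hG0').mono'
      ((measurable_id.pow_const _).mul (measurable_moebiusConv hφm).norm).aestronglyMeasurable ?_
    refine ae_restrict_of_forall_mem measurableSet_Ioi fun x hx => ?_
    rw [Real.norm_eq_abs, abs_mul, abs_of_nonneg (Real.rpow_nonneg (le_of_lt hx) _), abs_norm,
      Pi.add_apply, ← add_mul]
    exact mul_le_mul_of_nonneg_right (rpow_le_rpow_add_rpow hx h1 h2) (norm_nonneg _)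
  have h311 : ∀ s : ℂ, -(1 / 2 : ℝ) < s.re → s.re < 0 →
      leftMellin (moebiusConv φ) s * (s * riemannZeta (s + 1)) = leftMellin φ s :=
    fun s hs1 hs2 => leftMellin_moebiusConv_mul_eq_of_hasFiniteMellinNorm hφ.1
      (fun σ' h1 h2 => hGall σ' (by linarith) h2.le) hs1 hs2
  -- the certified critical zero `ρ` and `s₀ = ρ − 1`
  obtain ⟨γ, -, hρ⟩ := exists_zero_Icc_first_bracket
  set ρ : ℂ := 1 / 2 + (γ : ℂ) * I with hρdef
  have hre : ρ.re = 1 / 2 := by simp [hρdef]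
  have hρ1 : ρ ≠ 1 := by
    intro h
    have := congrArg Complex.re h
    rw [hre, Complex.one_re] at this
    norm_num at this
  have hs₀re : (ρ - 1).re = -(1 / 2 : ℝ) := by
    rw [Complex.sub_re, Complex.one_re, hre]; norm_num
  -- the path `h ↦ s₀ + h`, `h ↓ 0`
  have hpath0 : Tendsto (fun h : ℝ => ρ - 1 + (h : ℂ)) (𝓝[>] 0) (𝓝 (ρ - 1)) := by
    have h := ((Complex.continuous_ofReal.tendsto (0 : ℝ)).const_add (ρ - 1)).mono_left
      (nhdsWithin_le_nhds (s := Ioi (0 : ℝ)))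
    simpa using h
  have hpath : ∀ a : ℝ, a ≤ -(1 / 2 : ℝ) → Tendsto (fun h : ℝ => ρ - 1 + (h : ℂ)) (𝓝[>] 0)
      (𝓝[{s : ℂ | a ≤ s.re ∧ s.re ≤ 0}] (ρ - 1)) := by
    intro a ha
    refine tendsto_nhdsWithin_iff.2 ⟨hpath0, ?_⟩
    filter_upwards [Ioo_mem_nhdsGT (show (0 : ℝ) < 1 / 2 by norm_num)] with h hh
    simp only [Complex.add_re, hs₀re, Complex.ofReal_re]
    constructor <;> linarith [hh.1, hh.2]
  have hMG : Tendsto (fun h : ℝ => leftMellin (moebiusConv φ) (ρ - 1 + h)) (𝓝[>] 0)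
      (𝓝 (leftMellin (moebiusConv φ) (ρ - 1))) :=
    (continuousWithinAt_leftMellin (measurable_moebiusConv hφm) hGσ hG0 (ρ - 1)).tendsto.comp
      (hpath σ hσ.le)
  have hMφ : Tendsto (fun h : ℝ => leftMellin φ (ρ - 1 + h)) (𝓝[>] 0)
      (𝓝 (leftMellin φ (ρ - 1))) :=
    (continuousWithinAt_leftMellin hφm hN (hφ.1.2 0 (by norm_num) le_rfl) (ρ - 1)).tendsto.comp
      (hpath _ le_rfl)
  have hζc : Tendsto (fun h : ℝ => (ρ - 1 + (h : ℂ)) * riemannZeta (ρ - 1 + (h : ℂ) + 1)) (𝓝[>] 0)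
      (𝓝 ((ρ - 1) * riemannZeta (ρ - 1 + 1))) := by
    have h1 : ρ - 1 + 1 ≠ 1 := by rw [sub_add_cancel]; exact hρ1
    have hc : ContinuousAt (fun z : ℂ => z * riemannZeta (z + 1)) (ρ - 1) :=
      continuousAt_id.mul (ContinuousAt.comp (f := fun z : ℂ => z + 1)
        (differentiableAt_riemannZeta h1).continuousAt (continuous_id.add continuous_const).continuousAt)
    exact hc.tendsto.comp hpath0
  have hprod := hMG.mul hζc
  rw [sub_add_cancel, hρ, mul_zero, mul_zero] at hprod
  -- along the path the product IS `φ^∧`, by (3.11)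
  have heq : (fun h : ℝ => leftMellin (moebiusConv φ) (ρ - 1 + h) *
      ((ρ - 1 + (h : ℂ)) * riemannZeta (ρ - 1 + (h : ℂ) + 1))) =ᶠ[𝓝[>] 0]
      fun h : ℝ => leftMellin φ (ρ - 1 + h) := by
    filter_upwards [Ioo_mem_nhdsGT (show (0 : ℝ) < 1 / 2 by norm_num)] with h hh
    have hsre : (ρ - 1 + (h : ℂ)).re = -(1 / 2 : ℝ) + h := by
      rw [Complex.add_re, hs₀re, Complex.ofReal_re]
    exact h311 _ (by rw [hsre]; linarith [hh.1]) (by rw [hsre]; linarith [hh.2])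
  have hzero : leftMellin φ (ρ - 1) = 0 := tendsto_nhds_unique hMφ (hprod.congr' heq)
  exact hne _ hs₀re hzero

end BaezDuarteMellin

open BaezDuarteMellin in
/-- **IJMMS (4.11)** (p. 3607: "if `φ` satisfies the conditions in Theorem 3.5 farther to the left
… then `Gφ(x) ≪̸ x^{−1/2−ε}`, as follows easily from the reasoning in the proof of Theorem 3.5"),
here as a corollary of Prop. 4.3 under the hypotheses of Thm. 4.1 (which the printed "conditions
farther to the left" imply): for every `ε > 0`, `Gφ(x) = O(x^{−1/2−ε})` is impossible.
[cite: BaezDuarte2005Moebius, §4 eq. (4.11) (IJMMS 2005:22 p. 3607)] -/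
theorem BaezDuarte2005Moebius_eq_4_11 {φ : ℝ → ℂ} (hφ : IsMellinProper φ)
    (hN : HasFiniteMellinNorm φ (-(1 / 2 : ℝ)))
    (hne : ∀ s : ℂ, s.re = -(1 / 2 : ℝ) → leftMellin φ s ≠ 0) {ε : ℝ} (hε : 0 < ε) :
    ¬ (moebiusConv φ =O[atTop] fun x : ℝ ↦ x ^ (-(1 / 2 : ℝ) - ε)) := by
  intro hG
  refine BaezDuarte2005Moebius_prop_4_3 hφ hN hne (hG.trans_isLittleO ?_)
  refine (isLittleO_iff_tendsto' ?_).2 ?_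
  · filter_upwards [eventually_gt_atTop (0 : ℝ)] with x hx h
    exact absurd h (Real.rpow_pos_of_pos hx _).ne'
  · refine (tendsto_rpow_neg_atTop hε).congr' ?_
    filter_upwards [eventually_gt_atTop (0 : ℝ)] with x hx
    rw [show -(1 / 2 : ℝ) - ε = -(1 / 2 : ℝ) + -ε by ring, Real.rpow_add hx,
      mul_div_cancel_left₀ _ (Real.rpow_pos_of_pos hx _).ne']

open BaezDuarteMellin in
/-- **On the range `ϑ ∈ [0, 1/2)` printed in IJMMS Thm. 4.4** (p. 3607, (4.14): for real
Mellin-proper `φ` "there exists `ϑ ∈ [0,1/2)` such that `liminf x^{ϑ+ε}Gφ(x) = −∞`,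
`limsup x^{ϑ+ε}Gφ(x) = +∞` for all `ε > 0`"; proof: "`f(s)` … with abscissa of convergence
`α ∈ (−1/2, 0]` … `ϑ = −α`"). Under RH, Thm. 3.5 gives `Gφ ≪ x^{−1/2+ε}` for every proper `φ`, so
the abscissa is `α = −1/2` and, as recorded here, for every `ϑ < 1/2` there is `ε > 0` with
`x^{ϑ+ε}|Gφ(x)| → 0`: the printed conclusion (4.14) then fails for every `ϑ ∈ [0,1/2)`. The printed
range thus carries the tacit hypothesis `α > −1/2` (under which the Landau argument runs); the
boundary case `α = −1/2`, `ϑ = 1/2`, is not covered by the printed proof ("it is obvious that `s = α`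
cannot be a singularity of `f(s)`" needs `φ^∧` near `s = −1/2`). A remark on the source, proved; it
asserts nothing about RH. [cite: BaezDuarte2005Moebius, Thm. 4.4 (4.14) and Thm. 3.5 (3.16) (IJMMS 2005:22 pp. 3604, 3607)] -/
theorem BaezDuarte2005Moebius_thm_4_4_range_of_riemannHypothesis (hRH : RiemannHypothesis)
    {φ : ℝ → ℂ} (hφ : IsMoebiusProper φ) {ϑ : ℝ} (hϑ : ϑ < 1 / 2) :
    ∃ ε : ℝ, 0 < ε ∧ Tendsto (fun x : ℝ => x ^ (ϑ + ε) * ‖moebiusConv φ x‖) atTop (𝓝 0) := by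
  set ε : ℝ := (1 / 2 - ϑ) / 3 with hε
  have hε0 : 0 < ε := by rw [hε]; linarith
  refine ⟨ε, hε0, ?_⟩
  have hG := moebiusConv_isBigO_of_riemannHypothesis hRH hφ hε0
  have h1 : (fun x : ℝ => x ^ (ϑ + ε) * ‖moebiusConv φ x‖) =O[atTop] fun x : ℝ => x ^ (-ε) := by
    have h2 : (fun x : ℝ => x ^ (ϑ + ε) * ‖moebiusConv φ x‖) =O[atTop]
        fun x : ℝ => x ^ (ϑ + ε) * x ^ (-(1 / 2 : ℝ) + ε) :=
      (isBigO_refl (fun x : ℝ => x ^ (ϑ + ε)) atTop).mul hG.norm_left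
    refine h2.trans (IsBigO.of_bound 1 ?_)
    filter_upwards [eventually_gt_atTop (0 : ℝ)] with x hx
    rw [← Real.rpow_add hx, show ϑ + ε + (-(1 / 2 : ℝ) + ε) = -ε by rw [hε]; ring, one_mul]
  exact h1.trans_tendsto (tendsto_rpow_neg_atTop hε0)

end Literature.NumberTheory.LFunctions

end
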